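import Literature.MathematicalPhysics.QuantumLattice.FermiRG.BGM2006Sec2Lemma21Proof
import Mathlib.Analysis.SpecialFunctions.PolarCoord
import Mathlib.MeasureTheory.Group.Integral
import Mathlib.MeasureTheory.Integral.Prod
import Mathlib.MeasureTheory.Integral.IntervalIntegral.Periodic
import HarnessLib

/-!
# Benfatto–Giuliani–Mastropietro 2006, Lemmas 2.2a and 2.2b — PROOF (discharge of
`BGM2006_Lemma_2_2a`, `BGM2006_Lemma_2_2b`)

Companion proof file of `BGM2006Sec2Setup.lean` (typer-wave file F1a of the cell `gate-hubbard-kl`;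
source BGM06 = G. Benfatto, A. Giuliani, V. Mastropietro, *Fermi liquid behavior in the 2D Hubbard model
at low temperatures*, Ann. Henri Poincaré **7** (2006) 809–898, arXiv:cond-mat/0507686, §2.4–§2.5;
locators `p00NN:Lnn` = chunk/line of the `lit read` render of the arXiv TeX).  The statement file
declares Lemma 2.2a (the tadpole value of the anisotropic sector propagator, `|g^{(h)}_ω(0)| ≤ Cγ^{5h/2}`,
(2.56a)) and Lemma 2.2b (the isotropic one, `|ḡ^{(h)}_ω̄(0)| ≤ Cγ^{3h}`, (2.60a)) as the named facts
`BGM2006_Lemma_2_2a`, `BGM2006_Lemma_2_2b : Prop` (FACT-LIST F-003, F-005); this file PROVES both,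
`theorem BGM2006_Lemma_2_2a_holds`, `theorem BGM2006_Lemma_2_2b_holds`, leaving the statement file
untouched.  Both are instances of ONE two-index estimate (`norm_bgmGenProp_zero_le`, angular index
`m`: the sector width `(3/2)πγ^{h/2}` resp. `(3/2)πγ^h` is the only difference, exactly as BGM say:
"to be proven via a repetition of the proof of Lemma 2.2 and Lemma 2.2a", p0011:L150).

## The printed proof (p0011:L48–L96) and how it is followed

BGM: "(2.56b) `g_ω(0) = ∫dθ ζ_{h,ω}(θ)∫dk₀ ρdρ f_h(k₀,ρe⃗_r(θ))/(-ik₀[1+a(θ)] + e_θ(ρ) + O(c₀γ^{2h}))`,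
where, referring to (2.43), `a(θ) = a_h(u_h(θ)e⃗_r(θ))`, `e_θ(ρ) = ε_h(ρe⃗_r(θ)) - ε_h(u_h(θ)e⃗_r(θ))`
(`e_θ(u_h(θ)) = 0`, `e_θ'(u_h(θ)) = O(1)`) … `f_h = f̃_h(√(k₀²[1+a]² + e²)) + f^R_h`, (2.56bb)
`f̃_h(t) = H₀(γ^{-h}t) - H₀(γ^{-h+1}t)`, `f^R_h = O(γ^h)` … (2.56d) the rest is `O(γ^{5h/2})` … (2.56c)
invert `e_θ(ρ) = e` … (2.56e) `ρ(e) = u_h(θ) + O(γ^h)`, `e_θ'(ρ(e)) = e_θ'(u) + O(γ^h)` … and, since the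
first integral `∫dk₀ de f̃_h(√(k₀²[1+a]²+e²))/(-ik₀[1+a]+e)` is zero by oddity, the Lemma is proved."

Accordingly (all sections are theorem-only; the objects are spelled out, no definitions):

* §1 generic tools: the fermionic Matsubara reflection `j ↦ -1-j` and oddity (`Σ'`/`∫` of an odd
  function vanish with NO summability/integrability hypothesis), the frequency count
  `(1/β)·#{k₀ ∈ D_β : |k₀| ≤ R} ≤ 4R/π` UNIFORMLY in `β` (if one frequency lies below `R` then
  `π/β ≤ R`), a discrete Taylor estimate on `ℤ`, the Lipschitz constant of `H₀`.
* §2 = the honest form of (2.43)–(2.44) on the Matsubara lattice (BGM after (2.43): "`a_h` is real …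
  `|a_h| ≤ C|U|` and `|r_h| ≤ C|U||h|γ^{2h}` for any `k` in the support of `f_h`"): by (2.36a)
  `Re E_{h-1}(·,k⃗)` is even and `Im E_{h-1}(·,k⃗)` odd in `k₀`, so
  `E_{h-1}(k₀,k⃗) = ε'(k⃗) - ik₀a(k⃗) + r(k)` with `ε' = Re E_{h-1}(π/β,·)`, `a = i∂_{k₀}E_{h-1}(-π/β,·)`
  REAL, and `r` the remainder of the two-node interpolation, controlled by the second DISCRETE
  time-derivatives of (2.36): `|r| ≤ ½M k₀²`, `M = 4|C₂|c₀²`; `|a| ≤ 2|C₁|c₀²`, `|∇a| ≤ 8|C₂|c₀²`,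
  `|E_{h-1} - ε₀| ≤ 2|C₀|c₀` (telescoping (2.36) as in `bgmEffDisp_perturbation`).
* §3 = (2.42a): `f_h(k) ≠ 0 ⟹ e₀γ^{h-2} ≤ |-ik₀ + E_{h-1}(k) - μ| ≤ 2e₀γ^h ⟹ |k₀| ≤ 8e₀γ^h`,
  `|ε_h(k⃗) - μ| ≤ 3e₀γ^h`; the scale-`h` Fermi radius `u = u_h(θ,0)` (t1 g4's `levelRadius_bounds`),
  the radial slope `λ = ∇ε_h·e⃗_r ≥ c₁'` and `|e_θ(ρ) - λ(ρ-u)| ≤ 3(ρ-u)²` (2.41a).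
* §4 measure-theoretic plumbing of (2.56b): translation by `p⃗_F`, polar coordinates
  (`integral_comp_polarCoord_symm`), Fubini, the sector weight `ζ_ω(θ(ρe⃗_r(θ))) = ζ_ω(θ)`.
* §5 the per-`θ` estimate.  ONE deviation from print, on the safe side and with the same mechanism:
  instead of Dini's inversion (2.56c) we LINEARISE `e_θ(ρ) ≈ λ(ρ - u)` and freeze `a` and the Jacobian
  at the Fermi point (all three replacements are relatively `O(γ^h)`, which is (2.56d)–(2.56e)); the
  model integrand `u·f̃_h(√(k₀²(1+a)² + λ²(ρ-u)²))/(-ik₀(1+a) + λ(ρ-u))` is EXACTLY odd under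
  `(k₀, ρ-u) ↦ (-k₀, -(ρ-u))`, so its Matsubara sum × `dρ`-integral vanishes ("zero by oddity"), and
  the difference is `O(1)` pointwise on a set of measure `(1/β)#k₀ × Δρ = O(γ^h)·O(γ^h)`.
* §6 assembly: `× ∫ζ_ω ≤ (3/2)·(sector width)` gives `γ^{2h}·γ^{h/2}` resp. `γ^{2h}·γ^h`; the finitely
  many scales above a `μ,e₀`-dependent threshold are covered by the crude bound `|g(0)| ≤ 512/π`;
  the two facts follow BY NAME.

Everything is proved; no definitions, no named facts, no `sorry`, no axioms beyond the standard three,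
no instances, no notation.

## Sources

* [BGM06] G. Benfatto, A. Giuliani, V. Mastropietro, Ann. Henri Poincaré 7 (2006) 809–898,
  arXiv:cond-mat/0507686, §2.4 (2.42a)–(2.44), §2.5 Lemmas 2.2a/2.2b and the proof of Lemma 2.2a
  (2.56b)–(2.56e). [BenfattoGiulianiMastropietro2006]
-/

noncomputable section

open Real Set Filter MeasureTheory
open scoped Topology

namespace Literature.MathematicalPhysics.QuantumLattice.FermiRG

/-! ### §1 Generic tools -/

section Generic

/-- Fermionic Matsubara frequencies are odd under the reflection `j ↦ -1-j`: `k₀(-1-j) = -k₀(j)`. [folklore] -/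
private theorem fermiMatsubara_reflect (β : ℝ) (j : ℤ) : fermiMatsubara β (-1 - j) = -fermiMatsubara β j := by
  simp only [fermiMatsubara]; push_cast; ring

/-- `k₀(j) = (2j+1)π/β`, the step to the next frequency is `2π/β`. [folklore] -/
private theorem fermiMatsubara_add_one (β : ℝ) (j : ℤ) :
    fermiMatsubara β (j + 1) = fermiMatsubara β j + 2 * π / β := by
  simp only [fermiMatsubara]; push_cast; ring

/-- `k₀(0) = π/β`. [folklore] -/
private theorem fermiMatsubara_zero (β : ℝ) : fermiMatsubara β 0 = π / β := by
  simp [fermiMatsubara]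

/-- `k₀(-1) = -π/β`. [folklore] -/
private theorem fermiMatsubara_neg_one (β : ℝ) : fermiMatsubara β (-1) = -(π / β) := by
  simp [fermiMatsubara]; ring

/-- Every Matsubara frequency lies in `D_β`. [folklore] -/
private theorem fermiMatsubara_mem (β : ℝ) (j : ℤ) : fermiMatsubara β j ∈ matsubaraSet β := ⟨j, rfl⟩

/-- An odd complex function on `ℝ` has integral zero (no integrability needed). [folklore] -/
private theorem integral_eq_zero_of_odd' (f : ℝ → ℂ) (hf : ∀ x, f (-x) = -f x) : ∫ x, f x = 0 := by
  have h1 : ∫ x, f (-x) = ∫ x, f x := integral_neg_eq_self f volume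
  have h2 : ∫ x, f (-x) = -∫ x, f x := by
    rw [← integral_neg]; exact integral_congr_ae (Eventually.of_forall hf)
  exact self_eq_neg.mp (h1.symm.trans h2)

/-- A finite sum over a set of integers stable under `j ↦ -1-j` of a family odd under that reflection
vanishes (the discrete half of "zero by oddity"). [folklore] -/
private theorem sum_eq_zero_of_reflect {S : Finset ℤ} (hS : ∀ j ∈ S, -1 - j ∈ S) (F : ℤ → ℂ)
    (hF : ∀ j ∈ S, F (-1 - j) = -F j) : ∑ j ∈ S, F j = 0 := by
  have h1 : ∑ j ∈ S, F j = ∑ j ∈ S, F (-1 - j) := by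
    refine Finset.sum_nbij' (fun j => -1 - j) (fun j => -1 - j) hS hS (fun j _ => by ring)
      (fun j _ => by ring) (fun j _ => by simp)
  have h2 : ∑ j ∈ S, F (-1 - j) = -∑ j ∈ S, F j := by
    rw [← Finset.sum_neg_distrib]; exact Finset.sum_congr rfl hF
  exact self_eq_neg.mp (h1.trans h2)

/-- **The frequency count, uniform in `β`**: if every `j ∈ S` has `|k₀(j)| ≤ R` then
`(1/β)·#S ≤ 4R/π` — for if `S` is non-empty then `π/β ≤ R`. [cite: BenfattoGiulianiMastropietro2006, §2.3 (2.31a) p0007:L137] -/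
private theorem inv_beta_mul_card_le {β R : ℝ} (hβ : 0 < β) (hR : 0 ≤ R) (S : Finset ℤ)
    (hS : ∀ j ∈ S, |fermiMatsubara β j| ≤ R) : 1 / β * (S.card : ℝ) ≤ 4 * R / π := by
  rcases S.eq_empty_or_nonempty with hSe | ⟨j, hj⟩
  · rw [hSe, Finset.card_empty, Nat.cast_zero, mul_zero]; positivity
  · have h1 : π / β ≤ R := (pi_div_le_abs_fermiMatsubara hβ j).trans (hS j hj)
    have hcard := card_fermiMatsubara_le hβ hR S hS
    have h3 : (3 : ℝ) ≤ 3 * (R * β / π) := by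
      rw [div_le_iff₀ hβ] at h1
      have : 1 ≤ R * β / π := by rw [le_div_iff₀ Real.pi_pos]; linarith
      linarith
    have h4 : (S.card : ℝ) ≤ 4 * (R * β / π) := by linarith
    calc 1 / β * (S.card : ℝ) ≤ 1 / β * (4 * (R * β / π)) :=
          mul_le_mul_of_nonneg_left h4 (by positivity)
      _ = 4 * R / π := by field_simp

/-- **Discrete Taylor estimate at two nodes**: for `φ : ℕ → ℂ` with second differences bounded by
`M`, `‖φ n - φ 0 - n(φ 1 - φ 0)‖ ≤ M·n(n-1)/2`. [folklore] -/
private theorem norm_sub_sub_smul_le_of_second_diff {φ : ℕ → ℂ} {M : ℝ}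
    (hM : ∀ i, ‖φ (i + 2) - 2 * φ (i + 1) + φ i‖ ≤ M) (n : ℕ) :
    ‖φ n - φ 0 - (n : ℂ) * (φ 1 - φ 0)‖ ≤ M * ((n : ℝ) * ((n : ℝ) - 1) / 2) := by
  -- first differences `ψ i = φ (i+1) - φ i` drift by at most `M` per step
  set ψ : ℕ → ℂ := fun i => φ (i + 1) - φ i with hψ
  have hdrift : ∀ i : ℕ, ‖ψ i - ψ 0‖ ≤ M * i := by
    intro i
    have htel : ψ i - ψ 0 = ∑ l ∈ Finset.range i, (ψ (l + 1) - ψ l) :=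
      (Finset.sum_range_sub ψ i).symm
    rw [htel]
    calc ‖∑ l ∈ Finset.range i, (ψ (l + 1) - ψ l)‖ ≤ ∑ l ∈ Finset.range i, ‖ψ (l + 1) - ψ l‖ :=
          norm_sum_le _ _
      _ ≤ ∑ _l ∈ Finset.range i, M := Finset.sum_le_sum fun l _ => by
          have : ψ (l + 1) - ψ l = φ (l + 2) - 2 * φ (l + 1) + φ l := by
            simp only [hψ, add_assoc, one_add_one_eq_two]; ring
          rw [this]; exact hM l
      _ = M * i := by rw [Finset.sum_const, Finset.card_range, nsmul_eq_mul, mul_comm]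
  have htel2 : φ n - φ 0 = ∑ i ∈ Finset.range n, ψ i := (Finset.sum_range_sub φ n).symm
  have hmain : φ n - φ 0 - (n : ℂ) * (φ 1 - φ 0) = ∑ i ∈ Finset.range n, (ψ i - ψ 0) := by
    rw [Finset.sum_sub_distrib, ← htel2, Finset.sum_const, Finset.card_range, nsmul_eq_mul]
  rw [hmain]
  calc ‖∑ i ∈ Finset.range n, (ψ i - ψ 0)‖ ≤ ∑ i ∈ Finset.range n, ‖ψ i - ψ 0‖ := norm_sum_le _ _
    _ ≤ ∑ i ∈ Finset.range n, M * (i : ℝ) := Finset.sum_le_sum fun i _ => hdrift i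
    _ = M * ∑ i ∈ Finset.range n, (i : ℝ) := by rw [Finset.mul_sum]
    _ = M * ((n : ℝ) * ((n : ℝ) - 1) / 2) := by
        congr 1
        have h := Finset.sum_range_id_mul_two n
        have h' : ((∑ i ∈ Finset.range n, i : ℕ) : ℝ) * 2 = (n : ℝ) * ((n : ℝ) - 1) := by
          have : ((n * (n - 1) : ℕ) : ℝ) = (n : ℝ) * ((n : ℝ) - 1) := by
            rcases Nat.eq_zero_or_pos n with hn | hn
            · subst hn; simp
            · rw [Nat.cast_mul, Nat.cast_sub hn]; simp
          rw [← this]; exact_mod_cast h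
        rw [Nat.cast_sum] at h'
        linarith

/-- **`H₀` is Lipschitz**: `|H₀(s) - H₀(t)| ≤ L|s - t|` with `L = sup|H₀'|`. [folklore] -/
private theorem exists_lipschitz_gnCutoff {e₀ : ℝ} (he : 0 < e₀) :
    ∃ L : ℝ, 0 ≤ L ∧ ∀ s t : ℝ, |gnCutoff 4 e₀ s - gnCutoff 4 e₀ t| ≤ L * |s - t| := by
  obtain ⟨L, hL0, hL⟩ := exists_bound_iteratedDeriv_gnCutoff (γ := (4 : ℝ)) (by norm_num) he 1
  refine ⟨L, hL0, fun s t => ?_⟩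
  have hd : Differentiable ℝ (gnCutoff 4 e₀) := (contDiff_gnCutoff 4 e₀ (m := 1)).differentiable (by simp)
  have h := Convex.norm_image_sub_le_of_norm_hasDerivWithin_le (s := Set.univ) (f := gnCutoff 4 e₀)
    (f' := deriv (gnCutoff 4 e₀)) (fun x _ => (hd x).hasDerivAt.hasDerivWithinAt)
    (fun x _ => by rw [← iteratedDeriv_one]; exact (Real.norm_eq_abs _).le.trans (hL x))
    convex_univ (Set.mem_univ t) (Set.mem_univ s)
  simpa [Real.norm_eq_abs] using h

/-- The scaled cutoff `C_h⁻¹(t) = H₀(4^{-h}t)` is `L4^{-h}`-Lipschitz. [folklore] -/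
private theorem abs_gnScaleCutoff_sub_le {e₀ L : ℝ} (hL : ∀ s t : ℝ, |gnCutoff 4 e₀ s - gnCutoff 4 e₀ t| ≤ L * |s - t|)
    (h : ℤ) (s t : ℝ) :
    |gnScaleCutoff 4 e₀ h s - gnScaleCutoff 4 e₀ h t| ≤ L * (4 : ℝ) ^ (-h) * |s - t| := by
  have h1 := hL ((4 : ℝ) ^ (-h) * s) ((4 : ℝ) ^ (-h) * t)
  rw [← mul_sub, abs_mul, abs_of_pos (zpow_pos (by norm_num : (0 : ℝ) < 4) _)] at h1
  simpa [gnScaleCutoff, mul_assoc] using h1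

end Generic


/-! ### §2 The `k₀`-structure of `E_{h-1}` on the Matsubara lattice: (2.43)–(2.44) made honest -/

section KZero

variable {β U : ℝ} {C : ℕ → ℝ} {hβ : ℤ} {E : ℤ → ℝ × (Fin 2 → ℝ) → ℂ}

/-- `m · 4^{-m} ≤ (1/2)^m`. [folklore] -/
private theorem mul_zpow_neg_le_half_pow' (m : ℕ) : (m : ℝ) * (4 : ℝ) ^ (-(m : ℤ)) ≤ (1 / 2 : ℝ) ^ m := by
  have hm : (m : ℝ) ≤ 2 ^ m := by exact_mod_cast (Nat.lt_two_pow_self).le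
  rw [zpow_neg, zpow_natCast]
  have h4 : (4 : ℝ) ^ m = 2 ^ m * 2 ^ m := by rw [← mul_pow]; norm_num
  rw [h4, one_div, inv_pow]
  have h2 : (0 : ℝ) < 2 ^ m := by positivity
  rw [mul_inv, ← mul_assoc]
  calc (m : ℝ) * (2 ^ m)⁻¹ * (2 ^ m)⁻¹ ≤ 2 ^ m * (2 ^ m)⁻¹ * (2 ^ m)⁻¹ := by gcongr
    _ = (2 ^ m)⁻¹ := by rw [mul_inv_cancel₀ h2.ne', one_mul]

/-- `Σ_{m<n} m 4^{-m} ≤ 2`. [folklore] -/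
private theorem sum_mul_zpow_neg_le' (n : ℕ) : ∑ m ∈ Finset.range n, (m : ℝ) * (4 : ℝ) ^ (-(m : ℤ)) ≤ 2 :=
  (Finset.sum_le_sum fun m _ => mul_zpow_neg_le_half_pow' m).trans (sum_geometric_two_le n)

/-- `Σ_{m<n} m 4^{-2m} ≤ 2`. [folklore] -/
private theorem sum_mul_zpow_neg_two_le' (n : ℕ) :
    ∑ m ∈ Finset.range n, (m : ℝ) * (4 : ℝ) ^ (2 * (-(m : ℤ))) ≤ 2 := by
  refine (Finset.sum_le_sum fun m _ => ?_).trans (sum_geometric_two_le n)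
  have hle : (4 : ℝ) ^ (2 * (-(m : ℤ))) ≤ (4 : ℝ) ^ (-(m : ℤ)) := by
    apply zpow_le_zpow_right₀ (by norm_num : (1 : ℝ) ≤ 4); omega
  exact (mul_le_mul_of_nonneg_left hle (Nat.cast_nonneg m)).trans (mul_zpow_neg_le_half_pow' m)

/-- `Σ_{m<n} m ≤ n²`. [folklore] -/
private theorem sum_range_cast_le_sq' (n : ℕ) : ∑ m ∈ Finset.range n, (m : ℝ) ≤ (n : ℝ) ^ 2 := by
  calc ∑ m ∈ Finset.range n, (m : ℝ) ≤ ∑ _m ∈ Finset.range n, (n : ℝ) :=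
        Finset.sum_le_sum fun m hm => by exact_mod_cast (Finset.mem_range.1 hm).le
    _ = (n : ℝ) ^ 2 := by simp [sq]

/-- **(2.36aa), first discrete time derivative, explicitly**:
`∂_{k₀}f(k₀,k⃗) = (β/2π)[f(k₀ + 2π/β, k⃗) - f(k₀, k⃗)]`. [cite: BenfattoGiulianiMastropietro2006, §2.3 (2.36aa) p0008:L55] -/
theorem bgmTimeDiffIter_one_apply (β : ℝ) (f : ℝ × (Fin 2 → ℝ) → ℂ) (k₀ : ℝ) (q : Fin 2 → ℝ) :
    bgmTimeDiffIter β 1 f (k₀, q) = ((β / (2 * π) : ℝ)) • (f (k₀ + 2 * π / β, q) - f (k₀, q)) := by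
  simp only [bgmTimeDiffIter, List.replicate, bgmDiffIter, bgmDiff, bgmStep, bgmShift, if_true,
    Prod.mk_add_mk, add_zero]
  congr 1
  rw [inv_div]

/-- **(2.36aa), second discrete time derivative, explicitly**:
`∂_{k₀}²f(k₀,k⃗) = (β/2π)²[f(k₀ + 4π/β) - 2f(k₀ + 2π/β) + f(k₀)]`. [cite: BenfattoGiulianiMastropietro2006, §2.3 (2.36aa) p0008:L55] -/
theorem bgmTimeDiffIter_two_apply (β : ℝ) (f : ℝ × (Fin 2 → ℝ) → ℂ) (k₀ : ℝ) (q : Fin 2 → ℝ) :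
    bgmTimeDiffIter β 2 f (k₀, q) =
      (((β / (2 * π)) ^ 2 : ℝ)) • (f (k₀ + 2 * π / β + 2 * π / β, q) - 2 * f (k₀ + 2 * π / β, q) + f (k₀, q)) := by
  have h1 : bgmTimeDiffIter β 2 f (k₀, q) = bgmDiff β 1 0 (bgmTimeDiffIter β 1 f) (k₀, q) := rfl
  rw [h1]
  simp only [bgmDiff, bgmStep, bgmShift, if_true, Prod.mk_add_mk, add_zero, bgmTimeDiffIter_one_apply,
    inv_div, ← smul_sub, smul_smul, sq]
  congr 1
  ring

/-- The three discrete-time clauses of (2.36) at scale `j = -m`, read off `BGMSmoothness`: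
`|∂_{k₀}(E_j - E_{j-1})| ≤ C₁U²|j|γ^j`, `|∂²_{k₀}(E_j - E_{j-1})| ≤ C₂U²|j|`,
`|∂_{kᵢ}∂_{k₀}(E_j - E_{j-1})| ≤ C₂U²|j|`. [cite: BenfattoGiulianiMastropietro2006, §2.3 (2.36) p0008:L46] -/
theorem bgm_time_diff_bounds (hS : BGMSmoothness β U C hβ E) {m : ℕ} (hm : hβ ≤ -(m : ℤ))
    {k₀ : ℝ} (hk₀ : k₀ ∈ matsubaraSet β) (q : Fin 2 → ℝ) :
    ‖bgmTimeDiffIter β 1 (fun p => E (-(m : ℤ)) p - E (-(m : ℤ) - 1) p) (k₀, q)‖ ≤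
        |C 1| * U ^ 2 * ((m : ℝ) * (4 : ℝ) ^ (-(m : ℤ))) ∧
    ‖bgmTimeDiffIter β 2 (fun p => E (-(m : ℤ)) p - E (-(m : ℤ) - 1) p) (k₀, q)‖ ≤ |C 2| * U ^ 2 * (m : ℝ) ∧
    (∀ i : Fin 2, ‖fderiv ℝ (fun k' => bgmTimeDiffIter β 1 (fun p => E (-(m : ℤ)) p - E (-(m : ℤ) - 1) p) (k₀, k')) q
        (Pi.single i 1)‖ ≤ |C 2| * U ^ 2 * (m : ℝ)) := by
  obtain ⟨-, -, hS3⟩ := hS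
  obtain ⟨-, hbd⟩ := hS3 (-(m : ℤ)) hm (by omega)
  have hcast : |(((-(m : ℤ)) : ℤ) : ℝ)| = m := by push_cast; rw [abs_neg, Nat.abs_cast]
  have hmpos : (0 : ℝ) ≤ m := Nat.cast_nonneg m
  refine ⟨?_, ?_, fun i => ?_⟩
  · have h := hbd 1 0 (by norm_num) Fin.elim0 k₀ hk₀ q
    have e : mixedPartial Fin.elim0
        (fun k' => bgmTimeDiffIter β 1 (fun p => E (-(m : ℤ)) p - E (-(m : ℤ) - 1) p) (k₀, k')) q =
        bgmTimeDiffIter β 1 (fun p => E (-(m : ℤ)) p - E (-(m : ℤ) - 1) p) (k₀, q) := by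
      simp only [mixedPartial, iteratedFDeriv_zero_apply]
    have hexp : (2 - ((1 + 0 : ℕ) : ℤ)) * (-(m : ℤ)) = -(m : ℤ) := by push_cast; ring
    rw [e, hcast, hexp, add_zero] at h
    calc _ ≤ C 1 * |U| ^ 2 * m * (4 : ℝ) ^ (-(m : ℤ)) := h
      _ = C 1 * (U ^ 2 * (m * (4 : ℝ) ^ (-(m : ℤ)))) := by rw [sq_abs]; ring
      _ ≤ |C 1| * (U ^ 2 * (m * (4 : ℝ) ^ (-(m : ℤ)))) :=
          mul_le_mul_of_nonneg_right (le_abs_self _) (by positivity)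
      _ = _ := by ring
  · have h := hbd 2 0 (by norm_num) Fin.elim0 k₀ hk₀ q
    have e : mixedPartial Fin.elim0
        (fun k' => bgmTimeDiffIter β 2 (fun p => E (-(m : ℤ)) p - E (-(m : ℤ) - 1) p) (k₀, k')) q =
        bgmTimeDiffIter β 2 (fun p => E (-(m : ℤ)) p - E (-(m : ℤ) - 1) p) (k₀, q) := by
      simp only [mixedPartial, iteratedFDeriv_zero_apply]
    have hexp : (2 - ((2 + 0 : ℕ) : ℤ)) * (-(m : ℤ)) = 0 := by push_cast; ring
    rw [e, hcast, hexp, zpow_zero, mul_one, add_zero] at h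
    calc _ ≤ C 2 * |U| ^ 2 * m := h
      _ = C 2 * (U ^ 2 * m) := by rw [sq_abs]; ring
      _ ≤ |C 2| * (U ^ 2 * m) := mul_le_mul_of_nonneg_right (le_abs_self _) (by positivity)
      _ = _ := by ring
  · have h := hbd 1 1 (by norm_num) (fun _ => i) k₀ hk₀ q
    have e : mixedPartial (fun _ : Fin 1 => i)
        (fun k' => bgmTimeDiffIter β 1 (fun p => E (-(m : ℤ)) p - E (-(m : ℤ) - 1) p) (k₀, k')) q =
        fderiv ℝ (fun k' => bgmTimeDiffIter β 1 (fun p => E (-(m : ℤ)) p - E (-(m : ℤ) - 1) p) (k₀, k')) q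
          (Pi.single i 1) := by
      simp only [mixedPartial, iteratedFDeriv_one_apply]
    have hexp : (2 - ((1 + 1 : ℕ) : ℤ)) * (-(m : ℤ)) = 0 := by push_cast; ring
    rw [e, hcast, hexp, zpow_zero, mul_one] at h
    calc _ ≤ C 2 * |U| ^ 2 * m := h
      _ = C 2 * (U ^ 2 * m) := by rw [sq_abs]; ring
      _ ≤ |C 2| * (U ^ 2 * m) := mul_le_mul_of_nonneg_right (le_abs_self _) (by positivity)
      _ = _ := by ring

/-- **`|E_{h'} - ε₀| ≤ 2C₀|U|` on the Matsubara lattice** ((2.42): `|E_h(k) - E_0(k)| ≤ C₀'|U|`), for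
`h_β - 1 ≤ h' ≤ 0`. [cite: BenfattoGiulianiMastropietro2006, §2.4 (2.42) p0009:L101] -/
theorem norm_E_sub_sqDispersion_le (hI : BGMInitial E) (hS : BGMSmoothness β U C hβ E) {h' : ℤ}
    (hh₁ : hβ - 1 ≤ h') (hh₀ : h' ≤ 0) {k₀ : ℝ} (hk₀ : k₀ ∈ matsubaraSet β) (q : Fin 2 → ℝ) :
    ‖E h' (k₀, q) - ((sqDispersion q : ℝ) : ℂ)‖ ≤ 2 * |C 0| * |U| := by
  set n := (-h').toNat with hn
  have hmem : ∀ m ∈ Finset.range n, hβ ≤ -(m : ℤ) := fun m hm => by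
    have := Finset.mem_range.1 hm; omega
  rw [bgm_telescope E hh₀ (k₀, q), hI]
  simp only [sub_sub_cancel_left, norm_neg]
  calc ‖∑ m ∈ Finset.range n, (E (-(m : ℤ)) (k₀, q) - E (-(m : ℤ) - 1) (k₀, q))‖
      ≤ ∑ m ∈ Finset.range n, ‖E (-(m : ℤ)) (k₀, q) - E (-(m : ℤ) - 1) (k₀, q)‖ := norm_sum_le _ _
    _ ≤ ∑ m ∈ Finset.range n, |C 0| * |U| * ((m : ℝ) * (4 : ℝ) ^ (2 * (-(m : ℤ)))) :=
        Finset.sum_le_sum fun m hm => (bgm_diff_bounds hS (hmem m hm) hk₀ q).1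
    _ = |C 0| * |U| * ∑ m ∈ Finset.range n, (m : ℝ) * (4 : ℝ) ^ (2 * (-(m : ℤ))) := by rw [Finset.mul_sum]
    _ ≤ |C 0| * |U| * 2 := by gcongr; exact sum_mul_zpow_neg_two_le' n
    _ = 2 * |C 0| * |U| := by ring

/-- The first time-difference of `E_{h'}` is minus the sum of those of the increments (`E_0 ≡ ε₀` has
none). [cite: BenfattoGiulianiMastropietro2006, §2.4 proof of Lemma 2.1 p0009:L77] -/
private theorem bgmTimeDiffIter_one_telescope (hI : BGMInitial E) {h' : ℤ} (hh₀ : h' ≤ 0) (k₀ : ℝ)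
    (q : Fin 2 → ℝ) :
    bgmTimeDiffIter β 1 (E h') (k₀, q) = -∑ m ∈ Finset.range (-h').toNat,
      bgmTimeDiffIter β 1 (fun p => E (-(m : ℤ)) p - E (-(m : ℤ) - 1) p) (k₀, q) := by
  simp only [bgmTimeDiffIter_one_apply]
  rw [bgm_telescope E hh₀ (k₀ + 2 * π / β, q), bgm_telescope E hh₀ (k₀, q), hI, hI]
  simp only [Finset.sum_sub_distrib, ← Finset.smul_sum, smul_sub]
  ring

/-- **`|∂_{k₀}E_{h'}| ≤ 2C₁U²` on the Matsubara lattice** (the bound "`|a_h| ≤ C|U|`" after (2.43), in the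
sharper form the inductive hypothesis gives). [cite: BenfattoGiulianiMastropietro2006, §2.4 (2.43)–(2.44) p0010:L1–L4] -/
theorem norm_bgmTimeDiffIter_one_le (hI : BGMInitial E) (hS : BGMSmoothness β U C hβ E) {h' : ℤ}
    (hh₁ : hβ - 1 ≤ h') (hh₀ : h' ≤ 0) {k₀ : ℝ} (hk₀ : k₀ ∈ matsubaraSet β) (q : Fin 2 → ℝ) :
    ‖bgmTimeDiffIter β 1 (E h') (k₀, q)‖ ≤ 2 * |C 1| * U ^ 2 := by
  set n := (-h').toNat with hn
  have hmem : ∀ m ∈ Finset.range n, hβ ≤ -(m : ℤ) := fun m hm => by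
    have := Finset.mem_range.1 hm; omega
  rw [bgmTimeDiffIter_one_telescope hI hh₀, norm_neg]
  calc _ ≤ ∑ m ∈ Finset.range n, ‖bgmTimeDiffIter β 1 (fun p => E (-(m : ℤ)) p - E (-(m : ℤ) - 1) p) (k₀, q)‖ :=
        norm_sum_le _ _
    _ ≤ ∑ m ∈ Finset.range n, |C 1| * U ^ 2 * ((m : ℝ) * (4 : ℝ) ^ (-(m : ℤ))) :=
        Finset.sum_le_sum fun m hm => (bgm_time_diff_bounds hS (hmem m hm) hk₀ q).1
    _ = |C 1| * U ^ 2 * ∑ m ∈ Finset.range n, (m : ℝ) * (4 : ℝ) ^ (-(m : ℤ)) := by rw [Finset.mul_sum]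
    _ ≤ |C 1| * U ^ 2 * 2 := by gcongr; exact sum_mul_zpow_neg_le' n
    _ = 2 * |C 1| * U ^ 2 := by ring

/-- **`|∂²_{k₀}E_{h'}| ≤ C₂U²h'²` on the Matsubara lattice** (the second discrete time derivatives, which
control the interpolation remainder `r_h` of (2.43)). [cite: BenfattoGiulianiMastropietro2006, §2.4 (2.42)–(2.43) p0009:L101–p0010:L4] -/
theorem norm_bgmTimeDiffIter_two_le (hI : BGMInitial E) (hS : BGMSmoothness β U C hβ E) {h' : ℤ}
    (hh₁ : hβ - 1 ≤ h') (hh₀ : h' ≤ 0) {k₀ : ℝ} (hk₀ : k₀ ∈ matsubaraSet β) (q : Fin 2 → ℝ) :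
    ‖bgmTimeDiffIter β 2 (E h') (k₀, q)‖ ≤ |C 2| * U ^ 2 * (h' : ℝ) ^ 2 := by
  set n := (-h').toNat with hn
  have hnz : ((n : ℕ) : ℤ) = -h' := Int.toNat_of_nonneg (by omega)
  have hnr : (n : ℝ) = -(h' : ℝ) := by exact_mod_cast hnz
  have hmem : ∀ m ∈ Finset.range n, hβ ≤ -(m : ℤ) := fun m hm => by
    have := Finset.mem_range.1 hm; omega
  have hfun : bgmTimeDiffIter β 1 (E h') = fun p => -∑ m ∈ Finset.range n,
      bgmTimeDiffIter β 1 (fun p => E (-(m : ℤ)) p - E (-(m : ℤ) - 1) p) p := by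
    funext p
    obtain ⟨k₀', q'⟩ := p
    exact bgmTimeDiffIter_one_telescope hI hh₀ k₀' q'
  have htel : bgmTimeDiffIter β 2 (E h') (k₀, q) = -∑ m ∈ Finset.range n,
      bgmTimeDiffIter β 2 (fun p => E (-(m : ℤ)) p - E (-(m : ℤ) - 1) p) (k₀, q) := by
    change bgmTimeDiffIter β 1 (bgmTimeDiffIter β 1 (E h')) (k₀, q) =
      -∑ m ∈ Finset.range n, bgmTimeDiffIter β 1
        (bgmTimeDiffIter β 1 (fun p => E (-(m : ℤ)) p - E (-(m : ℤ) - 1) p)) (k₀, q)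
    rw [hfun, bgmTimeDiffIter_one_apply]
    simp only [bgmTimeDiffIter_one_apply, smul_sub, smul_neg, Finset.smul_sum, Finset.sum_sub_distrib]
    abel
  rw [htel, norm_neg]
  calc _ ≤ ∑ m ∈ Finset.range n, ‖bgmTimeDiffIter β 2 (fun p => E (-(m : ℤ)) p - E (-(m : ℤ) - 1) p) (k₀, q)‖ :=
        norm_sum_le _ _
    _ ≤ ∑ m ∈ Finset.range n, |C 2| * U ^ 2 * (m : ℝ) :=
        Finset.sum_le_sum fun m hm => (bgm_time_diff_bounds hS (hmem m hm) hk₀ q).2.1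
    _ = |C 2| * U ^ 2 * ∑ m ∈ Finset.range n, (m : ℝ) := by rw [Finset.mul_sum]
    _ ≤ |C 2| * U ^ 2 * (n : ℝ) ^ 2 := by gcongr; exact sum_range_cast_le_sq' n
    _ = |C 2| * U ^ 2 * (h' : ℝ) ^ 2 := by rw [hnr, neg_sq]

/-- **`|∂_{kᵢ}∂_{k₀}E_{h'}| ≤ C₂U²h'²`** (the mixed derivatives, which make `a_h(k⃗)` Lipschitz in `k⃗`). [cite: BenfattoGiulianiMastropietro2006, §2.4 (2.42) p0009:L101] -/
theorem norm_fderiv_bgmTimeDiffIter_one_le (hI : BGMInitial E) (hS : BGMSmoothness β U C hβ E) {h' : ℤ}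
    (hh₁ : hβ - 1 ≤ h') (hh₀ : h' ≤ 0) {k₀ : ℝ} (hk₀ : k₀ ∈ matsubaraSet β) (q : Fin 2 → ℝ) (i : Fin 2) :
    DifferentiableAt ℝ (fun k' => bgmTimeDiffIter β 1 (E h') (k₀, k')) q ∧
    ‖fderiv ℝ (fun k' => bgmTimeDiffIter β 1 (E h') (k₀, k')) q (Pi.single i 1)‖ ≤
      |C 2| * U ^ 2 * (h' : ℝ) ^ 2 := by
  set n := (-h').toNat with hn
  have hnz : ((n : ℕ) : ℤ) = -h' := Int.toNat_of_nonneg (by omega)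
  have hnr : (n : ℝ) = -(h' : ℝ) := by exact_mod_cast hnz
  have hmem : ∀ m ∈ Finset.range n, hβ ≤ -(m : ℤ) := fun m hm => by
    have := Finset.mem_range.1 hm; omega
  have hS1 := hS.1
  -- the slices are smooth, hence so are the increments' time differences
  set G : ℕ → (Fin 2 → ℝ) → ℂ := fun m k' =>
    bgmTimeDiffIter β 1 (fun p => E (-(m : ℤ)) p - E (-(m : ℤ) - 1) p) (k₀, k') with hG
  have hGd : ∀ m, Differentiable ℝ (G m) := by
    intro m
    have e : G m = fun k' => ((β / (2 * π) : ℝ)) •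
        ((E (-(m : ℤ)) (k₀ + 2 * π / β, k') - E (-(m : ℤ) - 1) (k₀ + 2 * π / β, k')) -
          (E (-(m : ℤ)) (k₀, k') - E (-(m : ℤ) - 1) (k₀, k'))) := by
      funext k'; simp only [hG, bgmTimeDiffIter_one_apply]
    rw [e]
    exact ((((hS1 _ _ 1).differentiable (by simp)).sub ((hS1 _ _ 1).differentiable (by simp))).sub
      (((hS1 _ _ 1).differentiable (by simp)).sub ((hS1 _ _ 1).differentiable (by simp)))).const_smul ((β / (2 * π) : ℝ))
  have hfun : (fun k' => bgmTimeDiffIter β 1 (E h') (k₀, k')) = fun k' => -∑ m ∈ Finset.range n, G m k' := by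
    funext k'; rw [bgmTimeDiffIter_one_telescope hI hh₀]
  have hsumd : DifferentiableAt ℝ (fun k' => ∑ m ∈ Finset.range n, G m k') q :=
    (DifferentiableAt.fun_sum fun m _ => (hGd m q))
  refine ⟨by rw [hfun]; exact hsumd.neg, ?_⟩
  rw [hfun, fderiv_fun_neg, fderiv_fun_sum fun m _ => (hGd m q)]
  rw [neg_apply, norm_neg, sum_apply]
  calc _ ≤ ∑ m ∈ Finset.range n, ‖fderiv ℝ (G m) q (Pi.single i 1)‖ := norm_sum_le _ _
    _ ≤ ∑ m ∈ Finset.range n, |C 2| * U ^ 2 * (m : ℝ) :=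
        Finset.sum_le_sum fun m hm => (bgm_time_diff_bounds hS (hmem m hm) hk₀ q).2.2 i
    _ = |C 2| * U ^ 2 * ∑ m ∈ Finset.range n, (m : ℝ) := by rw [Finset.mul_sum]
    _ ≤ |C 2| * U ^ 2 * (n : ℝ) ^ 2 := by gcongr; exact sum_range_cast_le_sq' n
    _ = |C 2| * U ^ 2 * (h' : ℝ) ^ 2 := by rw [hnr, neg_sq]

/-- (2.36a): `E_{h'}(-k₀, k⃗) = E_{h'}(k₀, k⃗)^*`. [cite: BenfattoGiulianiMastropietro2006, §2.3 (2.36a) p0008:L70] -/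
theorem E_neg_eq_conj (hSy : BGMSymmetry E) (h' : ℤ) (k₀ : ℝ) (q : Fin 2 → ℝ) :
    E h' (-k₀, q) = (starRingEnd ℂ) (E h' (k₀, q)) := by
  have h := (hSy h' k₀ q).2
  rw [h, Complex.conj_conj]

/-- `Re E_{h'}` is even in `k₀`. [cite: BenfattoGiulianiMastropietro2006, §2.3 (2.36a) p0008:L70] -/
theorem re_E_neg (hSy : BGMSymmetry E) (h' : ℤ) (k₀ : ℝ) (q : Fin 2 → ℝ) :
    (E h' (-k₀, q)).re = (E h' (k₀, q)).re := by
  rw [E_neg_eq_conj hSy, Complex.conj_re]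

/-- `Im E_{h'}` is odd in `k₀`. [cite: BenfattoGiulianiMastropietro2006, §2.3 (2.36a) p0008:L70] -/
theorem im_E_neg (hSy : BGMSymmetry E) (h' : ℤ) (k₀ : ℝ) (q : Fin 2 → ℝ) :
    (E h' (-k₀, q)).im = -(E h' (k₀, q)).im := by
  rw [E_neg_eq_conj hSy, Complex.conj_im]

/-- Under (2.36a), `ε_h(k⃗) = Re E_h(π/β, k⃗)` (the printed average of `E_h(±π/β, ·)` is its real part). [cite: BenfattoGiulianiMastropietro2006, §2.4 (2.36c) p0008:L112] -/
theorem bgmEffDisp_eq_re (hSy : BGMSymmetry E) (β : ℝ) (h' : ℤ) (q : Fin 2 → ℝ) :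
    bgmEffDisp β E h' q = (E h' (π / β, q)).re := by
  rw [bgmEffDisp, Complex.div_re]
  simp only [Complex.add_re, re_E_neg hSy]
  norm_num
  ring

/-- `E_{h'}(π/β) - E_{h'}(-π/β) = 2i·Im E_{h'}(π/β)`. [cite: BenfattoGiulianiMastropietro2006, §2.3 (2.36a) p0008:L70] -/
private theorem E_sub_E_neg (hSy : BGMSymmetry E) (h' : ℤ) (k₀ : ℝ) (q : Fin 2 → ℝ) :
    E h' (k₀, q) - E h' (-k₀, q) = 2 * Complex.I * ((E h' (k₀, q)).im : ℂ) := by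
  rw [E_neg_eq_conj hSy, Complex.sub_conj]
  push_cast
  ring

/-- **(2.44)**: the first time-difference at `-π/β` is `i(β/π)·Im E_{h'}(π/β, k⃗)`, i.e.
`a(k⃗) := -(β/π)Im E_{h'}(π/β,k⃗) = i∂_{k₀}E_{h'}(-π/β,k⃗)` and `a` is REAL. [cite: BenfattoGiulianiMastropietro2006, §2.4 (2.44) p0009:L150] -/
theorem bgmTimeDiffIter_one_neg_pi_div (hSy : BGMSymmetry E) (β : ℝ) (h' : ℤ)
    (q : Fin 2 → ℝ) :
    bgmTimeDiffIter β 1 (E h') (-(π / β), q) = Complex.I * (((β / π) * (E h' (π / β, q)).im : ℝ) : ℂ) := by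
  rw [bgmTimeDiffIter_one_apply]
  have e1 : -(π / β) + 2 * π / β = π / β := by ring
  rw [e1, E_sub_E_neg hSy h' (π / β) q, Complex.real_smul]
  push_cast
  ring

/-- Hence **`|a(k⃗)| ≤ 2C₁U²`** ("`|a_h(k⃗)| ≤ C|U|`", p0010:L3). [cite: BenfattoGiulianiMastropietro2006, §2.4 (2.44) p0010:L1–L4] -/
theorem abs_a_le (hI : BGMInitial E) (hSy : BGMSymmetry E) (hS : BGMSmoothness β U C hβ E)
    {h' : ℤ} (hh₁ : hβ - 1 ≤ h') (hh₀ : h' ≤ 0) (q : Fin 2 → ℝ) :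
    |(β / π) * (E h' (π / β, q)).im| ≤ 2 * |C 1| * U ^ 2 := by
  have h := norm_bgmTimeDiffIter_one_le hI hS hh₁ hh₀ (neg_pi_div_mem_matsubaraSet' β) q
  rwa [bgmTimeDiffIter_one_neg_pi_div hSy β, norm_mul, Complex.norm_I, one_mul, Complex.norm_real,
    Real.norm_eq_abs] at h
  where
  /-- `-π/β ∈ D_β`. [folklore] -/
  neg_pi_div_mem_matsubaraSet' (β : ℝ) : -(π / β) ∈ matsubaraSet β := ⟨-1, by simp [fermiMatsubara]; ring⟩

/-- **(2.43) as an identity on the Matsubara lattice**: with `ε'(k⃗) = Re E_{h'}(π/β,k⃗)`,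
`a(k⃗) = -(β/π)Im E_{h'}(π/β,k⃗)` and the interpolation remainder
`r(k₀,k⃗) = E_{h'}(k₀,k⃗) - ε'(k⃗) + ik₀a(k⃗)`:
`-ik₀ + E_{h'}(k) - μ = -ik₀[1 + a(k⃗)] + ε'(k⃗) - μ + r(k)`. [cite: BenfattoGiulianiMastropietro2006, §2.4 (2.43) p0009:L146] -/
theorem bgmDenom_decomp (μ β : ℝ) (E : ℤ → ℝ × (Fin 2 → ℝ) → ℂ) (h' : ℤ) (k₀ : ℝ) (q : Fin 2 → ℝ) :
    bgmDenom μ E h' (k₀, q) =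
      -(Complex.I * (k₀ : ℂ)) * (1 + ((-(β / π) * (E h' (π / β, q)).im : ℝ) : ℂ)) +
        (((E h' (π / β, q)).re - μ : ℝ) : ℂ) +
        (E h' (k₀, q) - ((E h' (π / β, q)).re : ℂ) +
          Complex.I * (k₀ : ℂ) * ((-(β / π) * (E h' (π / β, q)).im : ℝ) : ℂ)) := by
  simp only [bgmDenom]
  push_cast
  ring

/-- The interpolation remainder is conjugated under the Matsubara reflection `j ↦ -1-j`. [cite: BenfattoGiulianiMastropietro2006, §2.3 (2.36a) p0008:L70] -/
private theorem remainder_reflect (hSy : BGMSymmetry E) (β : ℝ) (h' : ℤ) (j : ℤ) (q : Fin 2 → ℝ) :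
    E h' (fermiMatsubara β (-1 - j), q) - ((E h' (π / β, q)).re : ℂ) +
        Complex.I * (fermiMatsubara β (-1 - j) : ℂ) * ((-(β / π) * (E h' (π / β, q)).im : ℝ) : ℂ) =
      (starRingEnd ℂ) (E h' (fermiMatsubara β j, q) - ((E h' (π / β, q)).re : ℂ) +
        Complex.I * (fermiMatsubara β j : ℂ) * ((-(β / π) * (E h' (π / β, q)).im : ℝ) : ℂ)) := by
  rw [fermiMatsubara_reflect, E_neg_eq_conj hSy]
  simp only [map_add, map_sub, map_mul, Complex.conj_ofReal, Complex.conj_I]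
  push_cast
  ring

/-- **The remainder of (2.43) is quadratically small in `k₀`**: if the second discrete time
derivatives of `E_{h'}(·, k⃗)` are bounded by `M` on `D_β`, then
`|r(k₀, k⃗)| ≤ (M/2)(k₀² - (π/β)²) ≤ (M/2)k₀²` at every `k₀ ∈ D_β` (two-node interpolation at `∓π/β`;
BGM: "`|r_h(k)| ≤ C|U||h|γ^{2h}` for any `k` in the support of `f_h`", where `|k₀| = O(γ^h)`).
[cite: BenfattoGiulianiMastropietro2006, §2.4 (2.43) p0009:L146–p0010:L4] -/
theorem norm_remainder_le (hSy : BGMSymmetry E) {β : ℝ} (hβpos : 0 < β) {h' : ℤ} {q : Fin 2 → ℝ} {M : ℝ}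
    (hM : ∀ j : ℤ, ‖bgmTimeDiffIter β 2 (E h') (fermiMatsubara β j, q)‖ ≤ M) (j : ℤ) :
    ‖E h' (fermiMatsubara β j, q) - ((E h' (π / β, q)).re : ℂ) +
        Complex.I * (fermiMatsubara β j : ℂ) * ((-(β / π) * (E h' (π / β, q)).im : ℝ) : ℂ)‖ ≤
      M / 2 * (fermiMatsubara β j) ^ 2 := by
  have hβ0 : β ≠ 0 := hβpos.ne'
  have hM0 : 0 ≤ M := (norm_nonneg _).trans (hM 0)
  -- the case `j ≥ -1` by the discrete Taylor estimate
  have key : ∀ j : ℤ, -1 ≤ j →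
      ‖E h' (fermiMatsubara β j, q) - ((E h' (π / β, q)).re : ℂ) +
          Complex.I * (fermiMatsubara β j : ℂ) * ((-(β / π) * (E h' (π / β, q)).im : ℝ) : ℂ)‖ ≤
        M / 2 * (fermiMatsubara β j) ^ 2 := by
    intro j hj
    set n := (j + 1).toNat with hn
    have hnz : ((n : ℕ) : ℤ) = j + 1 := Int.toNat_of_nonneg (by omega)
    have hnr : (n : ℝ) = (j : ℝ) + 1 := by exact_mod_cast hnz
    set φ : ℕ → ℂ := fun i => E h' (fermiMatsubara β ((i : ℤ) - 1), q) with hφ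
    have hstep : ∀ i : ℕ, fermiMatsubara β ((i : ℤ) - 1) + 2 * π / β = fermiMatsubara β (((i + 1 : ℕ) : ℤ) - 1) := by
      intro i; rw [← fermiMatsubara_add_one]; congr 1; push_cast; ring
    have hφ2 : ∀ i, ‖φ (i + 2) - 2 * φ (i + 1) + φ i‖ ≤ (2 * π / β) ^ 2 * M := by
      intro i
      have h2 := hM ((i : ℤ) - 1)
      rw [bgmTimeDiffIter_two_apply, hstep i, hstep (i + 1), norm_smul, Real.norm_eq_abs,
        abs_of_nonneg (sq_nonneg _)] at h2
      have hpos : (0 : ℝ) < (β / (2 * π)) ^ 2 := by positivity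
      have e : (2 * π / β) ^ 2 * M = M / (β / (2 * π)) ^ 2 := by field_simp
      rw [e, le_div_iff₀ hpos, mul_comm]
      simpa [hφ, add_assoc] using h2
    have hT := norm_sub_sub_smul_le_of_second_diff hφ2 n
    -- identify the Taylor polynomial with `ε' - ik₀a`
    have hφn : φ n = E h' (fermiMatsubara β j, q) := by
      simp only [hφ, hnz, add_sub_cancel_right]
    have hφ0 : φ 0 = E h' (-(π / β), q) := by
      simp only [hφ, Nat.cast_zero, zero_sub, fermiMatsubara_neg_one]
    have hφ1 : φ 1 = E h' (π / β, q) := by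
      simp only [hφ, Nat.cast_one, sub_self, fermiMatsubara_zero]
    have hid : φ n - φ 0 - (n : ℂ) * (φ 1 - φ 0) =
        E h' (fermiMatsubara β j, q) - ((E h' (π / β, q)).re : ℂ) +
          Complex.I * (fermiMatsubara β j : ℂ) * ((-(β / π) * (E h' (π / β, q)).im : ℝ) : ℂ) := by
      rw [hφn, hφ0, hφ1, E_sub_E_neg hSy h' (π / β) q, E_neg_eq_conj hSy h' (π / β) q]
      have hre : ((starRingEnd ℂ) (E h' (π / β, q))) = ((E h' (π / β, q)).re : ℂ) -
          Complex.I * ((E h' (π / β, q)).im : ℂ) := by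
        apply Complex.ext <;> simp
      rw [hre, show ((n : ℕ) : ℂ) = (((j : ℝ) + 1 : ℝ) : ℂ) by exact_mod_cast hnr]
      have hβC : (β : ℂ) ≠ 0 := by exact_mod_cast hβ0
      have hπC : (π : ℂ) ≠ 0 := by exact_mod_cast Real.pi_pos.ne'
      simp only [fermiMatsubara]
      push_cast
      field_simp
      ring
    rw [hid] at hT
    refine hT.trans ?_
    -- `(2π/β)² M · n(n-1)/2 ≤ (M/2) k₀²`, `k₀ = (2n-1)π/β`
    have hk0 : fermiMatsubara β j = (2 * (n : ℝ) - 1) * π / β := by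
      rw [fermiMatsubara, hnr]; ring
    rw [hk0]
    have hineq : (n : ℝ) * ((n : ℝ) - 1) * 4 ≤ (2 * (n : ℝ) - 1) ^ 2 := by nlinarith
    have hπβ : 0 < (π / β) ^ 2 := by positivity
    calc (2 * π / β) ^ 2 * M * ((n : ℝ) * ((n : ℝ) - 1) / 2) = M / 2 * ((n : ℝ) * ((n : ℝ) - 1) * 4) * (π / β) ^ 2 := by
          ring
      _ ≤ M / 2 * (2 * (n : ℝ) - 1) ^ 2 * (π / β) ^ 2 := by gcongr
      _ = M / 2 * ((2 * (n : ℝ) - 1) * π / β) ^ 2 := by ring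
  rcases le_or_gt (-1) j with hj | hj
  · exact key j hj
  · have hj' : -1 ≤ -1 - j := by omega
    have h := key (-1 - j) hj'
    rw [remainder_reflect hSy, Complex.norm_conj, fermiMatsubara_reflect, neg_sq] at h
    exact h

end KZero


/-! ### §3 The support of `f_h` for a moving dispersion ((2.42a)) and the radial geometry of `ε_h` -/

section Support

/-- `4^{h-1} = 4^h/4`. [folklore] -/
private theorem four_zpow_sub_one (h : ℤ) : (4 : ℝ) ^ (h - 1) = (4 : ℝ) ^ h / 4 := by
  rw [zpow_sub_one₀ (by norm_num : (4 : ℝ) ≠ 0)]; ring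

/-- `4^{h-2} = 4^h/16`. [folklore] -/
private theorem four_zpow_sub_two (h : ℤ) : (4 : ℝ) ^ (h - 2) = (4 : ℝ) ^ h / 16 := by
  rw [zpow_sub₀ (by norm_num : (4 : ℝ) ≠ 0)]; norm_num

/-- `4^h ≤ 1` for `h ≤ 0`. [folklore] -/
private theorem four_zpow_le_one {h : ℤ} (hh : h ≤ 0) : (4 : ℝ) ^ h ≤ 1 :=
  zpow_le_one_of_nonpos₀ (by norm_num) hh

/-- `0 < 4^h`. [folklore] -/
private theorem four_zpow_pos (h : ℤ) : (0 : ℝ) < (4 : ℝ) ^ h := zpow_pos (by norm_num) h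

/-- The two denominators at consecutive scales differ by the dispersion increment:
`D_h(k) - D_{h-1}(k) = E_h(k) - E_{h-1}(k)`. [cite: BenfattoGiulianiMastropietro2006, §2.3 (2.28) p0007:L108] -/
private theorem bgmDenom_sub_bgmDenom (μ : ℝ) (E : ℤ → ℝ × (Fin 2 → ℝ) → ℂ) (h : ℤ) (p : ℝ × (Fin 2 → ℝ)) :
    bgmDenom μ E h p - bgmDenom μ E (h - 1) p = E h p - E (h - 1) p := by
  simp only [bgmDenom]; ring

/-- **(2.42a), denominator form**: if the scale-`h` cutoff `f_h(k)` (2.28) of a moving dispersion with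
`|E_h(k) - E_{h-1}(k)| ≤ (3/16)e₀γ^h` does not vanish, then `e₀γ^{h-2} < |-ik₀ + E_{h-1}(k) - μ| < 2e₀γ^h`
("by using the definition of `f_h(k)` in (2.28), one can easily see that …").
[cite: BenfattoGiulianiMastropietro2006, §2.4 (2.42a) p0010:L9–L14] -/
theorem norm_bgmDenom_bounds_of_bgmShell_ne_zero {e₀ μ : ℝ} (he : 0 < e₀) {E : ℤ → ℝ × (Fin 2 → ℝ) → ℂ}
    {h : ℤ} {p : ℝ × (Fin 2 → ℝ)}
    (hη : ‖E h p - E (h - 1) p‖ ≤ 3 / 16 * e₀ * (4 : ℝ) ^ h) (hf : bgmShell e₀ μ E h p ≠ 0) :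
    e₀ * (4 : ℝ) ^ (h - 2) < ‖bgmDenom μ E (h - 1) p‖ ∧ ‖bgmDenom μ E (h - 1) p‖ < 2 * e₀ * (4 : ℝ) ^ h := by
  have hγ : (1 : ℝ) < 4 := by norm_num
  have h4 := four_zpow_pos h
  have hdiff : ‖bgmDenom μ E h p‖ ≤ ‖bgmDenom μ E (h - 1) p‖ + 3 / 16 * e₀ * (4 : ℝ) ^ h ∧
      ‖bgmDenom μ E (h - 1) p‖ ≤ ‖bgmDenom μ E h p‖ + 3 / 16 * e₀ * (4 : ℝ) ^ h := by
    have h1 := norm_sub_norm_le (bgmDenom μ E h p) (bgmDenom μ E (h - 1) p)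
    have h2 := norm_sub_norm_le (bgmDenom μ E (h - 1) p) (bgmDenom μ E h p)
    rw [bgmDenom_sub_bgmDenom] at h1
    rw [norm_sub_rev, bgmDenom_sub_bgmDenom] at h2
    constructor <;> linarith
  simp only [bgmShell, bgmCutoffInv] at hf
  constructor
  · by_contra hle
    push Not at hle
    have h1 : gnScaleCutoff 4 e₀ (h - 1) ‖bgmDenom μ E (h - 1) p‖ = 1 :=
      gnScaleCutoff_eq_one hγ he (by rw [sub_sub, one_add_one_eq_two]; exact hle)
    have h2 : gnScaleCutoff 4 e₀ h ‖bgmDenom μ E h p‖ = 1 := by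
      apply gnScaleCutoff_eq_one hγ he
      rw [four_zpow_sub_one]
      rw [four_zpow_sub_two] at hle
      linarith [hdiff.1]
    exact hf (by rw [h1, h2, sub_self])
  · by_contra hle
    push Not at hle
    have h1 : gnScaleCutoff 4 e₀ (h - 1) ‖bgmDenom μ E (h - 1) p‖ = 0 := by
      apply gnScaleCutoff_eq_zero hγ he
      rw [four_zpow_sub_one]
      nlinarith
    have h2 : gnScaleCutoff 4 e₀ h ‖bgmDenom μ E h p‖ = 0 := by
      apply gnScaleCutoff_eq_zero hγ he
      linarith [hdiff.2]
    exact hf (by rw [h1, h2, sub_self])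

/-- On the support of `f_h` the denominator is bounded below, so `1/|D_{h-1}| ≤ 16γ^{-h}/e₀`. [cite: BenfattoGiulianiMastropietro2006, §2.4 (2.42a) p0010:L9–L14] -/
theorem norm_inv_bgmDenom_le_of_bgmShell_ne_zero {e₀ μ : ℝ} (he : 0 < e₀) {E : ℤ → ℝ × (Fin 2 → ℝ) → ℂ}
    {h : ℤ} {p : ℝ × (Fin 2 → ℝ)}
    (hη : ‖E h p - E (h - 1) p‖ ≤ 3 / 16 * e₀ * (4 : ℝ) ^ h) (hf : bgmShell e₀ μ E h p ≠ 0) :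
    ‖(bgmDenom μ E (h - 1) p)⁻¹‖ ≤ 16 * (4 : ℝ) ^ (-h) / e₀ := by
  have hlo := (norm_bgmDenom_bounds_of_bgmShell_ne_zero he hη hf).1
  have hpos : 0 < e₀ * (4 : ℝ) ^ (h - 2) := mul_pos he (four_zpow_pos _)
  rw [norm_inv]
  calc ‖bgmDenom μ E (h - 1) p‖⁻¹ ≤ (e₀ * (4 : ℝ) ^ (h - 2))⁻¹ := by
        exact inv_anti₀ hpos hlo.le
    _ = 16 * (4 : ℝ) ^ (-h) / e₀ := by
        rw [four_zpow_sub_two, zpow_neg]; field_simp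

/-- **(2.42a), frequency form** (pure arithmetic of the decomposition (2.43)): if
`D = -ik₀(1 + a) + (ε' - μ) + r` with `|a| ≤ ½`, `|r| ≤ ½Mk₀²`, and also `D = -ik₀ + (E - μ)` with
`|E - ε₀| ≤ A` (`ε₀` real), `2M(A + 2e₀) ≤ 1`, then `|D| < s ≤ 2e₀` forces `|k₀| < 4s`. [cite: BenfattoGiulianiMastropietro2006, §2.4 (2.42a)–(2.43) p0010:L1–L14] -/
theorem abs_k0_lt_of_norm_lt {k₀ a μ ε' εfree A M e₀ s : ℝ} {Ev r D : ℂ}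
    (hD1 : D = -(Complex.I * (k₀ : ℂ)) * (1 + (a : ℂ)) + ((ε' - μ : ℝ) : ℂ) + r)
    (hD2 : D = -(Complex.I * (k₀ : ℂ)) + (Ev - (μ : ℂ))) (ha : |a| ≤ 1 / 2)
    (hr : ‖r‖ ≤ M / 2 * k₀ ^ 2) (hA : ‖Ev - (εfree : ℂ)‖ ≤ A) (hMA : 2 * M * (A + 2 * e₀) ≤ 1)
    (hs : s ≤ 2 * e₀) (hDs : ‖D‖ < s) : |k₀| < 4 * s := by
  have him1 : D.im = -(k₀ * (1 + a)) + r.im := by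
    rw [hD1]; simp
  have him2 : D.im = -k₀ + Ev.im := by
    rw [hD2]; simp
  have hDim : |D.im| < s := lt_of_le_of_lt (Complex.abs_im_le_norm D) hDs
  have hrim : |r.im| ≤ M / 2 * k₀ ^ 2 := (Complex.abs_im_le_norm r).trans hr
  have ha' := abs_le.1 ha
  -- `|k₀|/2 < s + (M/2) k₀²`
  have hmain : |k₀| / 2 < s + M / 2 * k₀ ^ 2 := by
    have h1 : |k₀ * (1 + a)| ≤ |D.im| + |r.im| := by
      have : k₀ * (1 + a) = r.im - D.im := by rw [him1]; ring
      rw [this]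
      have := abs_sub (r.im) (D.im)
      linarith
    rw [abs_mul] at h1
    have h2 : |k₀| / 2 ≤ |k₀| * |1 + a| := by
      have : 1 / 2 ≤ |1 + a| := by rw [abs_of_nonneg (by linarith)]; linarith
      calc |k₀| / 2 = |k₀| * (1 / 2) := by ring
        _ ≤ |k₀| * |1 + a| := mul_le_mul_of_nonneg_left this (abs_nonneg _)
    linarith
  by_cases hcase : M * k₀ ^ 2 ≤ |k₀| / 2
  · linarith
  · push Not at hcase
    -- then `M|k₀| > 1/2`, so `|k₀| > A + 2e₀`
    have hk0 : 0 < |k₀| := by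
      rcases eq_or_ne k₀ 0 with hz | hz
      · exfalso; rw [hz] at hcase; simp at hcase
      · exact abs_pos.2 hz
    have hMk : 1 / 2 < M * |k₀| := by
      have : |k₀| / 2 < M * |k₀| * |k₀| := by rw [mul_assoc, ← sq, sq_abs]; exact hcase
      nlinarith
    have hMpos : 0 < M := by
      by_contra hM0; push Not at hM0
      have : M * |k₀| ≤ 0 := mul_nonpos_of_nonpos_of_nonneg hM0 hk0.le
      linarith
    have hkA : A + 2 * e₀ < |k₀| := by
      by_contra hc; push Not at hc
      have : M * |k₀| ≤ M * (A + 2 * e₀) := mul_le_mul_of_nonneg_left hc hMpos.le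
      linarith
    have hEim : |Ev.im| ≤ A := by
      have : Ev.im = (Ev - (εfree : ℂ)).im := by simp
      rw [this]; exact (Complex.abs_im_le_norm _).trans hA
    have : |k₀| - A ≤ |D.im| := by
      rw [him2]
      have := abs_sub_abs_le_abs_sub (-k₀) (-Ev.im)
      rw [abs_neg, abs_neg, sub_neg_eq_add] at this
      linarith
    linarith

/-- **(2.42a), level form**: with the same decomposition, `|ε' - μ| ≤ |D| + ½Mk₀²`. [cite: BenfattoGiulianiMastropietro2006, §2.4 (2.42a) p0010:L9–L14] -/
theorem abs_level_le_of_decomp {k₀ a μ ε' M : ℝ} {r D : ℂ}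
    (hD1 : D = -(Complex.I * (k₀ : ℂ)) * (1 + (a : ℂ)) + ((ε' - μ : ℝ) : ℂ) + r)
    (hr : ‖r‖ ≤ M / 2 * k₀ ^ 2) : |ε' - μ| ≤ ‖D‖ + M / 2 * k₀ ^ 2 := by
  have hre : D.re = (ε' - μ) + r.re := by rw [hD1]; simp
  have h1 : ε' - μ = D.re - r.re := by rw [hre]; ring
  rw [h1]
  calc |D.re - r.re| ≤ |D.re| + |r.re| := abs_sub _ _
    _ ≤ ‖D‖ + ‖r‖ := add_le_add (Complex.abs_re_le_norm D) (Complex.abs_re_le_norm r)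
    _ ≤ ‖D‖ + M / 2 * k₀ ^ 2 := by linarith

end Support


/-! ### §3b Radial geometry of a `C²`-small perturbation of the free band ((2.41a) consumed) -/

section Radial

variable {ε : (Fin 2 → ℝ) → ℝ} {δ₀ δ₁ δ₂ c : ℝ}

/-- The derivative of `ε` along a ray. [folklore] -/
private theorem hasDerivAt_eps_ray' (hε : Differentiable ℝ ε) (θ t : ℝ) :
    HasDerivAt (fun s : ℝ => ε (s • dir θ)) (fderiv ℝ ε (t • dir θ) (dir θ)) t := by
  have hl : HasDerivAt (fun s : ℝ => s • dir θ) (dir θ) t := by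
    simpa using (hasDerivAt_id t).smul_const (dir θ)
  exact (hε (t • dir θ)).hasFDerivAt.comp_hasDerivAt t hl

/-- The second derivative of `ε` along a ray is the Hessian on `(e⃗_r, e⃗_r)`. [folklore] -/
private theorem hasDerivAt_fderiv_ray (hε : ContDiff ℝ 2 ε) (θ s : ℝ) :
    HasDerivAt (fun s : ℝ => fderiv ℝ ε (s • dir θ) (dir θ))
      (fderiv ℝ (fderiv ℝ ε) (s • dir θ) (dir θ) (dir θ)) s := by
  have hd : Differentiable ℝ (fderiv ℝ ε) :=
    (hε.fderiv_right (m := 1) (by norm_num)).differentiable (by simp)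
  have hl : HasDerivAt (fun s : ℝ => s • dir θ) (dir θ) s := by
    simpa using (hasDerivAt_id s).smul_const (dir θ)
  have h1 : HasDerivAt (fun s : ℝ => fderiv ℝ ε (s • dir θ)) (fderiv ℝ (fderiv ℝ ε) (s • dir θ) (dir θ)) s :=
    (hd (s • dir θ)).hasFDerivAt.comp_hasDerivAt s hl
  have h2 := h1.clm_apply (hasDerivAt_const s (dir θ))
  simpa using h2

/-- **The radial derivative of the free band**: `∇ε₀(t e⃗_r)·e⃗_r = 2(cos θ sin(t cos θ) + sin θ sin(t sin θ))`. [folklore] -/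
private theorem fderiv_sqDispersion_ray_dir' (t θ : ℝ) :
    fderiv ℝ sqDispersion (t • dir θ) (dir θ) =
      2 * (Real.cos θ * Real.sin (t * Real.cos θ) + Real.sin θ * Real.sin (t * Real.sin θ)) := by
  rw [fderiv_sqDispersion_apply]
  simp only [Pi.smul_apply, smul_eq_mul, dir_zero, dir_one]
  ring

/-- `c · sin(t c) ≥ (2/π) t c²` for `0 ≤ t ≤ π/2`, `|c| ≤ 1`. [folklore] -/
private theorem mul_sin_mul_ge' {t c : ℝ} (ht : 0 ≤ t) (hc : |c| ≤ 1) (htπ : t ≤ π / 2) :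
    2 / π * t * c ^ 2 ≤ c * Real.sin (t * c) := by
  have key : ∀ a : ℝ, 0 ≤ a → a ≤ 1 → 2 / π * t * a ^ 2 ≤ a * Real.sin (t * a) := by
    intro a ha0 ha1
    have hta : t * a ≤ π / 2 := by nlinarith [Real.pi_pos]
    have h := Real.mul_le_sin (by positivity : 0 ≤ t * a) hta
    calc 2 / π * t * a ^ 2 = a * (2 / π * (t * a)) := by ring
      _ ≤ a * Real.sin (t * a) := mul_le_mul_of_nonneg_left h ha0
  rcases le_total 0 c with h0 | h0
  · exact key c h0 ((le_abs_self c).trans hc)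
  · have h := key (-c) (by linarith) ((neg_le_abs c).trans hc)
    have e1 : (-c) ^ 2 = c ^ 2 := by ring
    have e2 : -c * Real.sin (t * -c) = c * Real.sin (t * c) := by
      rw [mul_neg, Real.sin_neg]; ring
    rwa [e1, e2] at h

/-- `4t/π ≤ ∇ε₀(t e⃗_r)·e⃗_r` for `0 ≤ t ≤ π/2`. [folklore] -/
private theorem fderiv_sqDispersion_ray_dir_ge' {t : ℝ} (ht : 0 ≤ t) (htπ : t ≤ π / 2) (θ : ℝ) :
    4 / π * t ≤ fderiv ℝ sqDispersion (t • dir θ) (dir θ) := by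
  rw [fderiv_sqDispersion_ray_dir']
  have h1 := mul_sin_mul_ge' ht (Real.abs_cos_le_one θ) htπ
  have h2 := mul_sin_mul_ge' ht (Real.abs_sin_le_one θ) htπ
  have hcs : Real.cos θ ^ 2 + Real.sin θ ^ 2 = 1 := by rw [add_comm]; exact Real.sin_sq_add_cos_sq θ
  have : 2 / π * t * Real.cos θ ^ 2 + 2 / π * t * Real.sin θ ^ 2 = 2 / π * t := by
    rw [← mul_add, hcs, mul_one]
  have h12 := add_le_add h1 h2
  rw [this] at h12
  have e : 4 / π * t = 2 * (2 / π * t) := by ring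
  rw [e]
  linarith

/-- `|cos θ| + |sin θ| ≤ 2`. [folklore] -/
private theorem abs_dir_add_le' (θ : ℝ) : |dir θ 0| + |dir θ 1| ≤ 2 := by
  have := Real.abs_cos_le_one θ; have := Real.abs_sin_le_one θ
  simp only [dir_zero, dir_one]; linarith

/-- **Radial transversality of the perturbed band**: `∇ε(t e⃗_r)·e⃗_r ≥ 4t/π - 2δ₁` on `0 ≤ t ≤ π/2`
(Lemma 2.1 (2), (2.41), at every point of the annulus rather than on the curves only). [cite: BenfattoGiulianiMastropietro2006, §2.4 Lemma 2.1 (2) (2.41) p0009:L55] -/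
theorem fderiv_ray_dir_ge'
    (h1 : ∀ k v, |fderiv ℝ ε k v - fderiv ℝ sqDispersion k v| ≤ δ₁ * (|v 0| + |v 1|)) (hδ₁ : 0 ≤ δ₁)
    {t : ℝ} (ht : 0 ≤ t) (htπ : t ≤ π / 2) (θ : ℝ) :
    4 / π * t - 2 * δ₁ ≤ fderiv ℝ ε (t • dir θ) (dir θ) := by
  have h := h1 (t • dir θ) (dir θ)
  have hb := fderiv_sqDispersion_ray_dir_ge' ht htπ θ
  have h2 : δ₁ * (|dir θ 0| + |dir θ 1|) ≤ δ₁ * 2 := mul_le_mul_of_nonneg_left (abs_dir_add_le' θ) hδ₁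
  have h3 := (abs_le.1 (h.trans h2)).1
  linarith

/-- **The Hessian of the perturbed band along a ray is bounded**: `|D²ε(s e⃗_r)(e⃗_r, e⃗_r)| ≤ 2 + 4δ₂`
(third bound of (2.41a): `Hess ε₀ = 2 diag(cos k₁, cos k₂)`). [cite: BenfattoGiulianiMastropietro2006, §2.4 (2.41a) p0009:L77–L84] -/
theorem abs_fderiv_fderiv_ray_le
    (h2 : ∀ k v w, |fderiv ℝ (fderiv ℝ ε) k v w - fderiv ℝ (fderiv ℝ sqDispersion) k v w| ≤
      δ₂ * (|v 0| + |v 1|) * (|w 0| + |w 1|)) (hδ₂ : 0 ≤ δ₂) (s θ : ℝ) :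
    |fderiv ℝ (fderiv ℝ ε) (s • dir θ) (dir θ) (dir θ)| ≤ 2 + 4 * δ₂ := by
  have h := h2 (s • dir θ) (dir θ) (dir θ)
  have hfree : |fderiv ℝ (fderiv ℝ sqDispersion) (s • dir θ) (dir θ) (dir θ)| ≤ 2 := by
    rw [fderiv_fderiv_sqDispersion_apply]
    simp only [dir_zero, dir_one]
    have hc := Real.abs_cos_le_one ((s • dir θ) 0)
    have hs := Real.abs_cos_le_one ((s • dir θ) 1)
    have hc' := abs_le.1 hc
    have hs' := abs_le.1 hs
    have hcs : Real.cos θ ^ 2 + Real.sin θ ^ 2 = 1 := by rw [add_comm]; exact Real.sin_sq_add_cos_sq θ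
    rw [abs_le]
    constructor <;> nlinarith [sq_nonneg (Real.cos θ), sq_nonneg (Real.sin θ)]
  have hd : δ₂ * (|dir θ 0| + |dir θ 1|) * (|dir θ 0| + |dir θ 1|) ≤ 4 * δ₂ := by
    have hS := abs_dir_add_le' θ
    have h0 : 0 ≤ |dir θ 0| + |dir θ 1| := by positivity
    have hSS : (|dir θ 0| + |dir θ 1|) * (|dir θ 0| + |dir θ 1|) ≤ 4 := by nlinarith
    calc δ₂ * (|dir θ 0| + |dir θ 1|) * (|dir θ 0| + |dir θ 1|)
        = δ₂ * ((|dir θ 0| + |dir θ 1|) * (|dir θ 0| + |dir θ 1|)) := by ring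
      _ ≤ δ₂ * 4 := mul_le_mul_of_nonneg_left hSS hδ₂
      _ = 4 * δ₂ := by ring
  have h' := abs_le.1 (h.trans hd)
  have hf' := abs_le.1 hfree
  rw [abs_le]; constructor <;> linarith

/-- **Linearisation of the band along a ray** (the step `e_θ(ρ) = e_θ'(u)(ρ - u) + O((ρ-u)²)` behind
(2.56c)–(2.56e)): `|ε(ρe⃗_r) - ε(ue⃗_r) - ∇ε(ue⃗_r)·e⃗_r (ρ - u)| ≤ (2 + 4δ₂)(ρ - u)²`. [cite: BenfattoGiulianiMastropietro2006, §2.5 proof of Lemma 2.2a (2.56e) p0011:L88–L94] -/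
theorem abs_ray_linearisation_le (hε : ContDiff ℝ 2 ε)
    (h2 : ∀ k v w, |fderiv ℝ (fderiv ℝ ε) k v w - fderiv ℝ (fderiv ℝ sqDispersion) k v w| ≤
      δ₂ * (|v 0| + |v 1|) * (|w 0| + |w 1|)) (hδ₂ : 0 ≤ δ₂) (θ ρ u : ℝ) :
    |ε (ρ • dir θ) - ε (u • dir θ) - fderiv ℝ ε (u • dir θ) (dir θ) * (ρ - u)| ≤ (2 + 4 * δ₂) * (ρ - u) ^ 2 := by
  set B := 2 + 4 * δ₂ with hB
  have hB0 : 0 ≤ B := by rw [hB]; positivity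
  set lam := fderiv ℝ ε (u • dir θ) (dir θ) with hlam
  -- the slope drifts by at most `B|s - u|`
  have hslope : ∀ s : ℝ, |fderiv ℝ ε (s • dir θ) (dir θ) - lam| ≤ B * |s - u| := by
    intro s
    have h := Convex.norm_image_sub_le_of_norm_hasDerivWithin_le (s := Set.univ)
      (f := fun s : ℝ => fderiv ℝ ε (s • dir θ) (dir θ))
      (f' := fun s => fderiv ℝ (fderiv ℝ ε) (s • dir θ) (dir θ) (dir θ))
      (fun x _ => (hasDerivAt_fderiv_ray hε θ x).hasDerivWithinAt)
      (fun x _ => (Real.norm_eq_abs _).le.trans (abs_fderiv_fderiv_ray_le h2 hδ₂ x θ))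
      convex_univ (Set.mem_univ u) (Set.mem_univ s)
    simpa [Real.norm_eq_abs, hlam] using h
  -- integrate the drift: `g(s) = ε(s e_r) - lam (s - u)` has `|g'| ≤ B|ρ - u|` between `u` and `ρ`
  set g : ℝ → ℝ := fun s => ε (s • dir θ) - lam * (s - u) with hg
  have hgd : ∀ s, HasDerivAt g (fderiv ℝ ε (s • dir θ) (dir θ) - lam) s := by
    intro s
    have h1 := hasDerivAt_eps_ray' (hε.differentiable (by simp)) θ s
    have h2 : HasDerivAt (fun s : ℝ => lam * (s - u)) lam s := by
      simpa using ((hasDerivAt_id s).sub_const u).const_mul lam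
    exact h1.sub h2
  have hI : Convex ℝ (Set.uIcc u ρ) := convex_uIcc u ρ
  have h := Convex.norm_image_sub_le_of_norm_hasDerivWithin_le (s := Set.uIcc u ρ) (f := g)
    (f' := fun s => fderiv ℝ ε (s • dir θ) (dir θ) - lam) (C := B * |ρ - u|)
    (fun x _ => (hgd x).hasDerivWithinAt)
    (fun x hx => by
      rw [Real.norm_eq_abs]
      refine (hslope x).trans (mul_le_mul_of_nonneg_left ?_ hB0)
      exact Set.abs_sub_left_of_mem_uIcc hx) hI Set.left_mem_uIcc Set.right_mem_uIcc
  have e : g ρ - g u = ε (ρ • dir θ) - ε (u • dir θ) - lam * (ρ - u) := by simp only [hg]; ring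
  rw [e, Real.norm_eq_abs, Real.norm_eq_abs] at h
  calc _ ≤ B * |ρ - u| * |ρ - u| := h
    _ = B * (ρ - u) ^ 2 := by rw [mul_assoc, ← sq, sq_abs]

/-- **Radial separation**: on `[c, π/2]`, where `∇ε·e⃗_r ≥ 4c/π - 2δ₁ =: m > 0`,
`m|s - t| ≤ |ε(se⃗_r) - ε(te⃗_r)|`. [cite: BenfattoGiulianiMastropietro2006, §2.4 Lemma 2.1 (2) (2.41) p0009:L55] -/
theorem mul_abs_sub_le_abs_eps_sub (hε : ContDiff ℝ 2 ε)
    (h1 : ∀ k v, |fderiv ℝ ε k v - fderiv ℝ sqDispersion k v| ≤ δ₁ * (|v 0| + |v 1|)) (hδ₁ : 0 ≤ δ₁)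
    (hc : 0 ≤ c) (θ : ℝ) {s t : ℝ} (hs : s ∈ Icc c (π / 2)) (ht : t ∈ Icc c (π / 2)) :
    (4 / π * c - 2 * δ₁) * |s - t| ≤ |ε (s • dir θ) - ε (t • dir θ)| := by
  have hD : Convex ℝ (Icc c (π / 2)) := convex_Icc _ _
  have hdiff : Differentiable ℝ ε := hε.differentiable (by simp)
  have hcont : ContinuousOn (fun s : ℝ => ε (s • dir θ)) (Icc c (π / 2)) :=
    (hε.continuous.comp (continuous_id.smul continuous_const)).continuousOn
  have hder : DifferentiableOn ℝ (fun s : ℝ => ε (s • dir θ)) (interior (Icc c (π / 2))) :=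
    fun x _ => (hasDerivAt_eps_ray' hdiff θ x).differentiableAt.differentiableWithinAt
  have hge : ∀ x ∈ interior (Icc c (π / 2)), 4 / π * c - 2 * δ₁ ≤ deriv (fun s : ℝ => ε (s • dir θ)) x := by
    intro x hx
    rw [interior_Icc] at hx
    rw [(hasDerivAt_eps_ray' hdiff θ x).deriv]
    have h := fderiv_ray_dir_ge' h1 hδ₁ (hc.trans hx.1.le) hx.2.le θ
    have : 4 / π * c ≤ 4 / π * x := mul_le_mul_of_nonneg_left hx.1.le (by positivity)
    linarith
  have key := Convex.mul_sub_le_image_sub_of_le_deriv hD hcont hder hge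
  rcases le_total t s with hts | hst
  · have h := key t ht s hs hts
    rw [abs_of_nonneg (by linarith : 0 ≤ s - t)]
    exact h.trans (le_abs_self _)
  · have h := key s hs t ht hst
    rw [abs_sub_comm, abs_of_nonneg (by linarith : 0 ≤ t - s), abs_sub_comm]
    exact h.trans (le_abs_self _)

end Radial


/-! ### §4 Measure-theoretic plumbing of (2.56b) -/

section Plumbing

/-- `zoneSq` is measurable. [folklore] -/
private theorem measurableSet_zoneSq : MeasurableSet zoneSq := by
  unfold zoneSq; exact MeasurableSet.univ_pi fun _ => measurableSet_Icc

/-- **Translation**: `∫_{[-π,π]²} G(k⃗' + p⃗_F) dk⃗' = ∫_{ℝ²} 1_B G` as soon as `G` vanishes on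
`(p⃗_F + [-π,π]²) \ B` and `B ⊆ p⃗_F + [-π,π]²` (the shift `k⃗ = k⃗' + p⃗_F(θ_{h,ω})` of (2.46)/(2.49)).
[cite: BenfattoGiulianiMastropietro2006, §2.5 (2.46)–(2.49) p0010:L55–L75] -/
theorem setIntegral_zoneSq_comp_add_eq (G : (Fin 2 → ℝ) → ℂ) (p : Fin 2 → ℝ) (B : Set (Fin 2 → ℝ))
    (h1 : ∀ q, q - p ∈ zoneSq → G q ≠ 0 → q ∈ B) (h2 : ∀ q ∈ B, q - p ∈ zoneSq) :
    ∫ k in zoneSq, G (k + p) = ∫ q, B.indicator G q := by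
  rw [← integral_indicator measurableSet_zoneSq]
  have e : (zoneSq.indicator fun k => G (k + p)) = fun k => ({q | q - p ∈ zoneSq} : Set (Fin 2 → ℝ)).indicator G (k + p) := by
    funext k
    by_cases hk : k ∈ zoneSq
    · have hk' : k + p - p ∈ zoneSq := by rwa [add_sub_cancel_right]
      simp only [Set.indicator, Set.mem_setOf_eq, if_pos hk, if_pos hk']
    · have hk' : k + p - p ∉ zoneSq := by rwa [add_sub_cancel_right]
      simp only [Set.indicator, Set.mem_setOf_eq, if_neg hk, if_neg hk']
  rw [e, integral_add_right_eq_self (fun q => ({q | q - p ∈ zoneSq} : Set (Fin 2 → ℝ)).indicator G q) p]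
  congr 1
  funext q
  simp only [Set.indicator, Set.mem_setOf_eq]
  by_cases hq : q - p ∈ zoneSq
  · rw [if_pos hq]
    by_cases hG : G q = 0
    · rw [hG]; split_ifs <;> rfl
    · rw [if_pos (h1 q hq hG)]
  · rw [if_neg hq]
    by_cases hB : q ∈ B
    · exact absurd (h2 q hB) hq
    · rw [if_neg hB]

/-- The polar angle of a ray point: `θ(ρe⃗_r(θ)) = θ` for `ρ > 0`, `θ ∈ (-π, π]`. [folklore] -/
private theorem polarAngle_smul_dir {ρ θ : ℝ} (hρ : 0 < ρ) (hθ : θ ∈ Ioc (-π) π) : polarAngle (ρ • dir θ) = θ := by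
  unfold polarAngle
  have : momToComplex (ρ • dir θ) = ρ * (Complex.cos θ + Complex.sin θ * Complex.I) := by
    apply Complex.ext <;> simp [momToComplex, Complex.cos_ofReal_re, Complex.sin_ofReal_re]
  rw [this]
  exact Complex.arg_mul_cos_add_sin_mul_I hρ hθ

/-- A ray point has `(ρe⃗_r)₁² + (ρe⃗_r)₂² = ρ²`. [folklore] -/
private theorem sq_add_sq_smul_dir (ρ θ : ℝ) : (ρ • dir θ) 0 ^ 2 + (ρ • dir θ) 1 ^ 2 = ρ ^ 2 := by
  simp only [Pi.smul_apply, smul_eq_mul, dir_zero, dir_one]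
  nlinarith [Real.sin_sq_add_cos_sq θ]

/-- **Polar coordinates on the disc** (`k⃗ = ρe⃗_r(θ)`, `dk⃗ = ρ dρ dθ`, (2.56b)): for the Euclidean ball
`B_r = {q₁² + q₂² < r²}`, `∫_{ℝ²} 1_{B_r} G = ∫_{(0,r)×(-π,π)} ρ G(ρe⃗_r(θ)) dρ dθ`. [cite: BenfattoGiulianiMastropietro2006, §2.5 (2.56b) p0011:L48–L52] -/
theorem integral_indicator_ball_eq_polar (G : (Fin 2 → ℝ) → ℂ) {r : ℝ} (hr : 0 < r) :
    ∫ q, {q : Fin 2 → ℝ | q 0 ^ 2 + q 1 ^ 2 < r ^ 2}.indicator G q =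
      ∫ p in Ioo 0 r ×ˢ Ioo (-π) π, (p.1 : ℂ) * G (p.1 • dir p.2) := by
  set B := {q : Fin 2 → ℝ | q 0 ^ 2 + q 1 ^ 2 < r ^ 2} with hB
  have hmp : MeasurePreserving (MeasurableEquiv.finTwoArrow (α := ℝ)).symm volume volume :=
    (volume_preserving_finTwoArrow ℝ).symm _
  have ha : ∫ q, B.indicator G q = ∫ p : ℝ × ℝ, B.indicator G ![p.1, p.2] := by
    rw [← hmp.integral_comp (MeasurableEquiv.measurableEmbedding _)]
    simp [MeasurableEquiv.finTwoArrow_symm_apply]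
  rw [ha, ← integral_comp_polarCoord_symm, polarCoord_target]
  rw [setIntegral_eq_of_subset_of_forall_sdiff_eq_zero (measurableSet_Ioi.prod measurableSet_Ioo)
    (Set.prod_mono Ioo_subset_Ioi_self subset_rfl)]
  · refine setIntegral_congr_fun (measurableSet_Ioo.prod measurableSet_Ioo) fun p hp => ?_
    have hp1 : 0 < p.1 := hp.1.1
    have hdir : (![p.1 * Real.cos p.2, p.1 * Real.sin p.2] : Fin 2 → ℝ) = p.1 • dir p.2 := by
      ext i; fin_cases i <;> simp [dir]
    have hmem : p.1 • dir p.2 ∈ B := by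
      simp only [hB, Set.mem_setOf_eq, sq_add_sq_smul_dir]
      exact pow_lt_pow_left₀ hp.1.2 hp1.le two_ne_zero
    simp only [polarCoord_symm_apply, Complex.real_smul, hdir, Set.indicator_of_mem hmem]
  · intro p hp
    have hp1 : 0 < p.1 := hp.1.1
    have hnot : ¬ p.1 < r := fun h => hp.2 ⟨⟨hp1, h⟩, hp.1.2⟩
    have hdir : (![p.1 * Real.cos p.2, p.1 * Real.sin p.2] : Fin 2 → ℝ) = p.1 • dir p.2 := by
      ext i; fin_cases i <;> simp [dir]
    have hmem : p.1 • dir p.2 ∉ B := by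
      simp only [hB, Set.mem_setOf_eq, sq_add_sq_smul_dir, not_lt]
      exact pow_le_pow_left₀ hr.le (not_lt.1 hnot) 2
    simp only [polarCoord_symm_apply, hdir, Set.indicator_of_notMem hmem, smul_zero]

/-- **Fubini with the angle outermost** on a product of sets. [folklore] -/
private theorem setIntegral_prod_symm' (f : ℝ × ℝ → ℂ) {s t : Set ℝ}
    (hf : IntegrableOn f (s ×ˢ t) (volume.prod volume)) :
    ∫ z in s ×ˢ t, f z = ∫ y in t, ∫ x in s, f (x, y) := by
  have hf' : Integrable f ((volume.restrict s).prod (volume.restrict t)) := by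
    rw [Measure.prod_restrict]; exact hf
  rw [Measure.volume_eq_prod, ← Measure.prod_restrict]
  exact integral_prod_symm f hf'

/-- A measurable function bounded on a product of bounded intervals is integrable there. [folklore] -/
private theorem integrableOn_prod_Ioo_of_bound {f : ℝ × ℝ → ℂ} (hf : Measurable f) {a b c d M : ℝ}
    (hM : ∀ p ∈ Ioo a b ×ˢ Ioo c d, ‖f p‖ ≤ M) :
    IntegrableOn f (Ioo a b ×ˢ Ioo c d) (volume.prod volume) := by
  refine IntegrableOn.of_bound ?_ hf.aestronglyMeasurable M ?_
  · rw [Measure.prod_prod]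
    exact ENNReal.mul_lt_top (by simp [Real.volume_Ioo]) (by simp [Real.volume_Ioo])
  · exact (ae_restrict_iff' (measurableSet_Ioo.prod measurableSet_Ioo)).2 (Eventually.of_forall hM)

/-- The inner `ρ`-integrals of an integrable function on the product are integrable in `θ`. [folklore] -/
private theorem integrableOn_inner {f : ℝ × ℝ → ℂ} {s t : Set ℝ}
    (hf : IntegrableOn f (s ×ˢ t) (volume.prod volume)) :
    IntegrableOn (fun y => ∫ x in s, f (x, y)) t := by
  have hf' : Integrable f ((volume.restrict s).prod (volume.restrict t)) := by
    rw [Measure.prod_restrict]; exact hf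
  exact hf'.integral_prod_right

/-- **The angular measure of a sector**: `∫_{(-π,π)} ζ_{m,ω}(θ)dθ ≤ (3/2)·(π/2^m)` (support (2.45): `ζ = 0`
at circle distance `≥ (3/4)·width` from its centre, `0 ≤ ζ ≤ 1`). [cite: BenfattoGiulianiMastropietro2006, §2.5 (2.45), (2.57) p0010:L33–L40] -/
theorem setIntegral_sectorWeightCirc_le (m : ℕ) (ω : ℤ) :
    ∫ θ in Ioo (-π) π, sectorWeightCirc m ω θ ≤ 3 / 2 * sectorWidth m := by
  set w := sectorWidth m with hw
  have hw0 : 0 < w := sectorWidth_pos m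
  have hwπ : w ≤ π := sectorWidth_le_pi m
  set c := ((ω : ℝ) + 1 / 2) * w with hc
  have hper : Function.Periodic (sectorWeightCirc m ω) (2 * π) := periodic_sectorWeightCirc m ω
  -- shift the period window to `[c - π, c + π]`
  have h1 : ∫ θ in Ioo (-π) π, sectorWeightCirc m ω θ = ∫ θ in (-π)..(-π + 2 * π), sectorWeightCirc m ω θ := by
    rw [intervalIntegral.integral_of_le (by linarith [Real.pi_pos]), integral_Ioc_eq_integral_Ioo]
    congr 1; ring_nf
  have h2 : ∫ θ in (-π)..(-π + 2 * π), sectorWeightCirc m ω θ = ∫ θ in (c - π)..(c - π + 2 * π), sectorWeightCirc m ω θ :=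
    hper.intervalIntegral_add_eq (-π) (c - π)
  have h3 : ∫ θ in (c - π)..(c - π + 2 * π), sectorWeightCirc m ω θ = ∫ θ in Ioc (c - π) (c + π), sectorWeightCirc m ω θ := by
    rw [intervalIntegral.integral_of_le (by linarith [Real.pi_pos])]; congr 1; ring_nf
  -- on that window, `ζ` vanishes off `[c - 3w/4, c + 3w/4]`
  have h4 : ∫ θ in Ioc (c - π) (c + π), sectorWeightCirc m ω θ = ∫ θ in Icc (c - 3 * w / 4) (c + 3 * w / 4), sectorWeightCirc m ω θ := by
    refine setIntegral_eq_of_subset_of_forall_sdiff_eq_zero measurableSet_Ioc ?_ ?_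
    · intro θ hθ; exact ⟨by linarith [hθ.1], by linarith [hθ.2]⟩
    · intro θ hθ
      apply sectorWeightCirc_eq_zero
      intro k
      rw [← hc]
      have hθ1 := hθ.1
      have hθ2 : θ ∉ Icc (c - 3 * w / 4) (c + 3 * w / 4) := hθ.2
      rw [mem_Icc, not_and_or, not_le, not_le] at hθ2
      rcases eq_or_ne k 0 with hk | hk
      · subst hk; simp only [Int.cast_zero, mul_zero, sub_zero]
        rcases hθ2 with h | h
        · rw [abs_of_neg (by linarith)]; linarith
        · rw [abs_of_pos (by linarith)]; linarith
      · have hk1 : (1 : ℝ) ≤ |(k : ℝ)| := by exact_mod_cast Int.one_le_abs hk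
        have : |θ - c| ≤ π := abs_le.2 ⟨by linarith [hθ1.1], by linarith [hθ1.2]⟩
        have h5 : 2 * π * |(k : ℝ)| - |θ - c| ≤ |θ - c - 2 * π * k| := by
          have h6 := abs_sub_abs_le_abs_sub (2 * π * (k : ℝ)) (θ - c)
          rw [abs_mul, abs_of_pos Real.two_pi_pos, abs_sub_comm (2 * π * (k : ℝ)) (θ - c)] at h6
          exact h6
        have h7 : 2 * π ≤ 2 * π * |(k : ℝ)| := by nlinarith [Real.pi_pos]
        linarith
  rw [h1, h2, h3, h4]
  have hvol : volume (Icc (c - 3 * w / 4) (c + 3 * w / 4)) < ⊤ := by simp [Real.volume_Icc]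
  have h5 := norm_setIntegral_le_of_norm_le_const hvol (f := sectorWeightCirc m ω) (C := 1)
    (fun θ _ => by rw [Real.norm_eq_abs, abs_of_nonneg (sectorWeightCirc_nonneg m ω θ)]; exact sectorWeightCirc_le_one m ω θ)
  rw [Measure.real, Real.volume_Icc, ENNReal.toReal_ofReal (by linarith)] at h5
  have : ∫ θ in Icc (c - 3 * w / 4) (c + 3 * w / 4), sectorWeightCirc m ω θ ≤ 1 * (c + 3 * w / 4 - (c - 3 * w / 4)) :=
    (le_abs_self _).trans ((Real.norm_eq_abs _).symm.le.trans h5)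
  linarith

end Plumbing


/-! ### §5 The per-angle estimate: linearised model, exact oddity, pointwise comparison -/

section PerAngle

/-- **"Zero by oddity"** ((2.56e)): for every real `u, λ, a` and every finite set `S` of Matsubara
indices stable under `j ↦ -1-j`, the linearised model
`Σ_{j∈S} ∫dρ u·f̃_h(|-ik₀(j)(1+a) + λ(ρ-u)|)/(-ik₀(j)(1+a) + λ(ρ-u))` vanishes: the integrand is odd
under `(k₀, ρ - u) ↦ (-k₀, -(ρ - u))`.  No integrability is needed. [cite: BenfattoGiulianiMastropietro2006, §2.5 proof of Lemma 2.2a (2.56e) p0011:L88–L96] -/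
theorem model_sum_integral_eq_zero (β e₀ u lam a : ℝ) (h : ℤ) {S : Finset ℤ} (hS : ∀ j ∈ S, -1 - j ∈ S) :
    ∑ j ∈ S, ∫ ρ : ℝ, (u : ℂ) *
      ((gnShell 4 e₀ h ‖-(Complex.I * (fermiMatsubara β j : ℂ)) * (1 + (a : ℂ)) + ((lam * (ρ - u) : ℝ) : ℂ)‖ : ℝ) : ℂ) /
        (-(Complex.I * (fermiMatsubara β j : ℂ)) * (1 + (a : ℂ)) + ((lam * (ρ - u) : ℝ) : ℂ)) = 0 := by
  -- the model integrand, re-centred at `u`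
  set F : ℤ → ℝ → ℂ := fun j s => (u : ℂ) *
      ((gnShell 4 e₀ h ‖-(Complex.I * (fermiMatsubara β j : ℂ)) * (1 + (a : ℂ)) + ((lam * s : ℝ) : ℂ)‖ : ℝ) : ℂ) /
        (-(Complex.I * (fermiMatsubara β j : ℂ)) * (1 + (a : ℂ)) + ((lam * s : ℝ) : ℂ)) with hF
  have hshift : ∀ j : ℤ, (∫ ρ : ℝ, (u : ℂ) *
      ((gnShell 4 e₀ h ‖-(Complex.I * (fermiMatsubara β j : ℂ)) * (1 + (a : ℂ)) + ((lam * (ρ - u) : ℝ) : ℂ)‖ : ℝ) : ℂ) /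
        (-(Complex.I * (fermiMatsubara β j : ℂ)) * (1 + (a : ℂ)) + ((lam * (ρ - u) : ℝ) : ℂ))) = ∫ s, F j s := by
    intro j
    have h1 := integral_sub_right_eq_self (μ := volume) (F j) u
    rw [← h1]
  have hodd : ∀ (j : ℤ) (s : ℝ), F (-1 - j) (-s) = -F j s := by
    intro j s
    simp only [hF, fermiMatsubara_reflect]
    have e : -(Complex.I * ((-fermiMatsubara β j : ℝ) : ℂ)) * (1 + (a : ℂ)) + ((lam * -s : ℝ) : ℂ) =
        -(-(Complex.I * (fermiMatsubara β j : ℂ)) * (1 + (a : ℂ)) + ((lam * s : ℝ) : ℂ)) := by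
      push_cast; ring
    rw [e, norm_neg, div_neg]
  simp_rw [hshift]
  refine sum_eq_zero_of_reflect hS _ fun j _ => ?_
  rw [← integral_neg_eq_self (F (-1 - j)) volume, ← integral_neg]
  exact integral_congr_ae (Eventually.of_forall fun s => hodd j s)

/-- **The pointwise comparison** behind (2.56d)–(2.56e).  Along a fixed ray (angle `θ`, Matsubara
frequency `k₀`), let `D_h(ρ)`, `D_{h-1}(ρ)` be the two denominators, `f(ρ) = H₀(γ^{-h}|D_h|) -
H₀(γ^{-h+1}|D_{h-1}|)` the scale cutoff (2.28), and `D₁(ρ) = -ik₀(1+a) + λ(ρ-u)` the linearised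
denominator.  If `|D_h - D_{h-1}| ≤ η ≤ Δ`, `|D_{h-1} - D₁| ≤ Δ` near `u`, `Δ ≤ ½e₀γ^{h-2}`, and the
support facts of (2.42a) hold, then the true integrand `ρ f/D_{h-1}` (restricted to `(0, r_B)`) and the
model `u f̃_h(|D₁|)/D₁` differ by at most
`C = 32R'γ^{-h}/e₀ + (192 r_B L/e₀ + 1024 r_B/e₀²)·Δγ^{-2h}` on `[u - R', u + R']` and agree (both
vanish) elsewhere — with `R', Δ = O(γ^h), O(γ^{2h})` this `C` is `O(1)`: the three replacements
`ρ → u`, `f_h → f̃_h`, `D_{h-1} → D₁` are each relatively `O(γ^h)` ("the rest `R` is dimensionally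
bounded by `cγ^{5h/2}`"). [cite: BenfattoGiulianiMastropietro2006, §2.5 proof of Lemma 2.2a (2.56d)–(2.56e) p0011:L60–L94] -/
theorem norm_sub_model_le {e₀ L η Δ u R' rB lam a k₀ : ℝ} {h : ℤ} (he : 0 < e₀)
    (hL : ∀ s t : ℝ, |gnCutoff 4 e₀ s - gnCutoff 4 e₀ t| ≤ L * |s - t|) (hL0 : 0 ≤ L)
    {Dh Dh1 : ℝ → ℂ}
    (hη : ∀ ρ, ‖Dh ρ - Dh1 ρ‖ ≤ η) (hηΔ : η ≤ Δ) (hΔ : Δ ≤ e₀ * (4 : ℝ) ^ (h - 2) / 2)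
    (hsupp : ∀ ρ ∈ Ioo 0 rB, gnScaleCutoff 4 e₀ h ‖Dh ρ‖ - gnScaleCutoff 4 e₀ (h - 1) ‖Dh1 ρ‖ ≠ 0 →
      e₀ * (4 : ℝ) ^ (h - 2) < ‖Dh1 ρ‖ ∧ |ρ - u| ≤ R')
    (hD1 : ∀ ρ, |ρ - u| ≤ R' →
      ‖Dh1 ρ - (-(Complex.I * (k₀ : ℂ)) * (1 + (a : ℂ)) + ((lam * (ρ - u) : ℝ) : ℂ))‖ ≤ Δ)
    (hlam : 0 < lam) (hlamR : e₀ * (4 : ℝ) ^ h ≤ lam * R') (hR' : 0 ≤ R') (huR : R' < u) (hurB : u + R' < rB)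
    (ρ : ℝ) :
    ‖(Ioo 0 rB).indicator (fun ρ => (ρ : ℂ) *
        ((gnScaleCutoff 4 e₀ h ‖Dh ρ‖ - gnScaleCutoff 4 e₀ (h - 1) ‖Dh1 ρ‖ : ℝ) : ℂ) / Dh1 ρ) ρ -
      (u : ℂ) * ((gnShell 4 e₀ h ‖-(Complex.I * (k₀ : ℂ)) * (1 + (a : ℂ)) + ((lam * (ρ - u) : ℝ) : ℂ)‖ : ℝ) : ℂ) /
        (-(Complex.I * (k₀ : ℂ)) * (1 + (a : ℂ)) + ((lam * (ρ - u) : ℝ) : ℂ))‖ ≤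
      (32 * R' * (4 : ℝ) ^ (-h) / e₀ + (192 * rB * L / e₀ + 1024 * rB / e₀ ^ 2) * Δ * (4 : ℝ) ^ (-2 * h)) *
        (Icc (u - R') (u + R')).indicator 1 ρ := by
  have hγ : (1 : ℝ) < 4 := by norm_num
  have h4 := four_zpow_pos h
  have h4' := four_zpow_pos (-h)
  have h42 := four_zpow_pos (h - 2)
  set D1 : ℂ := -(Complex.I * (k₀ : ℂ)) * (1 + (a : ℂ)) + ((lam * (ρ - u) : ℝ) : ℂ) with hD1def
  set f : ℝ := gnScaleCutoff 4 e₀ h ‖Dh ρ‖ - gnScaleCutoff 4 e₀ (h - 1) ‖Dh1 ρ‖ with hfdef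
  set ft : ℝ := gnShell 4 e₀ h ‖D1‖ with hftdef
  have hft' : ft = gnScaleCutoff 4 e₀ h ‖D1‖ - gnScaleCutoff 4 e₀ (h - 1) ‖D1‖ := rfl
  -- size of the two cutoffs
  have hf1 : |f| ≤ 1 := by
    have h1 := gnScaleCutoff_mem_Icc 4 e₀ h ‖Dh ρ‖
    have h2 := gnScaleCutoff_mem_Icc 4 e₀ (h - 1) ‖Dh1 ρ‖
    rw [hfdef, abs_le]; constructor <;> linarith [h1.1, h1.2, h2.1, h2.2]
  have hft1 : |ft| ≤ 1 := by
    have h1 := gnScaleCutoff_mem_Icc 4 e₀ h ‖D1‖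
    have h2 := gnScaleCutoff_mem_Icc 4 e₀ (h - 1) ‖D1‖
    rw [hft', abs_le]; constructor <;> linarith [h1.1, h1.2, h2.1, h2.2]
  -- the constant is nonnegative
  have hRB : 0 < rB := by linarith
  have hΔ0 : 0 ≤ Δ := le_trans ((norm_nonneg _).trans (hη 0)) hηΔ
  set Cpt := 32 * R' * (4 : ℝ) ^ (-h) / e₀ + (192 * rB * L / e₀ + 1024 * rB / e₀ ^ 2) * Δ * (4 : ℝ) ^ (-2 * h)
    with hCpt
  have hCpt0 : 0 ≤ Cpt := by rw [hCpt]; positivity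
  -- trivial case: both integrands vanish
  by_cases hzero : (Ioo 0 rB).indicator (fun ρ => (ρ : ℂ) * ((gnScaleCutoff 4 e₀ h ‖Dh ρ‖ -
      gnScaleCutoff 4 e₀ (h - 1) ‖Dh1 ρ‖ : ℝ) : ℂ) / Dh1 ρ) ρ = 0 ∧ ft = 0
  · rw [hzero.1]
    have : ((gnShell 4 e₀ h ‖D1‖ : ℝ) : ℂ) = 0 := by rw [← hftdef, hzero.2]; simp
    rw [this, mul_zero, zero_div, sub_zero, norm_zero]
    exact mul_nonneg hCpt0 (Set.indicator_nonneg (fun _ _ => zero_le_one) _)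
  -- otherwise `|ρ - u| ≤ R'`, `ρ ∈ (0, r_B)`, and both denominators are `≥ d = ½e₀4^{h-2}`
  have hkey : |ρ - u| ≤ R' ∧ ρ ∈ Ioo 0 rB ∧ e₀ * (4 : ℝ) ^ (h - 2) / 2 ≤ ‖Dh1 ρ‖ ∧
      e₀ * (4 : ℝ) ^ (h - 2) / 2 ≤ ‖D1‖ := by
    rw [not_and_or] at hzero
    rcases hzero with hne | hne
    · -- the true integrand is nonzero: `ρ ∈ (0,r_B)` and `f ≠ 0`
      have hρ : ρ ∈ Ioo 0 rB := by
        by_contra hρ; exact hne (Set.indicator_of_notMem hρ _)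
      have hf : f ≠ 0 := by
        intro hf0
        apply hne
        rw [Set.indicator_of_mem hρ]
        simp [← hfdef, hf0]
      obtain ⟨hlo, hR⟩ := hsupp ρ hρ hf
      have hd := hD1 ρ hR
      refine ⟨hR, hρ, by linarith, ?_⟩
      have := norm_sub_norm_le (Dh1 ρ) D1
      linarith
    · -- the model is nonzero: `e₀4^{h-2} < |D₁| < e₀4^h`
      have hmem := mem_Ioo_of_gnShell_ne_zero hγ he hne
      have hRe : |lam * (ρ - u)| ≤ ‖D1‖ := by
        have : D1.re = lam * (ρ - u) := by rw [hD1def]; simp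
        rw [← this]; exact Complex.abs_re_le_norm D1
      have hR : |ρ - u| ≤ R' := by
        rw [abs_mul, abs_of_pos hlam] at hRe
        have : lam * |ρ - u| ≤ lam * R' := by linarith [hmem.2]
        exact le_of_mul_le_mul_left this hlam
      have hρ : ρ ∈ Ioo 0 rB := by
        have := abs_le.1 hR
        exact ⟨by linarith, by linarith⟩
      have hd := hD1 ρ hR
      refine ⟨hR, hρ, ?_, by linarith [hmem.1]⟩
      have := norm_sub_norm_le D1 (Dh1 ρ)
      rw [norm_sub_rev] at this
      linarith [hmem.1]
  obtain ⟨hR, hρ, hd1, hd2⟩ := hkey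
  have hdpos : 0 < e₀ * (4 : ℝ) ^ (h - 2) / 2 := by positivity
  have hDh1_ne : Dh1 ρ ≠ 0 := fun h0 => by rw [h0, norm_zero] at hd1; linarith
  have hD1_ne : D1 ≠ 0 := fun h0 => by rw [h0, norm_zero] at hd2; linarith
  rw [Set.indicator_of_mem hρ, Set.indicator_of_mem (show ρ ∈ Icc (u - R') (u + R') from
    ⟨by linarith [(abs_le.1 hR).1], by linarith [(abs_le.1 hR).2]⟩), Pi.one_apply, mul_one]
  have hΔρ := hD1 ρ hR
  -- the three-term splitting `ρ f/D - u ft/D₁ = (ρ-u) f/D + u (f - ft)/D + u ft (1/D - 1/D₁)`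
  have hsplit : (ρ : ℂ) * ((f : ℝ) : ℂ) / Dh1 ρ - (u : ℂ) * ((ft : ℝ) : ℂ) / D1 =
      ((ρ - u : ℝ) : ℂ) * ((f : ℝ) : ℂ) / Dh1 ρ + (u : ℂ) * (((f - ft : ℝ) : ℂ) / Dh1 ρ) +
        (u : ℂ) * ((ft : ℝ) : ℂ) * ((Dh1 ρ)⁻¹ - D1⁻¹) := by
    push_cast
    field_simp
    ring
  -- bounds on the inverses
  have hinv1 : ‖(Dh1 ρ)⁻¹‖ ≤ 32 * (4 : ℝ) ^ (-h) / e₀ := by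
    rw [norm_inv]
    calc ‖Dh1 ρ‖⁻¹ ≤ (e₀ * (4 : ℝ) ^ (h - 2) / 2)⁻¹ := inv_anti₀ hdpos hd1
      _ = 32 * (4 : ℝ) ^ (-h) / e₀ := by rw [four_zpow_sub_two, zpow_neg]; field_simp; ring
  have hinv2 : ‖(Dh1 ρ)⁻¹ - D1⁻¹‖ ≤ Δ * (32 * (4 : ℝ) ^ (-h) / e₀) ^ 2 := by
    rw [inv_sub_inv hDh1_ne hD1_ne, norm_div, norm_mul, norm_sub_rev]
    rw [div_le_iff₀ (by positivity)]
    have h1 : ‖Dh1 ρ - D1‖ ≤ Δ := hΔρ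
    have hprod : (e₀ * (4 : ℝ) ^ (h - 2) / 2) * (e₀ * (4 : ℝ) ^ (h - 2) / 2) ≤ ‖Dh1 ρ‖ * ‖D1‖ :=
      mul_le_mul hd1 hd2 hdpos.le (norm_nonneg _)
    have e : (32 * (4 : ℝ) ^ (-h) / e₀) ^ 2 * ((e₀ * (4 : ℝ) ^ (h - 2) / 2) * (e₀ * (4 : ℝ) ^ (h - 2) / 2)) = 1 := by
      rw [four_zpow_sub_two, zpow_neg]; field_simp; ring
    calc ‖Dh1 ρ - D1‖ ≤ Δ * 1 := by rw [mul_one]; exact h1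
      _ = Δ * ((32 * (4 : ℝ) ^ (-h) / e₀) ^ 2 * ((e₀ * (4 : ℝ) ^ (h - 2) / 2) * (e₀ * (4 : ℝ) ^ (h - 2) / 2))) := by
          rw [e]
      _ ≤ Δ * ((32 * (4 : ℝ) ^ (-h) / e₀) ^ 2 * (‖Dh1 ρ‖ * ‖D1‖)) := by gcongr
      _ = Δ * (32 * (4 : ℝ) ^ (-h) / e₀) ^ 2 * (‖Dh1 ρ‖ * ‖D1‖) := by ring
  -- the cutoff comparison `|f - ft| ≤ 6 L 4^{-h} Δ`
  have hfft : |f - ft| ≤ 6 * L * (4 : ℝ) ^ (-h) * Δ := by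
    have e : f - ft = (gnScaleCutoff 4 e₀ h ‖Dh ρ‖ - gnScaleCutoff 4 e₀ h ‖D1‖) -
        (gnScaleCutoff 4 e₀ (h - 1) ‖Dh1 ρ‖ - gnScaleCutoff 4 e₀ (h - 1) ‖D1‖) := by rw [hfdef, hft']; ring
    rw [e]
    have hLip : ∀ (h' : ℤ) (s t : ℝ), |gnScaleCutoff 4 e₀ h' s - gnScaleCutoff 4 e₀ h' t| ≤
        L * (4 : ℝ) ^ (-h') * |s - t| := by
      intro h' s t
      have h1 := hL ((4 : ℝ) ^ (-h') * s) ((4 : ℝ) ^ (-h') * t)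
      rw [← mul_sub, abs_mul, abs_of_pos (zpow_pos (by norm_num : (0 : ℝ) < 4) _)] at h1
      simpa [gnScaleCutoff, mul_assoc] using h1
    have h1 := hLip h ‖Dh ρ‖ ‖D1‖
    have h2 := hLip (h - 1) ‖Dh1 ρ‖ ‖D1‖
    have hn1 : |‖Dh ρ‖ - ‖D1‖| ≤ 2 * Δ := by
      calc |‖Dh ρ‖ - ‖D1‖| ≤ ‖Dh ρ - D1‖ := abs_norm_sub_norm_le _ _
        _ ≤ ‖Dh ρ - Dh1 ρ‖ + ‖Dh1 ρ - D1‖ := norm_sub_le_norm_sub_add_norm_sub _ _ _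
        _ ≤ η + Δ := add_le_add (hη ρ) hΔρ
        _ ≤ 2 * Δ := by linarith
    have hn2 : |‖Dh1 ρ‖ - ‖D1‖| ≤ Δ := (abs_norm_sub_norm_le _ _).trans hΔρ
    have e4 : (4 : ℝ) ^ (-(h - 1)) = 4 * (4 : ℝ) ^ (-h) := by
      rw [neg_sub, sub_eq_neg_add, zpow_add_one₀ (by norm_num : (4 : ℝ) ≠ 0)]; ring
    rw [e4] at h2
    have hb1 : L * (4 : ℝ) ^ (-h) * |‖Dh ρ‖ - ‖D1‖| ≤ L * (4 : ℝ) ^ (-h) * (2 * Δ) :=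
      mul_le_mul_of_nonneg_left hn1 (by positivity)
    have hb2 : L * (4 * (4 : ℝ) ^ (-h)) * |‖Dh1 ρ‖ - ‖D1‖| ≤ L * (4 * (4 : ℝ) ^ (-h)) * Δ :=
      mul_le_mul_of_nonneg_left hn2 (by positivity)
    calc _ ≤ |gnScaleCutoff 4 e₀ h ‖Dh ρ‖ - gnScaleCutoff 4 e₀ h ‖D1‖| +
          |gnScaleCutoff 4 e₀ (h - 1) ‖Dh1 ρ‖ - gnScaleCutoff 4 e₀ (h - 1) ‖D1‖| := abs_sub _ _
      _ ≤ L * (4 : ℝ) ^ (-h) * (2 * Δ) + L * (4 * (4 : ℝ) ^ (-h)) * Δ := add_le_add (h1.trans hb1) (h2.trans hb2)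
      _ = 6 * L * (4 : ℝ) ^ (-h) * Δ := by ring
  -- assemble
  have hu0 : 0 ≤ u := by linarith
  have hurB' : u ≤ rB := by linarith
  change ‖(ρ : ℂ) * ((f : ℝ) : ℂ) / Dh1 ρ - (u : ℂ) * ((ft : ℝ) : ℂ) / D1‖ ≤ Cpt
  rw [hsplit]
  have hT1 : ‖((ρ - u : ℝ) : ℂ) * ((f : ℝ) : ℂ) / Dh1 ρ‖ ≤ R' * 1 * (32 * (4 : ℝ) ^ (-h) / e₀) := by
    rw [div_eq_mul_inv, norm_mul, norm_mul, Complex.norm_real, Complex.norm_real, Real.norm_eq_abs,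
      Real.norm_eq_abs]
    exact mul_le_mul (mul_le_mul hR hf1 (abs_nonneg _) hR') hinv1 (norm_nonneg _) (by positivity)
  have hT2 : ‖(u : ℂ) * (((f - ft : ℝ) : ℂ) / Dh1 ρ)‖ ≤ rB * ((6 * L * (4 : ℝ) ^ (-h) * Δ) * (32 * (4 : ℝ) ^ (-h) / e₀)) := by
    rw [div_eq_mul_inv, norm_mul, norm_mul, Complex.norm_real, Complex.norm_real, Real.norm_eq_abs,
      Real.norm_eq_abs, abs_of_nonneg hu0]
    exact mul_le_mul hurB' (mul_le_mul hfft hinv1 (norm_nonneg _) (by positivity)) (by positivity) hRB.le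
  have hT3 : ‖(u : ℂ) * ((ft : ℝ) : ℂ) * ((Dh1 ρ)⁻¹ - D1⁻¹)‖ ≤ rB * 1 * (Δ * (32 * (4 : ℝ) ^ (-h) / e₀) ^ 2) := by
    rw [norm_mul, norm_mul, Complex.norm_real, Complex.norm_real, Real.norm_eq_abs, Real.norm_eq_abs,
      abs_of_nonneg hu0]
    exact mul_le_mul (mul_le_mul hurB' hft1 (abs_nonneg _) hRB.le) hinv2 (norm_nonneg _) (by positivity)
  have hzpow : (4 : ℝ) ^ (-2 * h) = (4 : ℝ) ^ (-h) * (4 : ℝ) ^ (-h) := by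
    rw [show -2 * h = -h + -h by ring, zpow_add₀ (by norm_num : (4 : ℝ) ≠ 0)]
  calc _ ≤ ‖((ρ - u : ℝ) : ℂ) * ((f : ℝ) : ℂ) / Dh1 ρ + (u : ℂ) * (((f - ft : ℝ) : ℂ) / Dh1 ρ)‖ +
        ‖(u : ℂ) * ((ft : ℝ) : ℂ) * ((Dh1 ρ)⁻¹ - D1⁻¹)‖ := norm_add_le _ _
    _ ≤ (‖((ρ - u : ℝ) : ℂ) * ((f : ℝ) : ℂ) / Dh1 ρ‖ + ‖(u : ℂ) * (((f - ft : ℝ) : ℂ) / Dh1 ρ)‖) +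
        ‖(u : ℂ) * ((ft : ℝ) : ℂ) * ((Dh1 ρ)⁻¹ - D1⁻¹)‖ := by gcongr; exact norm_add_le _ _
    _ ≤ (R' * 1 * (32 * (4 : ℝ) ^ (-h) / e₀) + rB * ((6 * L * (4 : ℝ) ^ (-h) * Δ) * (32 * (4 : ℝ) ^ (-h) / e₀))) +
        rB * 1 * (Δ * (32 * (4 : ℝ) ^ (-h) / e₀) ^ 2) := by gcongr
    _ = Cpt := by
        rw [hCpt, hzpow]; field_simp; ring

/-- The true integrand along a ray, restricted to `(0, r_B)`, is integrable (bounded by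
`r_B·16γ^{-h}/e₀`, measurable). [folklore] -/
private theorem integrable_indicator_ray {e₀ rB : ℝ} {h : ℤ} (he : 0 < e₀) {Dh Dh1 : ℝ → ℂ}
    (hDh : Continuous Dh) (hDh1 : Continuous Dh1)
    (hsupp : ∀ ρ ∈ Ioo 0 rB, gnScaleCutoff 4 e₀ h ‖Dh ρ‖ - gnScaleCutoff 4 e₀ (h - 1) ‖Dh1 ρ‖ ≠ 0 →
      e₀ * (4 : ℝ) ^ (h - 2) < ‖Dh1 ρ‖) :
    Integrable ((Ioo 0 rB).indicator fun ρ => (ρ : ℂ) *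
      ((gnScaleCutoff 4 e₀ h ‖Dh ρ‖ - gnScaleCutoff 4 e₀ (h - 1) ‖Dh1 ρ‖ : ℝ) : ℂ) / Dh1 ρ) := by
  rw [integrable_indicator_iff measurableSet_Ioo]
  have hcont : Continuous fun ρ => gnScaleCutoff 4 e₀ h ‖Dh ρ‖ - gnScaleCutoff 4 e₀ (h - 1) ‖Dh1 ρ‖ :=
    ((contDiff_gnScaleCutoff 4 e₀ h (m := 0)).continuous.comp hDh.norm).sub
      ((contDiff_gnScaleCutoff 4 e₀ (h - 1) (m := 0)).continuous.comp hDh1.norm)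
  have hmeas : Measurable fun ρ : ℝ => (ρ : ℂ) *
      ((gnScaleCutoff 4 e₀ h ‖Dh ρ‖ - gnScaleCutoff 4 e₀ (h - 1) ‖Dh1 ρ‖ : ℝ) : ℂ) / Dh1 ρ := by
    simp_rw [div_eq_mul_inv]
    exact ((Complex.measurable_ofReal.comp measurable_id).mul
      (Complex.measurable_ofReal.comp hcont.measurable)).mul hDh1.measurable.inv
  refine IntegrableOn.of_bound (by simp [Real.volume_Ioo]) hmeas.aestronglyMeasurable
    (|rB| * (16 * (4 : ℝ) ^ (-h) / e₀)) ?_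
  refine (ae_restrict_iff' measurableSet_Ioo).2 (Eventually.of_forall fun ρ hρ => ?_)
  by_cases hf : gnScaleCutoff 4 e₀ h ‖Dh ρ‖ - gnScaleCutoff 4 e₀ (h - 1) ‖Dh1 ρ‖ = 0
  · rw [hf]; simp; positivity
  · have hlo := hsupp ρ hρ hf
    have hpos : 0 < e₀ * (4 : ℝ) ^ (h - 2) := mul_pos he (four_zpow_pos _)
    have hf1 : |gnScaleCutoff 4 e₀ h ‖Dh ρ‖ - gnScaleCutoff 4 e₀ (h - 1) ‖Dh1 ρ‖| ≤ 1 := by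
      have h1 := gnScaleCutoff_mem_Icc 4 e₀ h ‖Dh ρ‖
      have h2 := gnScaleCutoff_mem_Icc 4 e₀ (h - 1) ‖Dh1 ρ‖
      rw [abs_le]; constructor <;> linarith [h1.1, h1.2, h2.1, h2.2]
    have hinv : ‖(Dh1 ρ)⁻¹‖ ≤ 16 * (4 : ℝ) ^ (-h) / e₀ := by
      rw [norm_inv]
      calc ‖Dh1 ρ‖⁻¹ ≤ (e₀ * (4 : ℝ) ^ (h - 2))⁻¹ := inv_anti₀ hpos hlo.le
        _ = 16 * (4 : ℝ) ^ (-h) / e₀ := by rw [four_zpow_sub_two, zpow_neg]; field_simp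
    rw [div_eq_mul_inv, norm_mul, norm_mul, Complex.norm_real, Complex.norm_real, Real.norm_eq_abs,
      Real.norm_eq_abs]
    have hρ' : |ρ| ≤ |rB| := by
      rw [abs_of_pos hρ.1, abs_of_pos (hρ.1.trans hρ.2)]; exact hρ.2.le
    calc |ρ| * |gnScaleCutoff 4 e₀ h ‖Dh ρ‖ - gnScaleCutoff 4 e₀ (h - 1) ‖Dh1 ρ‖| * ‖(Dh1 ρ)⁻¹‖
        ≤ |rB| * 1 * (16 * (4 : ℝ) ^ (-h) / e₀) :=
          mul_le_mul (mul_le_mul hρ' hf1 (abs_nonneg _) (abs_nonneg _)) hinv (norm_nonneg _) (by positivity)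
      _ = |rB| * (16 * (4 : ℝ) ^ (-h) / e₀) := by ring

/-- The linearised model along a ray is integrable (bounded by `|u|·16γ^{-h}/e₀`, supported in
`|ρ - u| < e₀γ^h/λ`, measurable). [folklore] -/
private theorem integrable_model_ray {e₀ u lam a k₀ : ℝ} {h : ℤ} (he : 0 < e₀) (hlam : 0 < lam) :
    Integrable fun ρ : ℝ => (u : ℂ) *
      ((gnShell 4 e₀ h ‖-(Complex.I * (k₀ : ℂ)) * (1 + (a : ℂ)) + ((lam * (ρ - u) : ℝ) : ℂ)‖ : ℝ) : ℂ) /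
        (-(Complex.I * (k₀ : ℂ)) * (1 + (a : ℂ)) + ((lam * (ρ - u) : ℝ) : ℂ)) := by
  have hγ : (1 : ℝ) < 4 := by norm_num
  set w := e₀ * (4 : ℝ) ^ h / lam with hw
  have hw0 : 0 < w := by rw [hw]; exact div_pos (mul_pos he (four_zpow_pos _)) hlam
  set D1 : ℝ → ℂ := fun ρ => -(Complex.I * (k₀ : ℂ)) * (1 + (a : ℂ)) + ((lam * (ρ - u) : ℝ) : ℂ) with hD1
  have hD1c : Continuous D1 :=
    continuous_const.add (Complex.continuous_ofReal.comp (continuous_const.mul (continuous_id.sub continuous_const)))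
  set F : ℝ → ℂ := fun ρ => (u : ℂ) * ((gnShell 4 e₀ h ‖D1 ρ‖ : ℝ) : ℂ) / D1 ρ with hF
  change Integrable F
  -- `F` vanishes off `(u - w, u + w)`
  have hzero : ∀ ρ, ρ ∉ Ioo (u - w) (u + w) → F ρ = 0 := by
    intro ρ hρ
    have hsh : gnShell 4 e₀ h ‖D1 ρ‖ = 0 := by
      by_contra hne
      have hmem := mem_Ioo_of_gnShell_ne_zero hγ he hne
      have hRe : |lam * (ρ - u)| ≤ ‖D1 ρ‖ := by
        have : (D1 ρ).re = lam * (ρ - u) := by simp [hD1]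
        rw [← this]; exact Complex.abs_re_le_norm _
      rw [abs_mul, abs_of_pos hlam] at hRe
      have h3 : |ρ - u| < w := by
        rw [hw, lt_div_iff₀ hlam]; nlinarith [hmem.2]
      exact hρ ⟨by linarith [(abs_lt.1 h3).1], by linarith [(abs_lt.1 h3).2]⟩
    simp [hF, hsh]
  have hind : F = (Ioo (u - w) (u + w)).indicator F := by
    funext ρ
    by_cases hρ : ρ ∈ Ioo (u - w) (u + w)
    · rw [Set.indicator_of_mem hρ]
    · rw [Set.indicator_of_notMem hρ, hzero ρ hρ]
  rw [hind, integrable_indicator_iff measurableSet_Ioo]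
  have hmeas : Measurable F := by
    simp only [hF]
    simp_rw [div_eq_mul_inv]
    exact (measurable_const.mul (Complex.measurable_ofReal.comp
      ((contDiff_gnShell 4 e₀ h (m := 0)).continuous.comp hD1c.norm).measurable)).mul hD1c.measurable.inv
  refine IntegrableOn.of_bound (by simp [Real.volume_Ioo]) hmeas.aestronglyMeasurable
    (|u| * (16 * (4 : ℝ) ^ (-h) / e₀)) (Eventually.of_forall fun ρ => ?_)
  simp only [hF]
  by_cases hsh : gnShell 4 e₀ h ‖D1 ρ‖ = 0
  · rw [hsh]; simp; positivity
  · have hmem := mem_Ioo_of_gnShell_ne_zero hγ he hsh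
    have hpos : 0 < e₀ * (4 : ℝ) ^ (h - 2) := mul_pos he (four_zpow_pos _)
    have hinv : ‖(D1 ρ)⁻¹‖ ≤ 16 * (4 : ℝ) ^ (-h) / e₀ := by
      rw [norm_inv]
      calc ‖D1 ρ‖⁻¹ ≤ (e₀ * (4 : ℝ) ^ (h - 2))⁻¹ := inv_anti₀ hpos hmem.1.le
        _ = 16 * (4 : ℝ) ^ (-h) / e₀ := by rw [four_zpow_sub_two, zpow_neg]; field_simp
    have hs1 : |gnShell 4 e₀ h ‖D1 ρ‖| ≤ 1 := by
      rw [abs_of_nonneg (gnShell_nonneg hγ he h (norm_nonneg _))]; exact gnShell_le_one _ _ _ _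
    rw [div_eq_mul_inv, norm_mul, norm_mul, Complex.norm_real, Complex.norm_real, Real.norm_eq_abs,
      Real.norm_eq_abs]
    calc |u| * |gnShell 4 e₀ h ‖D1 ρ‖| * ‖(D1 ρ)⁻¹‖ ≤ |u| * 1 * (16 * (4 : ℝ) ^ (-h) / e₀) :=
          mul_le_mul (mul_le_mul_of_nonneg_left hs1 (abs_nonneg _)) hinv (norm_nonneg _) (by positivity)
      _ = |u| * (16 * (4 : ℝ) ^ (-h) / e₀) := by ring

/-- **Per-angle assembly**: if the true integrands `A_j` and the models `B_j` (both integrable) differ by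
at most `C·1_{[u-R',u+R']}` pointwise and the models sum-integrate to zero, then
`|Σ_{j∈S} ∫A_j| ≤ #S · 2R'C`. [cite: BenfattoGiulianiMastropietro2006, §2.5 proof of Lemma 2.2a (2.56d)–(2.56e) p0011:L60–L96] -/
theorem norm_sum_integral_le_of_model {S : Finset ℤ} {A B : ℤ → ℝ → ℂ} {Cpt R' u : ℝ}
    (hA : ∀ j ∈ S, Integrable (A j)) (hB : ∀ j ∈ S, Integrable (B j))
    (hAB : ∀ j ∈ S, ∀ ρ, ‖A j ρ - B j ρ‖ ≤ Cpt * (Icc (u - R') (u + R')).indicator 1 ρ)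
    (hB0 : ∑ j ∈ S, ∫ ρ, B j ρ = 0) (hR' : 0 ≤ R') :
    ‖∑ j ∈ S, ∫ ρ, A j ρ‖ ≤ S.card * (Cpt * (2 * R')) := by
  have hsplit : ∑ j ∈ S, ∫ ρ, A j ρ = ∑ j ∈ S, ∫ ρ, (A j ρ - B j ρ) := by
    rw [← add_zero (∑ j ∈ S, ∫ ρ, (A j ρ - B j ρ)), ← hB0, ← Finset.sum_add_distrib]
    refine Finset.sum_congr rfl fun j hj => ?_
    rw [integral_sub (hA j hj) (hB j hj), sub_add_cancel]
  rw [hsplit]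
  have hg : Integrable (fun ρ : ℝ => Cpt * (Icc (u - R') (u + R')).indicator (1 : ℝ → ℝ) ρ) := by
    have e : (fun ρ : ℝ => Cpt * (Icc (u - R') (u + R')).indicator (1 : ℝ → ℝ) ρ) =
        (Icc (u - R') (u + R')).indicator fun _ => Cpt := by
      funext ρ; by_cases hρ : ρ ∈ Icc (u - R') (u + R') <;> simp [hρ]
    rw [e, integrable_indicator_iff measurableSet_Icc]
    exact integrableOn_const (by simp [Real.volume_Icc])
  have hgint : ∫ ρ : ℝ, Cpt * (Icc (u - R') (u + R')).indicator (1 : ℝ → ℝ) ρ = Cpt * (2 * R') := by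
    have e : (fun ρ : ℝ => Cpt * (Icc (u - R') (u + R')).indicator (1 : ℝ → ℝ) ρ) =
        (Icc (u - R') (u + R')).indicator fun _ => Cpt := by
      funext ρ; by_cases hρ : ρ ∈ Icc (u - R') (u + R') <;> simp [hρ]
    rw [e, integral_indicator_const Cpt measurableSet_Icc, Measure.real, Real.volume_Icc,
      ENNReal.toReal_ofReal (by linarith), smul_eq_mul]
    ring
  have hterm : ∀ j ∈ S, ‖∫ ρ, (A j ρ - B j ρ)‖ ≤ Cpt * (2 * R') := by
    intro j hj
    rw [← hgint]
    exact norm_integral_le_of_norm_le hg (Eventually.of_forall (hAB j hj))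
  calc ‖∑ j ∈ S, ∫ ρ, (A j ρ - B j ρ)‖ ≤ ∑ j ∈ S, ‖∫ ρ, (A j ρ - B j ρ)‖ := norm_sum_le _ _
    _ ≤ ∑ j ∈ S, Cpt * (2 * R') := Finset.sum_le_sum hterm
    _ = S.card * (Cpt * (2 * R')) := by rw [Finset.sum_const, nsmul_eq_mul]

end PerAngle


/-! ### §6a Consequences of the standing hypotheses (2.36) + `c₀` for the scales `h`, `h - 1` -/

section Standing

variable {μ e₀ β U c₀ : ℝ} {C : ℕ → ℝ} {hβ : ℤ} {E : ℤ → ℝ × (Fin 2 → ℝ) → ℂ} {h : ℤ}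

/-- `|U||h'| ≤ c₀` for every scale `h_β ≤ h' ≤ 0` once `|U||h_β| ≤ c₀`. [folklore] -/
private theorem abs_U_mul_le (hh₁ : hβ ≤ h) (hh₀ : h ≤ 0) (hUh : |U| * |(hβ : ℝ)| ≤ c₀) :
    |U| * |(h : ℝ)| ≤ c₀ := by
  have : |(h : ℝ)| ≤ |(hβ : ℝ)| := by
    rw [abs_of_nonpos (by exact_mod_cast hh₀), abs_of_nonpos (by exact_mod_cast (hh₁.trans hh₀))]
    exact_mod_cast neg_le_neg hh₁
  exact (mul_le_mul_of_nonneg_left this (abs_nonneg U)).trans hUh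

/-- `U²(h-1)² ≤ 4c₀²`. [folklore] -/
private theorem U_sq_mul_sq_le (hh₁ : hβ ≤ h) (hh₀ : h ≤ 0) (hU : |U| ≤ c₀) (hUh : |U| * |(hβ : ℝ)| ≤ c₀) :
    U ^ 2 * (((h - 1 : ℤ) : ℝ)) ^ 2 ≤ 4 * c₀ ^ 2 := by
  have h1 := abs_U_mul_le hh₁ hh₀ hUh
  have h2 : |U| * |(((h - 1 : ℤ)) : ℝ)| ≤ 2 * c₀ := by
    have : |(((h - 1 : ℤ)) : ℝ)| ≤ |(h : ℝ)| + 1 := by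
      push_cast
      calc |(h : ℝ) - 1| ≤ |(h : ℝ)| + |(1 : ℝ)| := abs_sub _ _
        _ = |(h : ℝ)| + 1 := by rw [abs_one]
    calc |U| * |(((h - 1 : ℤ)) : ℝ)| ≤ |U| * (|(h : ℝ)| + 1) := mul_le_mul_of_nonneg_left this (abs_nonneg U)
      _ = |U| * |(h : ℝ)| + |U| := by ring
      _ ≤ c₀ + c₀ := add_le_add h1 hU
      _ = 2 * c₀ := by ring
  have h3 : (|U| * |(((h - 1 : ℤ)) : ℝ)|) ^ 2 ≤ (2 * c₀) ^ 2 := pow_le_pow_left₀ (by positivity) h2 2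
  calc U ^ 2 * (((h - 1 : ℤ) : ℝ)) ^ 2 = (|U| * |(((h - 1 : ℤ)) : ℝ)|) ^ 2 := by rw [mul_pow, sq_abs, sq_abs]
    _ ≤ (2 * c₀) ^ 2 := h3
    _ = 4 * c₀ ^ 2 := by ring

/-- **The dispersion increment at scale `h`**: `|E_h(k) - E_{h-1}(k)| ≤ C₀c₀γ^{2h}` on `D_β × ℝ²`
((2.36) with `|U||h| ≤ c₀`). [cite: BenfattoGiulianiMastropietro2006, §2.3 (2.36) p0008:L46] -/
theorem norm_E_sub_E_le (hS : BGMSmoothness β U C hβ E) (hh₁ : hβ ≤ h) (hh₀ : h ≤ 0)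
    (hUh : |U| * |(hβ : ℝ)| ≤ c₀) {k₀ : ℝ} (hk₀ : k₀ ∈ matsubaraSet β) (q : Fin 2 → ℝ) :
    ‖E h (k₀, q) - E (h - 1) (k₀, q)‖ ≤ |C 0| * c₀ * (4 : ℝ) ^ (2 * h) := by
  have h1 := (hS.2.2 h hh₁ hh₀).1 k₀ hk₀ q
  have h2 := abs_U_mul_le hh₁ hh₀ hUh
  have h4 : (0 : ℝ) ≤ (4 : ℝ) ^ (2 * h) := (zpow_pos (by norm_num) _).le
  calc _ ≤ C 0 * |U| * |(h : ℝ)| * (4 : ℝ) ^ (2 * h) := h1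
    _ = C 0 * ((|U| * |(h : ℝ)|) * (4 : ℝ) ^ (2 * h)) := by ring
    _ ≤ |C 0| * ((|U| * |(h : ℝ)|) * (4 : ℝ) ^ (2 * h)) :=
        mul_le_mul_of_nonneg_right (le_abs_self _) (by positivity)
    _ ≤ |C 0| * (c₀ * (4 : ℝ) ^ (2 * h)) := by gcongr
    _ = _ := by ring

end Standing


/-! ### §6b Along a ray: continuity, support and the linearisation error of the scale-`h-1` denominator -/

section Ray

variable {μ e₀ β U c₀ : ℝ} {C : ℕ → ℝ} {hβ : ℤ} {E : ℤ → ℝ × (Fin 2 → ℝ) → ℂ} {h : ℤ}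

/-- `e⃗_r` is continuous. [folklore] -/
private theorem continuous_dir' : Continuous dir := by
  refine continuous_pi fun i => ?_
  fin_cases i
  · simpa [dir] using Real.continuous_cos
  · simpa [dir] using Real.continuous_sin

/-- The denominators are continuous along a ray (indeed in `k⃗`). [folklore] -/
private theorem continuous_bgmDenom_ray (hS : BGMSmoothness β U C hβ E) (μ : ℝ) (h' : ℤ) (k₀ θ : ℝ) :
    Continuous fun ρ : ℝ => bgmDenom μ E h' (k₀, ρ • dir θ) := by
  have hc : Continuous fun k : Fin 2 → ℝ => E h' (k₀, k) := (hS.1 h' k₀ 0).continuous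
  have hray : Continuous fun ρ : ℝ => ρ • dir θ := continuous_id.smul continuous_const
  simp only [bgmDenom]
  exact continuous_const.add ((hc.comp hray).sub continuous_const)

/-- The free band below a ray point: `ε₀(t e⃗_r) ≤ -4 + t²`. [folklore] -/
private theorem sqDispersion_ray_le' (t θ : ℝ) : sqDispersion (t • dir θ) ≤ -4 + t ^ 2 := by
  have h1 := Real.one_sub_sq_div_two_le_cos (x := t * Real.cos θ)
  have h2 := Real.one_sub_sq_div_two_le_cos (x := t * Real.sin θ)
  have hcs := Real.sin_sq_add_cos_sq θ
  simp only [sqDispersion, Pi.smul_apply, smul_eq_mul, dir_zero, dir_one]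
  nlinarith

/-- Every planar momentum is a `2πℤ²`-translate of a point of `[-π, π]²`. [folklore] -/
private theorem exists_sub_mem_zoneSq (q : Fin 2 → ℝ) :
    ∃ z : Fin 2 → ℤ, (q - fun i => 2 * π * (z i : ℝ)) ∈ zoneSq := by
  refine ⟨fun i => ⌊(q i + π) / (2 * π)⌋, fun i _ => ?_⟩
  have h1 := Int.floor_le ((q i + π) / (2 * π))
  have h2 := Int.lt_floor_add_one ((q i + π) / (2 * π))
  have hπ := Real.two_pi_pos
  rw [le_div_iff₀ hπ] at h1
  rw [div_lt_iff₀ hπ] at h2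
  simp only [Pi.sub_apply, Set.mem_Icc]
  constructor <;> nlinarith

/-- **(2.42a) on the support of `f_h`, level and denominator form**: if `f_h(k₀, q⃗) ≠ 0` with
`|k₀| ≤ 8e₀γ^h`, then `|ε_h(q⃗) - μ| ≤ 3e₀γ^h` and `e₀γ^{h-2} < |D_{h-1}(k₀,q⃗)| < 2e₀γ^h`.
[cite: BenfattoGiulianiMastropietro2006, §2.4 (2.42a) p0010:L9–L16] -/
theorem level_of_bgmShell_ne_zero (hI : BGMInitial E) (hSy : BGMSymmetry E) (hS : BGMSmoothness β U C hβ E)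
    (he : 0 < e₀) (hβpos : 0 < β) (hh₁ : hβ ≤ h) (hh₀ : h ≤ 0) (hU : |U| ≤ c₀) (hUh : |U| * |(hβ : ℝ)| ≤ c₀)
    (hK₀ : |C 0| * c₀ ≤ 3 / 16 * e₀) (hK₂ : 4 * |C 2| * c₀ ^ 2 * (64 * e₀) ≤ 1)
    {j : ℤ} (hj : |fermiMatsubara β j| ≤ 8 * e₀ * (4 : ℝ) ^ h) {q : Fin 2 → ℝ}
    (hf : bgmShell e₀ μ E h (fermiMatsubara β j, q) ≠ 0) :
    |bgmEffDisp β E h q - μ| ≤ 3 * e₀ * (4 : ℝ) ^ h ∧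
      e₀ * (4 : ℝ) ^ (h - 2) < ‖bgmDenom μ E (h - 1) (fermiMatsubara β j, q)‖ ∧
      ‖bgmDenom μ E (h - 1) (fermiMatsubara β j, q)‖ < 2 * e₀ * (4 : ℝ) ^ h := by
  have h4 : (0 : ℝ) < (4 : ℝ) ^ h := zpow_pos (by norm_num) _
  have h41 : (4 : ℝ) ^ h ≤ 1 := zpow_le_one_of_nonpos₀ (by norm_num) hh₀
  have hX : 0 < e₀ * (4 : ℝ) ^ h := mul_pos he h4
  have hc₀ : 0 ≤ c₀ := (abs_nonneg U).trans hU
  have hk₀ := fermiMatsubara_mem β j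
  -- the increment at scale `h`
  have hη : ‖E h (fermiMatsubara β j, q) - E (h - 1) (fermiMatsubara β j, q)‖ ≤ 3 / 16 * e₀ * (4 : ℝ) ^ h := by
    have h1 := norm_E_sub_E_le hS hh₁ hh₀ hUh hk₀ q
    have : (4 : ℝ) ^ (2 * h) ≤ (4 : ℝ) ^ h := zpow_le_zpow_right₀ (by norm_num) (by omega)
    calc _ ≤ |C 0| * c₀ * (4 : ℝ) ^ (2 * h) := h1
      _ ≤ |C 0| * c₀ * (4 : ℝ) ^ h := by gcongr
      _ ≤ 3 / 16 * e₀ * (4 : ℝ) ^ h := by gcongr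
  obtain ⟨hlo, hhi⟩ := norm_bgmDenom_bounds_of_bgmShell_ne_zero he hη hf
  refine ⟨?_, hlo, hhi⟩
  -- the decomposition and the remainder
  set M := |C 2| * U ^ 2 * (((h - 1 : ℤ) : ℝ)) ^ 2 with hM
  have hMle : M ≤ 4 * |C 2| * c₀ ^ 2 := by
    have := U_sq_mul_sq_le hh₁ hh₀ hU hUh
    calc M = |C 2| * (U ^ 2 * (((h - 1 : ℤ) : ℝ)) ^ 2) := by rw [hM]; ring
      _ ≤ |C 2| * (4 * c₀ ^ 2) := mul_le_mul_of_nonneg_left this (abs_nonneg _)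
      _ = 4 * |C 2| * c₀ ^ 2 := by ring
  have hM2 : ∀ j' : ℤ, ‖bgmTimeDiffIter β 2 (E (h - 1)) (fermiMatsubara β j', q)‖ ≤ M := fun j' => by
    have := norm_bgmTimeDiffIter_two_le hI hS (h' := h - 1) (by omega) (by omega) (fermiMatsubara_mem β j') q
    simpa [hM] using this
  have hr := norm_remainder_le hSy hβpos hM2 j
  have hdec := bgmDenom_decomp μ β E (h - 1) (fermiMatsubara β j) q
  have hlev := abs_level_le_of_decomp hdec hr
  -- `ε_h` versus `ε' = Re E_{h-1}(π/β, ·)`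
  have hεε : |bgmEffDisp β E h q - (E (h - 1) (π / β, q)).re| ≤ 3 / 16 * e₀ * (4 : ℝ) ^ h := by
    rw [bgmEffDisp_eq_re hSy, ← Complex.sub_re]
    refine (Complex.abs_re_le_norm _).trans ?_
    have h1 := norm_E_sub_E_le hS hh₁ hh₀ hUh (pi_div_mem_matsubaraSet'' β) q
    have : (4 : ℝ) ^ (2 * h) ≤ (4 : ℝ) ^ h := zpow_le_zpow_right₀ (by norm_num) (by omega)
    calc _ ≤ |C 0| * c₀ * (4 : ℝ) ^ (2 * h) := h1
      _ ≤ |C 0| * c₀ * (4 : ℝ) ^ h := by gcongr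
      _ ≤ 3 / 16 * e₀ * (4 : ℝ) ^ h := by gcongr
  -- the remainder term `(M/2)k₀² ≤ 32 M e₀² 4^{2h} ≤ ½ e₀ 4^h`
  have hrem : M / 2 * fermiMatsubara β j ^ 2 ≤ 1 / 2 * e₀ * (4 : ℝ) ^ h := by
    have hM0 : 0 ≤ M := by rw [hM]; positivity
    have h1 : fermiMatsubara β j ^ 2 ≤ (8 * e₀ * (4 : ℝ) ^ h) ^ 2 := by
      rw [← sq_abs]; exact pow_le_pow_left₀ (abs_nonneg _) hj 2
    calc M / 2 * fermiMatsubara β j ^ 2 ≤ M / 2 * (8 * e₀ * (4 : ℝ) ^ h) ^ 2 := by gcongr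
      _ = (M * (64 * e₀)) * (4 : ℝ) ^ h * (1 / 2 * e₀ * (4 : ℝ) ^ h) := by ring
      _ ≤ 1 * 1 * (1 / 2 * e₀ * (4 : ℝ) ^ h) := by
          gcongr
          · exact (mul_le_mul_of_nonneg_right hMle (by positivity)).trans hK₂
      _ = 1 / 2 * e₀ * (4 : ℝ) ^ h := by ring
  have h5 := abs_sub_le (bgmEffDisp β E h q) ((E (h - 1) (π / β, q)).re) μ
  nlinarith
  where
  /-- `π/β ∈ D_β`. [folklore] -/
  pi_div_mem_matsubaraSet'' (β : ℝ) : π / β ∈ matsubaraSet β := ⟨0, by simp [fermiMatsubara]⟩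

/-- **(2.42a), frequency form on the true support**: `f_h(k₀,q⃗) ≠ 0 ⟹ |k₀| < 8e₀γ^h`. [cite: BenfattoGiulianiMastropietro2006, §2.4 (2.42a) p0010:L9–L14] -/
theorem abs_k0_lt_of_bgmShell_ne_zero (hI : BGMInitial E) (hSy : BGMSymmetry E) (hS : BGMSmoothness β U C hβ E)
    (he : 0 < e₀) (hβpos : 0 < β) (hh₁ : hβ ≤ h) (hh₀ : h ≤ 0) (hU : |U| ≤ c₀) (hUh : |U| * |(hβ : ℝ)| ≤ c₀)
    (hK₀ : |C 0| * c₀ ≤ 3 / 16 * e₀) (hK₁ : 2 * |C 1| * c₀ ^ 2 ≤ 1 / 2)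
    (hK₂' : 2 * (4 * |C 2| * c₀ ^ 2) * (2 * |C 0| * c₀ + 2 * e₀) ≤ 1)
    {j : ℤ} {q : Fin 2 → ℝ} (hf : bgmShell e₀ μ E h (fermiMatsubara β j, q) ≠ 0) :
    |fermiMatsubara β j| < 8 * e₀ * (4 : ℝ) ^ h := by
  have h4 : (0 : ℝ) < (4 : ℝ) ^ h := zpow_pos (by norm_num) _
  have h41 : (4 : ℝ) ^ h ≤ 1 := zpow_le_one_of_nonpos₀ (by norm_num) hh₀
  have hk₀ := fermiMatsubara_mem β j
  have hc₀ : 0 ≤ c₀ := (abs_nonneg U).trans hU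
  have hη : ‖E h (fermiMatsubara β j, q) - E (h - 1) (fermiMatsubara β j, q)‖ ≤ 3 / 16 * e₀ * (4 : ℝ) ^ h := by
    have h1 := norm_E_sub_E_le hS hh₁ hh₀ hUh hk₀ q
    have : (4 : ℝ) ^ (2 * h) ≤ (4 : ℝ) ^ h := zpow_le_zpow_right₀ (by norm_num) (by omega)
    calc _ ≤ |C 0| * c₀ * (4 : ℝ) ^ (2 * h) := h1
      _ ≤ |C 0| * c₀ * (4 : ℝ) ^ h := by gcongr
      _ ≤ 3 / 16 * e₀ * (4 : ℝ) ^ h := by gcongr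
  obtain ⟨-, hhi⟩ := norm_bgmDenom_bounds_of_bgmShell_ne_zero he hη hf
  set M := |C 2| * U ^ 2 * (((h - 1 : ℤ) : ℝ)) ^ 2 with hM
  have hMle : M ≤ 4 * |C 2| * c₀ ^ 2 := by
    have := U_sq_mul_sq_le hh₁ hh₀ hU hUh
    calc M = |C 2| * (U ^ 2 * (((h - 1 : ℤ) : ℝ)) ^ 2) := by rw [hM]; ring
      _ ≤ |C 2| * (4 * c₀ ^ 2) := mul_le_mul_of_nonneg_left this (abs_nonneg _)
      _ = 4 * |C 2| * c₀ ^ 2 := by ring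
  have hM2 : ∀ j' : ℤ, ‖bgmTimeDiffIter β 2 (E (h - 1)) (fermiMatsubara β j', q)‖ ≤ M := fun j' => by
    have := norm_bgmTimeDiffIter_two_le hI hS (h' := h - 1) (by omega) (by omega) (fermiMatsubara_mem β j') q
    simpa [hM] using this
  have hr := norm_remainder_le hSy hβpos hM2 j
  have hdec := bgmDenom_decomp μ β E (h - 1) (fermiMatsubara β j) q
  have hdec2 : bgmDenom μ E (h - 1) (fermiMatsubara β j, q) =
      -(Complex.I * (fermiMatsubara β j : ℂ)) + (E (h - 1) (fermiMatsubara β j, q) - (μ : ℂ)) := by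
    simp only [bgmDenom]
  have ha : |(-(β / π) * (E (h - 1) (π / β, q)).im)| ≤ 1 / 2 := by
    rw [neg_mul, abs_neg]
    have := abs_a_le hI hSy hS (h' := h - 1) (by omega) (by omega) q
    have hU2 : U ^ 2 ≤ c₀ ^ 2 := by rw [← sq_abs]; exact pow_le_pow_left₀ (abs_nonneg U) hU 2
    calc _ ≤ 2 * |C 1| * U ^ 2 := this
      _ ≤ 2 * |C 1| * c₀ ^ 2 := by gcongr
      _ ≤ 1 / 2 := hK₁
  have hA := norm_E_sub_sqDispersion_le hI hS (h' := h - 1) (by omega) (by omega) hk₀ q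
  have hA' : ‖E (h - 1) (fermiMatsubara β j, q) - ((sqDispersion q : ℝ) : ℂ)‖ ≤ 2 * |C 0| * c₀ :=
    hA.trans (by gcongr)
  have hMA : 2 * M * (2 * |C 0| * c₀ + 2 * e₀) ≤ 1 :=
    le_trans (mul_le_mul_of_nonneg_right (mul_le_mul_of_nonneg_left hMle (by norm_num)) (by positivity)) hK₂'
  have := abs_k0_lt_of_norm_lt hdec hdec2 ha hr hA' hMA (s := 2 * e₀ * (4 : ℝ) ^ h) (by nlinarith) hhi
  linarith

end Ray


/-! ### §6c The per-angle bound for BGM's sector propagator (all Matsubara frequencies of the support) -/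

section PerAngleBGM

variable {μ e₀ β U c₀ : ℝ} {C : ℕ → ℝ} {hβ : ℤ} {E : ℤ → ℝ × (Fin 2 → ℝ) → ℂ} {h : ℤ}

/-- Coordinates of a ray point: `|(t e⃗_r)ᵢ| ≤ |t|`. [folklore] -/
private theorem abs_smul_dir_apply_le'' (t θ : ℝ) (i : Fin 2) : |(t • dir θ) i| ≤ |t| := by
  rw [Pi.smul_apply, smul_eq_mul, abs_mul]
  exact (mul_le_mul_of_nonneg_left (abs_dir_le_one θ i) (abs_nonneg t)).trans (by rw [mul_one])

/-- `e⃗_r = cos θ · ê₁ + sin θ · ê₂`. [folklore] -/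
private theorem dir_eq_smul_single_add (θ : ℝ) :
    dir θ = (dir θ 0) • (Pi.single 0 1 : Fin 2 → ℝ) + (dir θ 1) • (Pi.single 1 1 : Fin 2 → ℝ) := by
  ext i; fin_cases i <;> simp

/-- **`a(k⃗)` is Lipschitz along rays**: `|a(ρe⃗_r) - a(ue⃗_r)| ≤ 8C₂c₀²|ρ - u|`, where
`a(k⃗) = -(β/π)Im E_{h-1}(π/β,k⃗) = i∂_{k₀}E_{h-1}(-π/β,k⃗)` (the mixed derivatives of (2.36)).
[cite: BenfattoGiulianiMastropietro2006, §2.4 (2.42)–(2.44) p0009:L101–p0010:L4] -/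
theorem abs_a_ray_sub_le (hI : BGMInitial E) (hSy : BGMSymmetry E) (hS : BGMSmoothness β U C hβ E)
    (hh₁ : hβ ≤ h) (hh₀ : h ≤ 0) (hU : |U| ≤ c₀) (hUh : |U| * |(hβ : ℝ)| ≤ c₀) (θ ρ u : ℝ) :
    |(-(β / π) * (E (h - 1) (π / β, ρ • dir θ)).im) - (-(β / π) * (E (h - 1) (π / β, u • dir θ)).im)| ≤
      8 * |C 2| * c₀ ^ 2 * |ρ - u| := by
  set T : (Fin 2 → ℝ) → ℂ := fun q => bgmTimeDiffIter β 1 (E (h - 1)) (-(π / β), q) with hT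
  have hTa : ∀ q, -(β / π) * (E (h - 1) (π / β, q)).im = -(T q).im := by
    intro q
    show _ = -(bgmTimeDiffIter β 1 (E (h - 1)) (-(π / β), q)).im
    rw [bgmTimeDiffIter_one_neg_pi_div hSy β (h - 1) q]
    simp
  rw [hTa, hTa, neg_sub_neg, ← Complex.sub_im]
  refine (Complex.abs_im_le_norm _).trans ?_
  -- mean value inequality for `s ↦ T(s e⃗_r)`
  have hdiff : ∀ q, DifferentiableAt ℝ T q := fun q =>
    (norm_fderiv_bgmTimeDiffIter_one_le hI hS (h' := h - 1) (by omega) (by omega)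
      (q := q) (k₀ := -(π / β)) ⟨-1, by simp [fermiMatsubara]; ring⟩ 0).1
  have hbd : ∀ q (i : Fin 2), ‖fderiv ℝ T q (Pi.single i 1)‖ ≤ 4 * |C 2| * c₀ ^ 2 := by
    intro q i
    have h1 := (norm_fderiv_bgmTimeDiffIter_one_le hI hS (h' := h - 1) (by omega) (by omega)
      (q := q) (k₀ := -(π / β)) ⟨-1, by simp [fermiMatsubara]; ring⟩ i).2
    have h2 := U_sq_mul_sq_le hh₁ hh₀ hU hUh
    calc _ ≤ |C 2| * U ^ 2 * (((h - 1 : ℤ) : ℝ)) ^ 2 := h1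
      _ = |C 2| * (U ^ 2 * (((h - 1 : ℤ) : ℝ)) ^ 2) := by ring
      _ ≤ |C 2| * (4 * c₀ ^ 2) := mul_le_mul_of_nonneg_left h2 (abs_nonneg _)
      _ = 4 * |C 2| * c₀ ^ 2 := by ring
  have hray : ∀ s : ℝ, HasDerivAt (fun s : ℝ => T (s • dir θ)) (fderiv ℝ T (s • dir θ) (dir θ)) s := by
    intro s
    have hl : HasDerivAt (fun s : ℝ => s • dir θ) (dir θ) s := by
      simpa using (hasDerivAt_id s).smul_const (dir θ)
    exact (hdiff (s • dir θ)).hasFDerivAt.comp_hasDerivAt s hl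
  have hbound : ∀ s : ℝ, ‖fderiv ℝ T (s • dir θ) (dir θ)‖ ≤ 8 * |C 2| * c₀ ^ 2 := by
    intro s
    have hv : (fderiv ℝ T (s • dir θ)) (dir θ) =
        (fderiv ℝ T (s • dir θ)) ((dir θ 0) • (Pi.single 0 1 : Fin 2 → ℝ) + (dir θ 1) • (Pi.single 1 1 : Fin 2 → ℝ)) :=
      congrArg (fderiv ℝ T (s • dir θ)) (dir_eq_smul_single_add θ)
    rw [hv, map_add, map_smul, map_smul]
    have hc := Real.abs_cos_le_one θ
    have hs := Real.abs_sin_le_one θ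
    calc _ ≤ ‖(dir θ 0) • fderiv ℝ T (s • dir θ) (Pi.single 0 1)‖ + ‖(dir θ 1) • fderiv ℝ T (s • dir θ) (Pi.single 1 1)‖ :=
          norm_add_le _ _
      _ ≤ 1 * (4 * |C 2| * c₀ ^ 2) + 1 * (4 * |C 2| * c₀ ^ 2) := by
          rw [norm_smul, norm_smul, Real.norm_eq_abs, Real.norm_eq_abs, dir_zero, dir_one]
          exact add_le_add (mul_le_mul hc (hbd _ 0) (norm_nonneg _) zero_le_one)
            (mul_le_mul hs (hbd _ 1) (norm_nonneg _) zero_le_one)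
      _ = 8 * |C 2| * c₀ ^ 2 := by ring
  have h := Convex.norm_image_sub_le_of_norm_hasDerivWithin_le (s := Set.univ)
    (f := fun s : ℝ => T (s • dir θ)) (fun x _ => (hray x).hasDerivWithinAt) (fun x _ => hbound x)
    convex_univ (Set.mem_univ ρ) (Set.mem_univ u)
  rw [Real.norm_eq_abs, abs_sub_comm] at h
  exact h

/-- **Localisation along a ray**: a point `ρe⃗_r(θ)`, `0 < ρ < 3π/4`, whose level is within `w`
of `μ` lies within `w/(4c/π - 2δ₁)` of the Fermi radius `u = u_h(θ,0)` (it is `≥ c`, `≤ π/2` by the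
Euclidean radius bound, and the radial slope is `≥ 4c/π - 2δ₁` in between). [cite: BenfattoGiulianiMastropietro2006, §2.5 proof of Lemma 2.2a (2.56e) p0011:L88–L92] -/
theorem ray_localisation {ε : (Fin 2 → ℝ) → ℝ} {δ₀ δ₁ c μ w ρ u θ : ℝ} (hε : ContDiff ℝ 2 ε)
    (h0 : ∀ k, |ε k - sqDispersion k| ≤ δ₀)
    (h1 : ∀ k v, |fderiv ℝ ε k v - fderiv ℝ sqDispersion k v| ≤ δ₁ * (|v 0| + |v 1|)) (hδ₁ : 0 ≤ δ₁)
    (hc : 0 < c) (hcsq : c ^ 2 ≤ μ + 4 - w - δ₀) (hL : μ + w + δ₀ < -2 - Real.sqrt 2) (hμ : -4 < μ)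
    (hρ : ρ ∈ Ioo 0 (3 * π / 4)) (hlev : |ε (ρ • dir θ) - μ| ≤ w)
    (hu : IsLevelRadius ε μ θ u) (hcu : c ≤ u) :
    (4 / π * c - 2 * δ₁) * |ρ - u| ≤ w := by
  have hlev' := abs_le.1 hlev
  -- `ρ ≥ c`
  have hρc : c ≤ ρ := by
    have hε0 := (abs_le.1 (h0 (ρ • dir θ))).2
    have hfree := sqDispersion_ray_le' ρ θ
    have hsq : c ^ 2 ≤ ρ ^ 2 := by linarith
    exact le_of_sq_le_sq (by linarith) hρ.1.le
  -- `ρ ≤ π/2` (indeed `< π/4`)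
  have hw0 : 0 ≤ w := (abs_nonneg _).trans hlev
  have hδ₀0 : 0 ≤ δ₀ := (abs_nonneg _).trans (h0 0)
  have hρ2 : ρ ≤ π / 2 := by
    have hLv : sqDispersion (ρ • dir θ) ≤ μ + w + δ₀ := by
      have := (abs_le.1 (h0 (ρ • dir θ))).1; linarith
    have hs2 : (0 : ℝ) < Real.sqrt 2 := Real.sqrt_pos.2 (by norm_num)
    have hqi : ∀ i, |(ρ • dir θ) i| ≤ π := fun i => (abs_smul_dir_apply_le'' ρ θ i).trans
      (by rw [abs_of_pos hρ.1]; linarith [hρ.2, Real.pi_pos])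
    have h1 := sqrt_sq_add_sq_le_umklappRadius (by linarith) hqi hLv
    have h2 := umklappRadius_lt_pi_div_four (by linarith) hL
    rw [sq_add_sq_smul_dir, Real.sqrt_sq hρ.1.le] at h1
    linarith [Real.pi_pos]
  have hsep := mul_abs_sub_le_abs_eps_sub hε h1 hδ₁ hc.le θ (s := ρ) (t := u) ⟨hρc, hρ2⟩ ⟨hcu, hu.1.2⟩
  rw [hu.2] at hsep
  exact hsep.trans hlev

set_option maxHeartbeats 400000 in
/-- **The per-angle bound.**  For every angle `θ` and every finite set `S` of Matsubara indices in the
support `|k₀| ≤ 8e₀γ^h`, stable under `j ↦ -1-j`: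
`|Σ_{j∈S} ∫_0^{3π/4} ρ f_h(k₀(j), ρe⃗_r(θ))/D_{h-1}(k₀(j), ρe⃗_r(θ)) dρ| ≤ #S · 2R' · C_θ`,
`R' = 6e₀γ^h/c'`, `C_θ` independent of `h`, `β`, `θ`, `U` — the content of (2.56b)–(2.56e) for one
angular slice, below the scale threshold. [cite: BenfattoGiulianiMastropietro2006, §2.5 proof of Lemma 2.2a (2.56b)–(2.56e) p0011:L48–L96] -/
theorem norm_sum_ray_integral_le (hI : BGMInitial E) (hSy : BGMSymmetry E) (hS : BGMSmoothness β U C hβ E)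
    (he : 0 < e₀) (hβpos : 0 < β) (hh₁ : hβ ≤ h) (hh₀ : h ≤ 0) (hU : |U| ≤ c₀) (hUh : |U| * |(hβ : ℝ)| ≤ c₀)
    (hμ₁ : -4 < μ) (hμ₂ : μ < -2 - Real.sqrt 2)
    (hK₀ : |C 0| * c₀ ≤ 3 / 16 * e₀)
    (hK₂ : 4 * |C 2| * c₀ ^ 2 * (64 * e₀) ≤ 1) (hδ₂ : |C 2| * c₀ ^ 2 ≤ 1 / 4)
    (hδ₀a : 2 * |C 0| * c₀ ≤ (μ + 4) / 8) (hδ₀b : 2 * |C 0| * c₀ ≤ (-2 - Real.sqrt 2 - μ) / 4)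
    (hδ₁ : 2 * |C 1| * c₀ ^ 2 ≤ Real.sqrt ((μ + 4) / 2) / 4)
    (ht1a : 3 * e₀ * (4 : ℝ) ^ h ≤ (μ + 4) / 8) (ht1b : 3 * e₀ * (4 : ℝ) ^ h ≤ (-2 - Real.sqrt 2 - μ) / 4)
    (ht2 : 6 * e₀ * (4 : ℝ) ^ h / Real.sqrt ((μ + 4) / 2) < Real.sqrt ((μ + 4) / 2))
    (ht5 : (384 * |C 2| * c₀ ^ 2 * e₀ ^ 2 / Real.sqrt ((μ + 4) / 2) + |C 0| * c₀ +
        108 * e₀ ^ 2 / (Real.sqrt ((μ + 4) / 2)) ^ 2 + 128 * |C 2| * c₀ ^ 2 * e₀ ^ 2) * (4 : ℝ) ^ (2 * h) ≤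
        e₀ * (4 : ℝ) ^ (h - 2) / 2)
    {L : ℝ} (hL : ∀ s t : ℝ, |gnCutoff 4 e₀ s - gnCutoff 4 e₀ t| ≤ L * |s - t|) (hL0 : 0 ≤ L)
    (θ : ℝ) {S : Finset ℤ} (hSsym : ∀ j ∈ S, -1 - j ∈ S)
    (hSR : ∀ j ∈ S, |fermiMatsubara β j| ≤ 8 * e₀ * (4 : ℝ) ^ h) :
    ‖∑ j ∈ S, ∫ ρ in Ioo 0 (3 * π / 4), (ρ : ℂ) *
        ((bgmShell e₀ μ E h (fermiMatsubara β j, ρ • dir θ) : ℝ) : ℂ) /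
          bgmDenom μ E (h - 1) (fermiMatsubara β j, ρ • dir θ)‖ ≤
      S.card * ((192 / Real.sqrt ((μ + 4) / 2) +
        (192 * (3 * π / 4) * L / e₀ + 1024 * (3 * π / 4) / e₀ ^ 2) *
          (384 * |C 2| * c₀ ^ 2 * e₀ ^ 2 / Real.sqrt ((μ + 4) / 2) + |C 0| * c₀ +
            108 * e₀ ^ 2 / (Real.sqrt ((μ + 4) / 2)) ^ 2 + 128 * |C 2| * c₀ ^ 2 * e₀ ^ 2)) *
        (2 * (6 * e₀ * (4 : ℝ) ^ h / Real.sqrt ((μ + 4) / 2)))) := by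
  -- constants
  have hπ3 := Real.pi_gt_three
  have hπ4 := Real.pi_lt_four
  have h4 : (0 : ℝ) < (4 : ℝ) ^ h := zpow_pos (by norm_num) _
  have h41 : (4 : ℝ) ^ h ≤ 1 := zpow_le_one_of_nonpos₀ (by norm_num) hh₀
  have hX : 0 < e₀ * (4 : ℝ) ^ h := mul_pos he h4
  have hc₀ : 0 ≤ c₀ := (abs_nonneg U).trans hU
  have hgap : 0 < -2 - Real.sqrt 2 - μ := by linarith
  set c' := Real.sqrt ((μ + 4) / 2) with hc'
  have hc'pos : 0 < c' := Real.sqrt_pos.2 (by linarith)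
  have hc'sq : c' ^ 2 = (μ + 4) / 2 := Real.sq_sqrt (by linarith)
  set δ₀ := 2 * |C 0| * c₀ with hδ₀
  set δ₁ := 2 * |C 1| * c₀ ^ 2 with hδ₁'
  set δ₂ := |C 2| * c₀ ^ 2 with hδ₂'
  have hδ₀0 : 0 ≤ δ₀ := by positivity
  have hδ₁0 : 0 ≤ δ₁ := by positivity
  have hδ₂0 : 0 ≤ δ₂ := by positivity
  set M := 4 * |C 2| * c₀ ^ 2 with hM
  set R := 8 * e₀ * (4 : ℝ) ^ h with hR
  set R' := 6 * e₀ * (4 : ℝ) ^ h / c' with hR'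
  have hR'0 : 0 ≤ R' := by positivity
  set rB := 3 * π / 4 with hrB
  set η := |C 0| * c₀ * (4 : ℝ) ^ (2 * h) with hη
  set La := 8 * |C 2| * c₀ ^ 2 with hLa
  set CΔ := 384 * |C 2| * c₀ ^ 2 * e₀ ^ 2 / c' + |C 0| * c₀ + 108 * e₀ ^ 2 / c' ^ 2 +
    128 * |C 2| * c₀ ^ 2 * e₀ ^ 2 with hCΔ
  set Δ := CΔ * (4 : ℝ) ^ (2 * h) with hΔ
  have h42h : (4 : ℝ) ^ (2 * h) = (4 : ℝ) ^ h * (4 : ℝ) ^ h := by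
    rw [two_mul, zpow_add₀ (by norm_num : (4 : ℝ) ≠ 0)]
  have hΔeq : Δ = R * La * R' + η + 3 * R' ^ 2 + M / 2 * R ^ 2 := by
    simp only [hΔ, hCΔ, hR, hLa, hR', hη, hM, h42h]
    field_simp
    ring
  have hηΔ : η ≤ Δ := by
    rw [hΔeq]
    have : 0 ≤ R * La * R' := by positivity
    have : 0 ≤ 3 * R' ^ 2 := by positivity
    have : 0 ≤ M / 2 * R ^ 2 := by positivity
    linarith
  have hΔle : Δ ≤ e₀ * (4 : ℝ) ^ (h - 2) / 2 := ht5
  -- (2.41a): `ε_h` is a `C²`-small perturbation of the free band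
  obtain ⟨hε2, h0', h1', h2'⟩ := bgmEffDisp_perturbation hI hS hh₁ hh₀
  set ε := bgmEffDisp β E h with hεdef
  have hU2 : U ^ 2 ≤ c₀ ^ 2 := by rw [← sq_abs]; exact pow_le_pow_left₀ (abs_nonneg U) hU 2
  have hUh2 : (U * h) ^ 2 ≤ c₀ ^ 2 := by
    have := abs_U_mul_le hh₁ hh₀ hUh
    rw [← sq_abs, abs_mul]; exact pow_le_pow_left₀ (by positivity) this 2
  have h0 : ∀ k, |ε k - sqDispersion k| ≤ δ₀ := fun k =>
    (h0' k).trans (by rw [hδ₀]; gcongr)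
  have h1 : ∀ k v, |fderiv ℝ ε k v - fderiv ℝ sqDispersion k v| ≤ δ₁ * (|v 0| + |v 1|) := fun k v =>
    (h1' k v).trans (by rw [hδ₁']; gcongr)
  have h2 : ∀ k v w, |fderiv ℝ (fderiv ℝ ε) k v w - fderiv ℝ (fderiv ℝ sqDispersion) k v w| ≤
      δ₂ * (|v 0| + |v 1|) * (|w 0| + |w 1|) := fun k v w =>
    (h2' k v w).trans (by rw [hδ₂']; gcongr)
  -- the scale-`h` Fermi radius `u = u_h(θ, 0)` and the radial slope `λ`
  have hcδ : 2 * δ₁ < 4 / π * c' := by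
    have : c' < 4 / π * c' := by
      rw [lt_mul_iff_one_lt_left hc'pos, lt_div_iff₀ Real.pi_pos]; linarith
    linarith
  have hlev : μ ∈ Ioo (c' ^ 2 + δ₀ - 4) (-2 - Real.sqrt 2 - δ₀) := by
    rw [hc'sq]; constructor <;> linarith
  obtain ⟨hroot, hcu, huK, hK⟩ := levelRadius_bounds hε2 h0 hδ₁0 hcδ hlev θ
  set u := levelRadius ε μ θ with hudef
  have hu4 : u < π / 4 := lt_of_le_of_lt huK hK
  have hu2 : u ≤ π / 2 := hroot.1.2
  set lam := fderiv ℝ ε (u • dir θ) (dir θ) with hlamdef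
  have hlam : c' / 2 ≤ lam := by
    have h := fderiv_ray_dir_ge' h1 hδ₁0 hroot.1.1 hu2 θ
    have : 4 / π * c' ≤ 4 / π * u := mul_le_mul_of_nonneg_left hcu (by positivity)
    have : c' ≤ 4 / π * c' := by
      rw [le_mul_iff_one_le_left hc'pos, le_div_iff₀ Real.pi_pos]; linarith
    linarith
  have hlampos : 0 < lam := lt_of_lt_of_le (by positivity) hlam
  set a₀ := -(β / π) * (E (h - 1) (π / β, u • dir θ)).im with ha₀
  -- geometric thresholds
  have huR : R' < u := lt_of_lt_of_le ht2 hcu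
  have hurB : u + R' < rB := by rw [hrB]; linarith
  have hlamR : e₀ * (4 : ℝ) ^ h ≤ lam * R' := by
    calc e₀ * (4 : ℝ) ^ h ≤ 3 * e₀ * (4 : ℝ) ^ h := by linarith
      _ = c' / 2 * R' := by rw [hR']; field_simp; ring
      _ ≤ lam * R' := mul_le_mul_of_nonneg_right hlam hR'0
  -- the per-frequency packages
  have hpkg : ∀ j ∈ S,
      (∀ ρ : ℝ, ‖bgmDenom μ E h (fermiMatsubara β j, ρ • dir θ) - bgmDenom μ E (h - 1) (fermiMatsubara β j, ρ • dir θ)‖ ≤ η) ∧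
      (∀ ρ ∈ Ioo (0 : ℝ) rB, bgmShell e₀ μ E h (fermiMatsubara β j, ρ • dir θ) ≠ 0 →
        e₀ * (4 : ℝ) ^ (h - 2) < ‖bgmDenom μ E (h - 1) (fermiMatsubara β j, ρ • dir θ)‖ ∧ |ρ - u| ≤ R') ∧
      (∀ ρ : ℝ, |ρ - u| ≤ R' → ‖bgmDenom μ E (h - 1) (fermiMatsubara β j, ρ • dir θ) -
        (-(Complex.I * (fermiMatsubara β j : ℂ)) * (1 + (a₀ : ℂ)) + ((lam * (ρ - u) : ℝ) : ℂ))‖ ≤ Δ) := by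
    intro j hj
    have hk₀ := fermiMatsubara_mem β j
    have hjR := hSR j hj
    refine ⟨fun ρ => ?_, fun ρ hρ hf => ?_, fun ρ hρu => ?_⟩
    · rw [bgmDenom_sub_bgmDenom]; exact norm_E_sub_E_le hS hh₁ hh₀ hUh hk₀ _
    · obtain ⟨hlv, hlo, -⟩ := level_of_bgmShell_ne_zero hI hSy hS he hβpos hh₁ hh₀ hU hUh hK₀ hK₂ hjR hf
      refine ⟨hlo, ?_⟩
      have hloc := ray_localisation (w := 3 * e₀ * (4 : ℝ) ^ h) hε2 h0 h1 hδ₁0 hc'pos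
        (by rw [hc'sq]; linarith) (by linarith) hμ₁ hρ hlv hroot hcu
      have hslope : c' / 2 ≤ 4 / π * c' - 2 * δ₁ := by
        have : c' ≤ 4 / π * c' := by
          rw [le_mul_iff_one_le_left hc'pos, le_div_iff₀ Real.pi_pos]; linarith
        linarith
      have : c' / 2 * |ρ - u| ≤ 3 * e₀ * (4 : ℝ) ^ h :=
        le_trans (mul_le_mul_of_nonneg_right hslope (abs_nonneg _)) hloc
      rw [hR', le_div_iff₀ hc'pos]
      linarith
    · -- the linearisation error of the scale-`h-1` denominator
      have hdec := bgmDenom_decomp μ β E (h - 1) (fermiMatsubara β j) (ρ • dir θ)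
      set r := E (h - 1) (fermiMatsubara β j, ρ • dir θ) - ((E (h - 1) (π / β, ρ • dir θ)).re : ℂ) +
        Complex.I * (fermiMatsubara β j : ℂ) * ((-(β / π) * (E (h - 1) (π / β, ρ • dir θ)).im : ℝ) : ℂ) with hr
      set aq := -(β / π) * (E (h - 1) (π / β, ρ • dir θ)).im with haq
      set ε' := (E (h - 1) (π / β, ρ • dir θ)).re with hε'
      have e : bgmDenom μ E (h - 1) (fermiMatsubara β j, ρ • dir θ) -
          (-(Complex.I * (fermiMatsubara β j : ℂ)) * (1 + (a₀ : ℂ)) + ((lam * (ρ - u) : ℝ) : ℂ)) =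
          -(Complex.I * (fermiMatsubara β j : ℂ)) * ((aq - a₀ : ℝ) : ℂ) +
            (((ε' - ε (ρ • dir θ) : ℝ) : ℂ) + ((ε (ρ • dir θ) - ε (u • dir θ) - lam * (ρ - u) : ℝ) : ℂ)) + r := by
        rw [hdec, hroot.2]; push_cast; ring
      rw [e]
      -- the four error terms
      have hMb : ∀ j' : ℤ, ‖bgmTimeDiffIter β 2 (E (h - 1)) (fermiMatsubara β j', ρ • dir θ)‖ ≤ M := fun j' => by
        have h1 := norm_bgmTimeDiffIter_two_le hI hS (h' := h - 1) (by omega) (by omega) (fermiMatsubara_mem β j') (ρ • dir θ)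
        have h2 := U_sq_mul_sq_le hh₁ hh₀ hU hUh
        calc _ ≤ |C 2| * U ^ 2 * (((h - 1 : ℤ) : ℝ)) ^ 2 := h1
          _ = |C 2| * (U ^ 2 * (((h - 1 : ℤ) : ℝ)) ^ 2) := by ring
          _ ≤ |C 2| * (4 * c₀ ^ 2) := mul_le_mul_of_nonneg_left h2 (abs_nonneg _)
          _ = M := by rw [hM]; ring
      have hrb : ‖r‖ ≤ M / 2 * R ^ 2 := by
        have h1 := norm_remainder_le hSy hβpos hMb j
        have hk2 : fermiMatsubara β j ^ 2 ≤ R ^ 2 := by rw [← sq_abs]; exact pow_le_pow_left₀ (abs_nonneg _) hjR 2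
        calc ‖r‖ ≤ M / 2 * fermiMatsubara β j ^ 2 := h1
          _ ≤ M / 2 * R ^ 2 := by gcongr
      have hab : |aq - a₀| ≤ La * R' := by
        have := abs_a_ray_sub_le hI hSy hS hh₁ hh₀ hU hUh θ ρ u
        rw [← haq, ← ha₀] at this
        calc |aq - a₀| ≤ 8 * |C 2| * c₀ ^ 2 * |ρ - u| := this
          _ ≤ La * R' := by rw [hLa]; gcongr
      have hT1 : ‖-(Complex.I * (fermiMatsubara β j : ℂ)) * ((aq - a₀ : ℝ) : ℂ)‖ ≤ R * (La * R') := by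
        rw [norm_mul, norm_neg, norm_mul, Complex.norm_I, one_mul, Complex.norm_real, Complex.norm_real,
          Real.norm_eq_abs, Real.norm_eq_abs]
        exact mul_le_mul hjR hab (abs_nonneg _) (by positivity)
      have hT2 : |ε' - ε (ρ • dir θ)| ≤ η := by
        rw [abs_sub_comm, hεdef, bgmEffDisp_eq_re hSy, ← Complex.sub_re]
        refine (Complex.abs_re_le_norm _).trans ?_
        exact norm_E_sub_E_le hS hh₁ hh₀ hUh ⟨0, by simp [fermiMatsubara]⟩ (ρ • dir θ)
      have hT3 : |ε (ρ • dir θ) - ε (u • dir θ) - lam * (ρ - u)| ≤ 3 * R' ^ 2 := by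
        have h := abs_ray_linearisation_le hε2 h2 hδ₂0 θ ρ u
        have hB : 2 + 4 * δ₂ ≤ 3 := by rw [hδ₂']; linarith
        have hsq : (ρ - u) ^ 2 ≤ R' ^ 2 := by rw [← sq_abs]; exact pow_le_pow_left₀ (abs_nonneg _) hρu 2
        calc _ ≤ (2 + 4 * δ₂) * (ρ - u) ^ 2 := h
          _ ≤ 3 * R' ^ 2 := mul_le_mul hB hsq (sq_nonneg _) (by norm_num)
      calc _ ≤ ‖-(Complex.I * (fermiMatsubara β j : ℂ)) * ((aq - a₀ : ℝ) : ℂ) +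
            (((ε' - ε (ρ • dir θ) : ℝ) : ℂ) + ((ε (ρ • dir θ) - ε (u • dir θ) - lam * (ρ - u) : ℝ) : ℂ))‖ + ‖r‖ := norm_add_le _ _
        _ ≤ (‖-(Complex.I * (fermiMatsubara β j : ℂ)) * ((aq - a₀ : ℝ) : ℂ)‖ +
            (‖((ε' - ε (ρ • dir θ) : ℝ) : ℂ)‖ + ‖((ε (ρ • dir θ) - ε (u • dir θ) - lam * (ρ - u) : ℝ) : ℂ)‖)) + ‖r‖ := by
            gcongr
            exact (norm_add_le _ _).trans (add_le_add le_rfl (norm_add_le _ _))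
        _ ≤ (R * (La * R') + (η + 3 * R' ^ 2)) + M / 2 * R ^ 2 := by
            gcongr
            · rw [Complex.norm_real, Real.norm_eq_abs]; exact hT2
            · rw [Complex.norm_real, Real.norm_eq_abs]; exact hT3
        _ = Δ := by rw [hΔeq]; ring
  -- the models sum-integrate to zero, and each true integrand is within `C_θ` of its model
  have hmodel := model_sum_integral_eq_zero β e₀ u lam a₀ h hSsym
  set Cθ := 32 * R' * (4 : ℝ) ^ (-h) / e₀ + (192 * rB * L / e₀ + 1024 * rB / e₀ ^ 2) * Δ * (4 : ℝ) ^ (-2 * h)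
    with hCθ
  have hCθeq : Cθ = 192 / c' + (192 * (3 * π / 4) * L / e₀ + 1024 * (3 * π / 4) / e₀ ^ 2) * CΔ := by
    have h42 : (0 : ℝ) < (4 : ℝ) ^ (2 * h) := zpow_pos (by norm_num) _
    rw [hCθ, hΔ, hR', hrB, show (-2 * h) = -(2 * h) by ring, zpow_neg, zpow_neg]
    field_simp
    ring
  have key := norm_sum_integral_le_of_model (S := S) (u := u) (R' := R') (Cpt := Cθ)
    (A := fun j ρ => (Ioo 0 rB).indicator (fun ρ => (ρ : ℂ) *
      ((bgmShell e₀ μ E h (fermiMatsubara β j, ρ • dir θ) : ℝ) : ℂ) /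
        bgmDenom μ E (h - 1) (fermiMatsubara β j, ρ • dir θ)) ρ)
    (B := fun j ρ => (u : ℂ) *
      ((gnShell 4 e₀ h ‖-(Complex.I * (fermiMatsubara β j : ℂ)) * (1 + (a₀ : ℂ)) + ((lam * (ρ - u) : ℝ) : ℂ)‖ : ℝ) : ℂ) /
        (-(Complex.I * (fermiMatsubara β j : ℂ)) * (1 + (a₀ : ℂ)) + ((lam * (ρ - u) : ℝ) : ℂ)))
    (fun j hj => by
      obtain ⟨-, hsupp, -⟩ := hpkg j hj
      exact integrable_indicator_ray he (continuous_bgmDenom_ray hS μ h _ θ)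
        (continuous_bgmDenom_ray hS μ (h - 1) _ θ) (fun ρ hρ hf => (hsupp ρ hρ hf).1))
    (fun j _ => integrable_model_ray he hlampos)
    (fun j hj ρ => by
      obtain ⟨hη', hsupp, hD1⟩ := hpkg j hj
      exact norm_sub_model_le he hL hL0 hη' hηΔ hΔle hsupp hD1 hlampos hlamR hR'0 huR hurB ρ)
    hmodel hR'0
  -- rewrite the set integrals as integrals of the indicators
  have hind : ∀ j : ℤ, (∫ ρ in Ioo 0 rB, (ρ : ℂ) *
      ((bgmShell e₀ μ E h (fermiMatsubara β j, ρ • dir θ) : ℝ) : ℂ) /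
        bgmDenom μ E (h - 1) (fermiMatsubara β j, ρ • dir θ)) =
      ∫ ρ, (Ioo 0 rB).indicator (fun ρ => (ρ : ℂ) *
        ((bgmShell e₀ μ E h (fermiMatsubara β j, ρ • dir θ) : ℝ) : ℂ) /
          bgmDenom μ E (h - 1) (fermiMatsubara β j, ρ • dir θ)) ρ := fun j => by
    rw [integral_indicator measurableSet_Ioo]
  rw [Finset.sum_congr rfl fun j _ => hind j]
  rw [hCθeq] at key
  exact key

end PerAngleBGM


/-! ### §6d The sector propagator at `x = 0`: translation, polar coordinates, Fubini, assembly -/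

section Assembly

variable {μ e₀ β U c₀ : ℝ} {C : ℕ → ℝ} {hβ : ℤ} {E : ℤ → ℝ × (Fin 2 → ℝ) → ℂ} {h : ℤ}

/-- **WLOG `|U| ≤ c₀`, `|U||h_β| ≤ c₀`**: the statements carry `|U| ≤ U₀`, `|h_β|U₀ ≤ c₀`; for `h_β ≤ -1`
this gives both, and for `h_β = 0` the hypothesis (2.36) does not involve `U` at all (its bounds carry
the factor `|h| = 0`), so `U` may be replaced by `0`. [cite: BenfattoGiulianiMastropietro2006, §2.3 (2.36) p0008:L46] -/
theorem bgmSmoothness_wlog {U₀ : ℝ} (hS : BGMSmoothness β U C hβ E) (hhβ : hβ ≤ 0) (hU : |U| ≤ U₀)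
    (hc : |(hβ : ℝ)| * U₀ ≤ c₀) (hc₀ : 0 ≤ c₀) :
    ∃ U' : ℝ, BGMSmoothness β U' C hβ E ∧ |U'| ≤ c₀ ∧ |U'| * |(hβ : ℝ)| ≤ c₀ := by
  rcases eq_or_lt_of_le hhβ with h0 | hneg
  · subst h0
    refine ⟨0, ⟨hS.1, hS.2.1, fun h hh1 hh0 => ?_⟩, by simp [hc₀], by simp [hc₀]⟩
    have h00 : h = 0 := le_antisymm hh0 hh1
    subst h00
    obtain ⟨hA, hB⟩ := hS.2.2 0 le_rfl le_rfl
    refine ⟨fun k₀ hk₀ k => ?_, fun a b hab i k₀ hk₀ k => ?_⟩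
    · calc _ ≤ C 0 * |U| * |((0 : ℤ) : ℝ)| * (4 : ℝ) ^ (2 * (0 : ℤ)) := hA k₀ hk₀ k
        _ = C 0 * |(0 : ℝ)| * |((0 : ℤ) : ℝ)| * (4 : ℝ) ^ (2 * (0 : ℤ)) := by simp
    · calc _ ≤ C (a + b) * |U| ^ 2 * |((0 : ℤ) : ℝ)| * (4 : ℝ) ^ ((2 - ((a + b : ℕ) : ℤ)) * (0 : ℤ)) :=
          hB a b hab i k₀ hk₀ k
        _ = C (a + b) * |(0 : ℝ)| ^ 2 * |((0 : ℤ) : ℝ)| * (4 : ℝ) ^ ((2 - ((a + b : ℕ) : ℤ)) * (0 : ℤ)) := by simp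
  · refine ⟨U, hS, ?_, ?_⟩
    · have h1 : (1 : ℝ) ≤ |(hβ : ℝ)| := by
        rw [abs_of_neg (by exact_mod_cast hneg)]
        have : (hβ : ℝ) ≤ -1 := by exact_mod_cast (show hβ ≤ -1 by omega)
        linarith
      have hU0 : 0 ≤ U₀ := (abs_nonneg U).trans hU
      calc |U| ≤ U₀ := hU
        _ = 1 * U₀ := (one_mul _).symm
        _ ≤ |(hβ : ℝ)| * U₀ := mul_le_mul_of_nonneg_right h1 hU0
        _ ≤ c₀ := hc
    · calc |U| * |(hβ : ℝ)| ≤ U₀ * |(hβ : ℝ)| := mul_le_mul_of_nonneg_right hU (abs_nonneg _)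
        _ = |(hβ : ℝ)| * U₀ := mul_comm _ _
        _ ≤ c₀ := hc

/-- `f_h` is `2πℤ²`-periodic in `k⃗` (so is `E_h`, (2.36) footnote ¹). [cite: BenfattoGiulianiMastropietro2006, §2.3 (2.36) footnote 1 p0008:L52] -/
theorem bgmShell_periodic (hS : BGMSmoothness β U C hβ E) (e₀ μ : ℝ) (h' : ℤ) (k₀ : ℝ) (q : Fin 2 → ℝ)
    (z : Fin 2 → ℤ) :
    bgmShell e₀ μ E h' (k₀, q + fun i => 2 * π * (z i : ℝ)) = bgmShell e₀ μ E h' (k₀, q) := by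
  have hp := hS.2.1
  simp only [bgmShell, bgmCutoffInv, bgmDenom, hp]

/-- The Euclidean ball of radius `r` in the plane. [folklore] -/
private theorem abs_apply_lt_of_mem_ball {r : ℝ} (hr : 0 ≤ r) {q : Fin 2 → ℝ} (hq : q 0 ^ 2 + q 1 ^ 2 < r ^ 2)
    (i : Fin 2) : |q i| < r := by
  have h0 : q 0 ^ 2 < r ^ 2 := by nlinarith [sq_nonneg (q 1)]
  have h1 : q 1 ^ 2 < r ^ 2 := by nlinarith [sq_nonneg (q 0)]
  fin_cases i
  · exact abs_lt_of_sq_lt_sq h0 hr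
  · exact abs_lt_of_sq_lt_sq h1 hr

/-- **The support of the shifted integrand lies in the disc `|k⃗| < π/4`, inside one period cell**:
if `q⃗ - p⃗_F ∈ [-π,π]²` and `f_h(k₀, q⃗) ≠ 0` (with `|k₀| ≤ 8e₀γ^h`, below the threshold), then
`|q⃗|² < (3π/4)²` (indeed `< (π/4)²`; BGM's "`8 arccos(1 - μ - e₀) < 2π`" footnote).
[cite: BenfattoGiulianiMastropietro2006, §2.4 (2.39)–(2.40a) p0009:L14–L20] -/
theorem mem_ball_of_bgmShell_ne_zero (hI : BGMInitial E) (hSy : BGMSymmetry E) (hS : BGMSmoothness β U C hβ E)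
    (he : 0 < e₀) (hβpos : 0 < β) (hh₁ : hβ ≤ h) (hh₀ : h ≤ 0) (hU : |U| ≤ c₀) (hUh : |U| * |(hβ : ℝ)| ≤ c₀)
    (hμ₂ : μ < -2 - Real.sqrt 2)
    (hK₀ : |C 0| * c₀ ≤ 3 / 16 * e₀) (hK₂ : 4 * |C 2| * c₀ ^ 2 * (64 * e₀) ≤ 1)
    (hδ₀b : 2 * |C 0| * c₀ ≤ (-2 - Real.sqrt 2 - μ) / 4) (ht1b : 3 * e₀ * (4 : ℝ) ^ h ≤ (-2 - Real.sqrt 2 - μ) / 4)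
    {p : Fin 2 → ℝ} (hp : ∀ i, |p i| < π / 4)
    {j : ℤ} (hj : |fermiMatsubara β j| ≤ 8 * e₀ * (4 : ℝ) ^ h) {q : Fin 2 → ℝ}
    (hqp : q - p ∈ zoneSq) (hf : bgmShell e₀ μ E h (fermiMatsubara β j, q) ≠ 0) :
    q 0 ^ 2 + q 1 ^ 2 < (π / 4) ^ 2 := by
  obtain ⟨hε2, h0', -, -⟩ := bgmEffDisp_perturbation hI hS hh₁ hh₀
  have hc₀ : 0 ≤ c₀ := (abs_nonneg U).trans hU
  have h0 : ∀ k, |bgmEffDisp β E h k - sqDispersion k| ≤ 2 * |C 0| * c₀ := fun k => (h0' k).trans (by gcongr)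
  -- reduce `q` into the period cell
  obtain ⟨z, hz⟩ := exists_sub_mem_zoneSq q
  set q' := q - fun i => 2 * π * (z i : ℝ) with hq'
  have hqq' : q = q' + fun i => 2 * π * (z i : ℝ) := by rw [hq']; abel
  have hf' : bgmShell e₀ μ E h (fermiMatsubara β j, q') ≠ 0 := by
    rwa [hqq', bgmShell_periodic hS] at hf
  obtain ⟨hlv, -, -⟩ := level_of_bgmShell_ne_zero hI hSy hS he hβpos hh₁ hh₀ hU hUh hK₀ hK₂ hj hf'
  -- the Euclidean radius of `q'`
  have hLv : sqDispersion q' ≤ μ + 3 * e₀ * (4 : ℝ) ^ h + 2 * |C 0| * c₀ := by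
    have := (abs_le.1 (h0 q')).1; have := (abs_le.1 hlv).2; linarith
  have hL2 : μ + 3 * e₀ * (4 : ℝ) ^ h + 2 * |C 0| * c₀ < -2 - Real.sqrt 2 := by linarith
  have hs2 : (0 : ℝ) < Real.sqrt 2 := Real.sqrt_pos.2 (by norm_num)
  have hqi : ∀ i, |q' i| ≤ π := fun i => abs_le.2 ⟨(hz i (Set.mem_univ i)).1, (hz i (Set.mem_univ i)).2⟩
  have h1 := sqrt_sq_add_sq_le_umklappRadius (by linarith) hqi hLv
  have hμ4 : -4 ≤ μ + 3 * e₀ * (4 : ℝ) ^ h + 2 * |C 0| * c₀ := by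
    have := (abs_le.1 (h0 q')).2
    have hfree : -4 ≤ sqDispersion q' := by
      simp only [sqDispersion]
      have := Real.cos_le_one (q' 0); have := Real.cos_le_one (q' 1); linarith
    have := (abs_le.1 hlv).1
    linarith
  have h2 := umklappRadius_lt_pi_div_four hμ4 hL2
  have hrad : q' 0 ^ 2 + q' 1 ^ 2 < (π / 4) ^ 2 := by
    have hsq : Real.sqrt (q' 0 ^ 2 + q' 1 ^ 2) < π / 4 := lt_of_le_of_lt h1 h2
    have h3 := Real.sqrt_lt' (show 0 < π / 4 by positivity) |>.1 hsq
    exact h3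
  -- hence `z = 0` and `q = q'`
  have hz0 : ∀ i, z i = 0 := by
    intro i
    have hq'i : |q' i| < π / 4 := abs_apply_lt_of_mem_ball (by positivity) hrad i
    have hqpi : |q i - p i| ≤ π := by
      have := hqp i (Set.mem_univ i); exact abs_le.2 ⟨this.1, this.2⟩
    have hpi := hp i
    have hzi : |2 * π * (z i : ℝ)| < 2 * π := by
      have e : 2 * π * (z i : ℝ) = (q i - p i) + p i - q' i := by
        have := congrFun hqq' i; simp only [Pi.add_apply] at this; linarith
      rw [e]
      calc |q i - p i + p i - q' i| ≤ |q i - p i + p i| + |q' i| := abs_sub _ _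
        _ ≤ |q i - p i| + |p i| + |q' i| := by linarith [abs_add_le (q i - p i) (p i)]
        _ < π + π / 4 + π / 4 := by linarith
        _ < 2 * π := by linarith [Real.pi_pos]
    rw [abs_mul, abs_of_pos Real.two_pi_pos] at hzi
    have : |(z i : ℝ)| < 1 := by
      by_contra hc; push Not at hc
      have := mul_le_mul_of_nonneg_left hc Real.two_pi_pos.le
      linarith
    exact Int.abs_lt_one_iff.mp (by exact_mod_cast this)
  have hqeq : q = q' := by
    rw [hqq']; ext i; simp [hz0 i]
  rw [hqeq]; exact hrad

/-- Continuity of the denominators along the polar chart `(ρ, θ) ↦ ρe⃗_r(θ)`. [folklore] -/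
private theorem continuous_bgmDenom_polar (hS : BGMSmoothness β U C hβ E) (μ : ℝ) (h' : ℤ) (k₀ : ℝ) :
    Continuous fun p : ℝ × ℝ => bgmDenom μ E h' (k₀, p.1 • dir p.2) := by
  have hc : Continuous fun k : Fin 2 → ℝ => E h' (k₀, k) := (hS.1 h' k₀ 0).continuous
  have hray : Continuous fun p : ℝ × ℝ => p.1 • dir p.2 := continuous_fst.smul (continuous_dir'.comp continuous_snd)
  simp only [bgmDenom]
  exact continuous_const.add ((hc.comp hray).sub continuous_const)

/-- The shifted sector integrand `F_{h,ω}/D_{h-1}` is bounded by `16γ^{-h}/e₀` (everywhere). [cite: BenfattoGiulianiMastropietro2006, §2.5 proof of Lemma 2.2 p0011:L5–L7] -/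
theorem norm_sectorIntegrand_le (hS : BGMSmoothness β U C hβ E) (he : 0 < e₀) (hh₁ : hβ ≤ h) (hh₀ : h ≤ 0)
    (hU : |U| ≤ c₀) (hUh : |U| * |(hβ : ℝ)| ≤ c₀) (hK₀ : |C 0| * c₀ ≤ 3 / 16 * e₀) (m : ℕ) (ω : ℤ) (j : ℤ)
    (q : Fin 2 → ℝ) :
    ‖((bgmSectorFn e₀ μ E h m ω (fermiMatsubara β j, q) : ℝ) : ℂ) /
        bgmDenom μ E (h - 1) (fermiMatsubara β j, q)‖ ≤ 16 * (4 : ℝ) ^ (-h) / e₀ := by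
  have hc₀ : 0 ≤ c₀ := (abs_nonneg U).trans hU
  by_cases hf : bgmShell e₀ μ E h (fermiMatsubara β j, q) = 0
  · simp [bgmSectorFn, hf]; positivity
  · have hη : ‖E h (fermiMatsubara β j, q) - E (h - 1) (fermiMatsubara β j, q)‖ ≤ 3 / 16 * e₀ * (4 : ℝ) ^ h := by
      have h1 := norm_E_sub_E_le hS hh₁ hh₀ hUh (fermiMatsubara_mem β j) q
      have : (4 : ℝ) ^ (2 * h) ≤ (4 : ℝ) ^ h := zpow_le_zpow_right₀ (by norm_num) (by omega)
      calc _ ≤ |C 0| * c₀ * (4 : ℝ) ^ (2 * h) := h1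
        _ ≤ |C 0| * c₀ * (4 : ℝ) ^ h := by gcongr
        _ ≤ 3 / 16 * e₀ * (4 : ℝ) ^ h := by gcongr
    have hinv := norm_inv_bgmDenom_le_of_bgmShell_ne_zero he hη hf
    have hF : |bgmSectorFn e₀ μ E h m ω (fermiMatsubara β j, q)| ≤ 1 := by
      rw [bgmSectorFn, abs_mul]
      have h1 : |bgmShell e₀ μ E h (fermiMatsubara β j, q)| ≤ 1 := by
        have a := gnScaleCutoff_mem_Icc 4 e₀ h ‖bgmDenom μ E h (fermiMatsubara β j, q)‖
        have b := gnScaleCutoff_mem_Icc 4 e₀ (h - 1) ‖bgmDenom μ E (h - 1) (fermiMatsubara β j, q)‖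
        simp only [bgmShell, bgmCutoffInv, abs_le]; constructor <;> linarith [a.1, a.2, b.1, b.2]
      have h2 : |sectorWeightCirc m ω (polarAngle q)| ≤ 1 := by
        rw [abs_of_nonneg (sectorWeightCirc_nonneg _ _ _)]; exact sectorWeightCirc_le_one _ _ _
      calc _ ≤ 1 * 1 := mul_le_mul h1 h2 (abs_nonneg _) zero_le_one
        _ = 1 := one_mul _
    rw [div_eq_mul_inv, norm_mul, Complex.norm_real, Real.norm_eq_abs]
    calc _ ≤ 1 * (16 * (4 : ℝ) ^ (-h) / e₀) := mul_le_mul hF hinv (norm_nonneg _) zero_le_one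
      _ = _ := one_mul _

/-- **(2.49) at `x = 0`, unfolded**: `g(0) = (1/β)Σ'_{k₀} ∫_{[-π,π]²} F_{h,ω}(k₀,k⃗'+p⃗_F)/D_{h-1}(k₀,k⃗'+p⃗_F) dk⃗'/(2π)²`. [cite: BenfattoGiulianiMastropietro2006, §2.5 (2.49) p0010:L72] -/
theorem bgmGenProp_zero_eq (β e₀ μ : ℝ) (E : ℤ → ℝ × (Fin 2 → ℝ) → ℂ) (h : ℤ) (m ω : ℕ) :
    bgmGenProp β e₀ μ E h m ω 0 0 = ((1 / β : ℝ) : ℂ) *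
      ∑' j : ℤ, (∫ k in zoneSq,
        ((bgmSectorFn e₀ μ E h m ω
            (fermiMatsubara β j, k + levelRadius (bgmEffDisp β E h) μ (sectorCenter m ω) • dir (sectorCenter m ω)) : ℝ) : ℂ) /
          bgmDenom μ E (h - 1)
            (fermiMatsubara β j, k + levelRadius (bgmEffDisp β E h) μ (sectorCenter m ω) • dir (sectorCenter m ω))) /
        (((2 * π) ^ 2 : ℝ) : ℂ) := by
  unfold bgmGenProp
  congr 1
  refine tsum_congr fun j => ?_
  rw [← integral_div]
  refine setIntegral_congr_fun (by unfold zoneSq; exact MeasurableSet.univ_pi fun _ => measurableSet_Icc) fun k _ => ?_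
  simp [dot2]

/-- The volume of the period cell `[-π,π]²` is `(2π)²`. [folklore] -/
private theorem volume_zoneSq : volume zoneSq = ENNReal.ofReal ((2 * π) ^ 2) := by
  unfold zoneSq
  rw [volume_pi_pi]
  simp only [Real.volume_Icc, Finset.prod_const, Finset.card_univ, Fintype.card_fin]
  rw [← ENNReal.ofReal_pow (by linarith [Real.pi_pos])]
  congr 1; ring

/-- **A symmetric finite Matsubara box** containing every frequency with `|k₀| ≤ R` and stable under
the reflection `k₀ ↦ -k₀` (`j ↦ -1-j`). [folklore] -/
private theorem exists_matsubara_box (hβ : 0 < β) (R : ℝ) :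
    ∃ S : Finset ℤ, (∀ j ∈ S, |fermiMatsubara β j| ≤ R) ∧ (∀ j, |fermiMatsubara β j| ≤ R → j ∈ S) ∧
      (∀ j ∈ S, -1 - j ∈ S) := by
  refine ⟨(Finset.Icc (-1 - (⌈R * β / (2 * π)⌉₊ : ℤ)) (⌈R * β / (2 * π)⌉₊ : ℤ)).filter
      fun j => |fermiMatsubara β j| ≤ R,
    fun j hj => (Finset.mem_filter.1 hj).2, fun j hj => ?_, fun j hj => ?_⟩
  · have := natAbs_le_of_abs_fermiMatsubara_le hβ hj
    rw [Finset.mem_Icc] at this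
    exact Finset.mem_filter.2 ⟨Finset.mem_Icc.2 ⟨by omega, by omega⟩, hj⟩
  · obtain ⟨hj1, hj2⟩ := Finset.mem_filter.1 hj
    rw [Finset.mem_Icc] at hj1
    refine Finset.mem_filter.2 ⟨Finset.mem_Icc.2 ⟨by omega, by omega⟩, ?_⟩
    rw [fermiMatsubara_reflect, abs_neg]; exact hj2

/-- The polar-coordinate integrand `ζ(θ)·ρ f_h(k₀, ρe⃗_r(θ))/D_{h-1}(k₀, ρe⃗_r(θ))` is integrable on
`(0,r)×(-π,π)` (continuous and bounded by `r·16γ^{-h}/e₀`). [cite: BenfattoGiulianiMastropietro2006, §2.5 (2.56b) p0011:L48–L52] -/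
theorem integrableOn_polarIntegrand (hS : BGMSmoothness β U C hβ E) (he : 0 < e₀) (hh₁ : hβ ≤ h) (hh₀ : h ≤ 0)
    (hU : |U| ≤ c₀) (hUh : |U| * |(hβ : ℝ)| ≤ c₀) (hK₀ : |C 0| * c₀ ≤ 3 / 16 * e₀) (m : ℕ) (ω : ℤ) (j : ℤ)
    {r : ℝ} (hr : 0 < r) :
    IntegrableOn (fun z : ℝ × ℝ => ((sectorWeightCirc m ω z.2 : ℝ) : ℂ) * ((z.1 : ℂ) *
        ((bgmShell e₀ μ E h (fermiMatsubara β j, z.1 • dir z.2) : ℝ) : ℂ) /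
          bgmDenom μ E (h - 1) (fermiMatsubara β j, z.1 • dir z.2)))
      (Ioo 0 r ×ˢ Ioo (-π) π) (volume.prod volume) := by
  refine integrableOn_prod_Ioo_of_bound ?_ (M := r * (16 * (4 : ℝ) ^ (-h) / e₀)) ?_
  · have hray : Continuous fun z : ℝ × ℝ => z.1 • dir z.2 := continuous_fst.smul (continuous_dir'.comp continuous_snd)
    have hDh := continuous_bgmDenom_polar hS μ h (fermiMatsubara β j)
    have hDh1 := continuous_bgmDenom_polar hS μ (h - 1) (fermiMatsubara β j)
    have hsh : Continuous fun z : ℝ × ℝ => bgmShell e₀ μ E h (fermiMatsubara β j, z.1 • dir z.2) := by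
      simp only [bgmShell, bgmCutoffInv]
      exact ((contDiff_gnScaleCutoff 4 e₀ h (m := 0)).continuous.comp hDh.norm).sub
        ((contDiff_gnScaleCutoff 4 e₀ (h - 1) (m := 0)).continuous.comp hDh1.norm)
    have hζ : Continuous fun z : ℝ × ℝ => sectorWeightCirc m ω z.2 :=
      (contDiff_sectorWeightCirc m ω (m := 0)).continuous.comp continuous_snd
    simp_rw [div_eq_mul_inv]
    exact (Complex.measurable_ofReal.comp hζ.measurable).mul
      (((Complex.measurable_ofReal.comp measurable_fst).mul (Complex.measurable_ofReal.comp hsh.measurable)).mul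
        hDh1.measurable.inv)
  · intro z hz
    have hz1 : 0 < z.1 := hz.1.1
    have hq := norm_sectorIntegrand_le (μ := μ) hS he hh₁ hh₀ hU hUh hK₀ m ω j (z.1 • dir z.2)
    have hζeq : sectorWeightCirc m ω (polarAngle (z.1 • dir z.2)) = sectorWeightCirc m ω z.2 := by
      rw [polarAngle_smul_dir hz1 ⟨hz.2.1, hz.2.2.le⟩]
    have e : ((sectorWeightCirc m ω z.2 : ℝ) : ℂ) * ((z.1 : ℂ) *
        ((bgmShell e₀ μ E h (fermiMatsubara β j, z.1 • dir z.2) : ℝ) : ℂ) /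
          bgmDenom μ E (h - 1) (fermiMatsubara β j, z.1 • dir z.2)) =
        ((z.1 : ℝ) : ℂ) * (((bgmSectorFn e₀ μ E h m ω (fermiMatsubara β j, z.1 • dir z.2) : ℝ) : ℂ) /
          bgmDenom μ E (h - 1) (fermiMatsubara β j, z.1 • dir z.2)) := by
      simp only [bgmSectorFn, hζeq]; push_cast; ring
    rw [e, norm_mul, Complex.norm_real, Real.norm_eq_abs, abs_of_pos hz1]
    exact mul_le_mul hz.1.2.le hq (norm_nonneg _) hr.le

/-- **(2.56b) for one Matsubara frequency**: after the shift `k⃗ = k⃗' + p⃗_F(θ_{h,ω})` the `k⃗'`-integral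
over the period cell is the integral over the disc `|k⃗| < 3π/4` (the integrand is supported in
`|k⃗| < π/4` and is `2π`-periodic), which in polar coordinates and with the angle outermost reads
`∫dθ ζ_{h,ω}(θ) ∫ρdρ f_h/D_{h-1}`. [cite: BenfattoGiulianiMastropietro2006, §2.5 (2.49), (2.56b) p0010:L72–p0011:L52] -/
theorem sectorTerm_eq_angular (hI : BGMInitial E) (hSy : BGMSymmetry E) (hS : BGMSmoothness β U C hβ E)
    (he : 0 < e₀) (hβpos : 0 < β) (hh₁ : hβ ≤ h) (hh₀ : h ≤ 0) (hU : |U| ≤ c₀) (hUh : |U| * |(hβ : ℝ)| ≤ c₀)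
    (hμ₂ : μ < -2 - Real.sqrt 2)
    (hK₀ : |C 0| * c₀ ≤ 3 / 16 * e₀) (hK₂ : 4 * |C 2| * c₀ ^ 2 * (64 * e₀) ≤ 1)
    (hδ₀b : 2 * |C 0| * c₀ ≤ (-2 - Real.sqrt 2 - μ) / 4) (ht1b : 3 * e₀ * (4 : ℝ) ^ h ≤ (-2 - Real.sqrt 2 - μ) / 4)
    {p : Fin 2 → ℝ} (hp : ∀ i, |p i| < π / 4) (m : ℕ) (ω : ℤ)
    {j : ℤ} (hj : |fermiMatsubara β j| ≤ 8 * e₀ * (4 : ℝ) ^ h) :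
    (∫ k in zoneSq, ((bgmSectorFn e₀ μ E h m ω (fermiMatsubara β j, k + p) : ℝ) : ℂ) /
        bgmDenom μ E (h - 1) (fermiMatsubara β j, k + p)) =
      ∫ θ in Ioo (-π) π, ((sectorWeightCirc m ω θ : ℝ) : ℂ) *
        ∫ ρ in Ioo 0 (3 * π / 4), (ρ : ℂ) * ((bgmShell e₀ μ E h (fermiMatsubara β j, ρ • dir θ) : ℝ) : ℂ) /
          bgmDenom μ E (h - 1) (fermiMatsubara β j, ρ • dir θ) := by
  have hrBpos : (0 : ℝ) < 3 * π / 4 := by positivity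
  set G : (Fin 2 → ℝ) → ℂ := fun q => ((bgmSectorFn e₀ μ E h m ω (fermiMatsubara β j, q) : ℝ) : ℂ) /
    bgmDenom μ E (h - 1) (fermiMatsubara β j, q) with hGdef
  set H : ℝ × ℝ → ℂ := fun z => ((sectorWeightCirc m ω z.2 : ℝ) : ℂ) * ((z.1 : ℂ) *
      ((bgmShell e₀ μ E h (fermiMatsubara β j, z.1 • dir z.2) : ℝ) : ℂ) /
        bgmDenom μ E (h - 1) (fermiMatsubara β j, z.1 • dir z.2)) with hH
  set B : Set (Fin 2 → ℝ) := {q | q 0 ^ 2 + q 1 ^ 2 < (3 * π / 4) ^ 2} with hB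
  -- translation and restriction to the disc
  have hstep1 : (∫ k in zoneSq, G (k + p)) = ∫ q, B.indicator G q := by
    refine setIntegral_zoneSq_comp_add_eq G p B (fun q hq hG => ?_) (fun q hq => ?_)
    · have hf : bgmShell e₀ μ E h (fermiMatsubara β j, q) ≠ 0 := by
        intro hf; apply hG; simp [hGdef, bgmSectorFn, hf]
      have hb := mem_ball_of_bgmShell_ne_zero hI hSy hS he hβpos hh₁ hh₀ hU hUh hμ₂ hK₀ hK₂ hδ₀b ht1b hp hj hq hf
      simp only [hB, Set.mem_setOf_eq]
      refine lt_trans hb ?_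
      nlinarith [Real.pi_pos]
    · simp only [hB, Set.mem_setOf_eq] at hq
      intro i _
      have hqi := abs_apply_lt_of_mem_ball hrBpos.le hq i
      have hpi := hp i
      simp only [Pi.sub_apply, Set.mem_Icc]
      constructor <;> linarith [(abs_lt.1 hqi).1, (abs_lt.1 hqi).2, (abs_lt.1 hpi).1, (abs_lt.1 hpi).2, Real.pi_pos]
  -- polar coordinates and the sector weight
  have hstep2 : ∫ q, B.indicator G q = ∫ z in Ioo 0 (3 * π / 4) ×ˢ Ioo (-π) π, H z := by
    rw [hB, integral_indicator_ball_eq_polar G hrBpos]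
    refine setIntegral_congr_fun (measurableSet_Ioo.prod measurableSet_Ioo) fun z hz => ?_
    have hz1 : 0 < z.1 := hz.1.1
    have hζeq : sectorWeightCirc m ω (polarAngle (z.1 • dir z.2)) = sectorWeightCirc m ω z.2 := by
      rw [polarAngle_smul_dir hz1 ⟨hz.2.1, hz.2.2.le⟩]
    simp only [hH, hGdef, bgmSectorFn, hζeq]; push_cast; ring
  -- Fubini, angle outermost, and the constant sector weight out of the radial integral
  have hHint : IntegrableOn H (Ioo 0 (3 * π / 4) ×ˢ Ioo (-π) π) (volume.prod volume) :=
    integrableOn_polarIntegrand (μ := μ) hS he hh₁ hh₀ hU hUh hK₀ m ω j hrBpos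
  have hstep4 : ∀ θ, (∫ ρ in Ioo 0 (3 * π / 4), H (ρ, θ)) = ((sectorWeightCirc m ω θ : ℝ) : ℂ) *
      ∫ ρ in Ioo 0 (3 * π / 4), (ρ : ℂ) * ((bgmShell e₀ μ E h (fermiMatsubara β j, ρ • dir θ) : ℝ) : ℂ) /
        bgmDenom μ E (h - 1) (fermiMatsubara β j, ρ • dir θ) := by
    intro θ
    rw [← integral_const_mul]
  calc (∫ k in zoneSq, G (k + p)) = ∫ q, B.indicator G q := hstep1
    _ = ∫ z in Ioo 0 (3 * π / 4) ×ˢ Ioo (-π) π, H z := hstep2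
    _ = ∫ θ in Ioo (-π) π, ∫ ρ in Ioo 0 (3 * π / 4), H (ρ, θ) := setIntegral_prod_symm' H hHint
    _ = _ := setIntegral_congr_fun measurableSet_Ioo fun θ _ => hstep4 θ

/-- Each shifted sector term is dimensionally bounded: `|∫_{[-π,π]²} F_{h,ω}/D_{h-1} dk⃗/(2π)²| ≤ 16γ^{-h}/e₀`. [cite: BenfattoGiulianiMastropietro2006, §2.5 proof of Lemma 2.2 p0011:L5–L7] -/
theorem norm_sectorTerm_div_le (hS : BGMSmoothness β U C hβ E) (he : 0 < e₀) (hh₁ : hβ ≤ h) (hh₀ : h ≤ 0)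
    (hU : |U| ≤ c₀) (hUh : |U| * |(hβ : ℝ)| ≤ c₀) (hK₀ : |C 0| * c₀ ≤ 3 / 16 * e₀) (m : ℕ) (ω : ℤ) (j : ℤ)
    (p : Fin 2 → ℝ) :
    ‖(∫ k in zoneSq, ((bgmSectorFn e₀ μ E h m ω (fermiMatsubara β j, k + p) : ℝ) : ℂ) /
        bgmDenom μ E (h - 1) (fermiMatsubara β j, k + p)) / (((2 * π) ^ 2 : ℝ) : ℂ)‖ ≤
      16 * (4 : ℝ) ^ (-h) / e₀ := by
  rw [norm_div, Complex.norm_real, Real.norm_eq_abs, abs_of_pos (by positivity), div_le_iff₀ (by positivity)]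
  have h1 := norm_setIntegral_le_of_norm_le_const (by rw [volume_zoneSq]; exact ENNReal.ofReal_lt_top)
    (fun k _ => norm_sectorIntegrand_le (μ := μ) hS he hh₁ hh₀ hU hUh hK₀ m ω j (k + p)) (μ := volume) (s := zoneSq)
  rw [Measure.real, volume_zoneSq, ENNReal.toReal_ofReal (by positivity)] at h1
  exact h1

/-- **(2.49) at `x = 0` is a finite Matsubara sum** over any set of frequencies containing the support
`|k₀| ≤ 8e₀γ^h` ((2.42a): the other terms vanish identically). [cite: BenfattoGiulianiMastropietro2006, §2.5 (2.42a), (2.49) p0009:L70, p0010:L72] -/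
theorem bgmGenProp_zero_eq_sum (hI : BGMInitial E) (hSy : BGMSymmetry E) (hS : BGMSmoothness β U C hβ E)
    (he : 0 < e₀) (hβpos : 0 < β) (hh₁ : hβ ≤ h) (hh₀ : h ≤ 0) (hU : |U| ≤ c₀) (hUh : |U| * |(hβ : ℝ)| ≤ c₀)
    (hK₀ : |C 0| * c₀ ≤ 3 / 16 * e₀) (hK₁ : 2 * |C 1| * c₀ ^ 2 ≤ 1 / 2)
    (hK₂' : 2 * (4 * |C 2| * c₀ ^ 2) * (2 * |C 0| * c₀ + 2 * e₀) ≤ 1) (m ω : ℕ) {S : Finset ℤ}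
    (hmem : ∀ j, |fermiMatsubara β j| ≤ 8 * e₀ * (4 : ℝ) ^ h → j ∈ S) :
    bgmGenProp β e₀ μ E h m ω 0 0 = ((1 / β : ℝ) : ℂ) * ∑ j ∈ S, (∫ k in zoneSq,
        ((bgmSectorFn e₀ μ E h m ω
            (fermiMatsubara β j, k + levelRadius (bgmEffDisp β E h) μ (sectorCenter m ω) • dir (sectorCenter m ω)) : ℝ) : ℂ) /
          bgmDenom μ E (h - 1)
            (fermiMatsubara β j, k + levelRadius (bgmEffDisp β E h) μ (sectorCenter m ω) • dir (sectorCenter m ω))) /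
        (((2 * π) ^ 2 : ℝ) : ℂ) := by
  rw [bgmGenProp_zero_eq, tsum_eq_sum (s := S)]
  intro j hj
  have hf : ∀ q, bgmShell e₀ μ E h (fermiMatsubara β j, q) = 0 := fun q => by
    by_contra hf
    exact hj (hmem j (abs_k0_lt_of_bgmShell_ne_zero hI hSy hS he hβpos hh₁ hh₀ hU hUh hK₀ hK₁ hK₂' hf).le)
  simp [bgmSectorFn, hf]

/-- **The dimensional bound, all scales**: `|g(0)| ≤ (1/β)·#{k₀ : |k₀| ≤ 8e₀γ^h}·16γ^{-h}/e₀ ≤ 512/π`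
(the frequency count `(1/β)# ≤ 4R/π` is uniform in `β`). [cite: BenfattoGiulianiMastropietro2006, §2.5 (2.53) with N = 0 p0011:L5–L10] -/
theorem norm_bgmGenProp_zero_le_crude (hI : BGMInitial E) (hSy : BGMSymmetry E) (hS : BGMSmoothness β U C hβ E)
    (he : 0 < e₀) (hβpos : 0 < β) (hh₁ : hβ ≤ h) (hh₀ : h ≤ 0) (hU : |U| ≤ c₀) (hUh : |U| * |(hβ : ℝ)| ≤ c₀)
    (hK₀ : |C 0| * c₀ ≤ 3 / 16 * e₀) (hK₁ : 2 * |C 1| * c₀ ^ 2 ≤ 1 / 2)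
    (hK₂' : 2 * (4 * |C 2| * c₀ ^ 2) * (2 * |C 0| * c₀ + 2 * e₀) ≤ 1) (m ω : ℕ) :
    ‖bgmGenProp β e₀ μ E h m ω 0 0‖ ≤ 512 / π := by
  have h4 : (0 : ℝ) < (4 : ℝ) ^ h := zpow_pos (by norm_num) _
  obtain ⟨S, hSR, hmem, -⟩ := exists_matsubara_box hβpos (8 * e₀ * (4 : ℝ) ^ h)
  rw [bgmGenProp_zero_eq_sum hI hSy hS he hβpos hh₁ hh₀ hU hUh hK₀ hK₁ hK₂' m ω hmem, norm_mul, Complex.norm_real,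
    Real.norm_eq_abs, abs_of_pos (by positivity : (0 : ℝ) < 1 / β)]
  have hβS := inv_beta_mul_card_le hβpos (by positivity) S hSR
  refine (mul_le_mul_of_nonneg_left (norm_sum_le _ _) (by positivity)).trans ?_
  refine (mul_le_mul_of_nonneg_left (Finset.sum_le_sum fun j _ =>
    norm_sectorTerm_div_le hS he hh₁ hh₀ hU hUh hK₀ m ω j _) (by positivity)).trans ?_
  rw [Finset.sum_const, nsmul_eq_mul]
  calc 1 / β * (S.card * (16 * (4 : ℝ) ^ (-h) / e₀)) = (1 / β * S.card) * (16 * (4 : ℝ) ^ (-h) / e₀) := by ring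
    _ ≤ (4 * (8 * e₀ * (4 : ℝ) ^ h) / π) * (16 * (4 : ℝ) ^ (-h) / e₀) :=
        mul_le_mul_of_nonneg_right hβS (by positivity)
    _ = 512 / π := by rw [zpow_neg]; field_simp; norm_num

/-- **The angular integral of the per-ray estimate**: if at every angle the Matsubara sum of the radial
integrals is `≤ #S·Θ`, then `|Σ_{k₀∈S} ∫ F_{h,ω}/D_{h-1}| ≤ #S·Θ·∫ζ_{h,ω} ≤ #S·Θ·(3/2)·(π/2^m)`.
[cite: BenfattoGiulianiMastropietro2006, §2.5 (2.56b), (2.57) p0011:L48–L100] -/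
theorem norm_sum_sectorTerm_le (hI : BGMInitial E) (hSy : BGMSymmetry E) (hS : BGMSmoothness β U C hβ E)
    (he : 0 < e₀) (hβpos : 0 < β) (hh₁ : hβ ≤ h) (hh₀ : h ≤ 0) (hU : |U| ≤ c₀) (hUh : |U| * |(hβ : ℝ)| ≤ c₀)
    (hμ₂ : μ < -2 - Real.sqrt 2)
    (hK₀ : |C 0| * c₀ ≤ 3 / 16 * e₀) (hK₂ : 4 * |C 2| * c₀ ^ 2 * (64 * e₀) ≤ 1)
    (hδ₀b : 2 * |C 0| * c₀ ≤ (-2 - Real.sqrt 2 - μ) / 4) (ht1b : 3 * e₀ * (4 : ℝ) ^ h ≤ (-2 - Real.sqrt 2 - μ) / 4)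
    {p : Fin 2 → ℝ} (hp : ∀ i, |p i| < π / 4) (m : ℕ) (ω : ℤ) {S : Finset ℤ}
    (hSR : ∀ j ∈ S, |fermiMatsubara β j| ≤ 8 * e₀ * (4 : ℝ) ^ h) {Θ : ℝ} (hΘ : 0 ≤ Θ)
    (hray : ∀ θ : ℝ, ‖∑ j ∈ S, ∫ ρ in Ioo 0 (3 * π / 4), (ρ : ℂ) *
        ((bgmShell e₀ μ E h (fermiMatsubara β j, ρ • dir θ) : ℝ) : ℂ) /
          bgmDenom μ E (h - 1) (fermiMatsubara β j, ρ • dir θ)‖ ≤ S.card * Θ) :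
    ‖∑ j ∈ S, ∫ k in zoneSq, ((bgmSectorFn e₀ μ E h m ω (fermiMatsubara β j, k + p) : ℝ) : ℂ) /
        bgmDenom μ E (h - 1) (fermiMatsubara β j, k + p)‖ ≤ S.card * Θ * (3 / 2 * sectorWidth m) := by
  rw [Finset.sum_congr rfl fun j hj =>
    sectorTerm_eq_angular hI hSy hS he hβpos hh₁ hh₀ hU hUh hμ₂ hK₀ hK₂ hδ₀b ht1b hp m ω (hSR j hj)]
  -- integrability of the angular integrands
  have hAint : ∀ j ∈ S, IntegrableOn (fun θ => ((sectorWeightCirc m ω θ : ℝ) : ℂ) *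
      ∫ ρ in Ioo 0 (3 * π / 4), (ρ : ℂ) * ((bgmShell e₀ μ E h (fermiMatsubara β j, ρ • dir θ) : ℝ) : ℂ) /
        bgmDenom μ E (h - 1) (fermiMatsubara β j, ρ • dir θ)) (Ioo (-π) π) := by
    intro j _
    have h1 := integrableOn_inner (integrableOn_polarIntegrand (μ := μ) hS he hh₁ hh₀ hU hUh hK₀ m ω j
      (show (0 : ℝ) < 3 * π / 4 by positivity))
    refine h1.congr_fun (fun θ _ => ?_) measurableSet_Ioo
    simp only [← integral_const_mul]
  rw [← integral_finsetSum S hAint]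
  simp_rw [← Finset.mul_sum]
  have hζint : IntegrableOn (fun θ => sectorWeightCirc m ω θ * (S.card * Θ)) (Ioo (-π) π) :=
    (((contDiff_sectorWeightCirc m ω (m := 0)).continuous.mul continuous_const).integrableOn_Icc).mono_set
      Ioo_subset_Icc_self
  have hpt : ∀ θ : ℝ, ‖((sectorWeightCirc m ω θ : ℝ) : ℂ) * ∑ j ∈ S, ∫ ρ in Ioo 0 (3 * π / 4), (ρ : ℂ) *
      ((bgmShell e₀ μ E h (fermiMatsubara β j, ρ • dir θ) : ℝ) : ℂ) /
        bgmDenom μ E (h - 1) (fermiMatsubara β j, ρ • dir θ)‖ ≤ sectorWeightCirc m ω θ * (S.card * Θ) := by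
    intro θ
    rw [norm_mul, Complex.norm_real, Real.norm_eq_abs, abs_of_nonneg (sectorWeightCirc_nonneg _ _ _)]
    exact mul_le_mul_of_nonneg_left (hray θ) (sectorWeightCirc_nonneg _ _ _)
  refine (norm_integral_le_of_norm_le hζint (Eventually.of_forall hpt)).trans ?_
  rw [integral_mul_const]
  calc (∫ θ in Ioo (-π) π, sectorWeightCirc m ω θ) * (S.card * Θ)
      ≤ (3 / 2 * sectorWidth m) * (S.card * Θ) :=
        mul_le_mul_of_nonneg_right (setIntegral_sectorWeightCirc_le m ω) (by positivity)
    _ = S.card * Θ * (3 / 2 * sectorWidth m) := mul_comm _ _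

/-- **The improved bound below the threshold**: if at every angle the symmetric Matsubara sum of the
radial integrals is `≤ #S·Θ` then `|g(0)| ≤ (1/β)#S·Θ·(3/2)(π/2^m)/(2π)² ≤ 12e₀γ^hΘ·(π/2^m)/π³`.
[cite: BenfattoGiulianiMastropietro2006, §2.5 (2.56a)–(2.57) p0011:L40–L100] -/
theorem norm_bgmGenProp_zero_le_fine (hI : BGMInitial E) (hSy : BGMSymmetry E) (hS : BGMSmoothness β U C hβ E)
    (he : 0 < e₀) (hβpos : 0 < β) (hh₁ : hβ ≤ h) (hh₀ : h ≤ 0) (hU : |U| ≤ c₀) (hUh : |U| * |(hβ : ℝ)| ≤ c₀)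
    (hμ₁ : -4 < μ) (hμ₂ : μ < -2 - Real.sqrt 2)
    (hK₀ : |C 0| * c₀ ≤ 3 / 16 * e₀) (hK₁ : 2 * |C 1| * c₀ ^ 2 ≤ 1 / 2)
    (hK₂ : 4 * |C 2| * c₀ ^ 2 * (64 * e₀) ≤ 1)
    (hK₂' : 2 * (4 * |C 2| * c₀ ^ 2) * (2 * |C 0| * c₀ + 2 * e₀) ≤ 1)
    (hδ₀a : 2 * |C 0| * c₀ ≤ (μ + 4) / 8) (hδ₀b : 2 * |C 0| * c₀ ≤ (-2 - Real.sqrt 2 - μ) / 4)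
    (ht1b : 3 * e₀ * (4 : ℝ) ^ h ≤ (-2 - Real.sqrt 2 - μ) / 4)
    {Θ : ℝ} (hΘ : 0 ≤ Θ)
    (hray : ∀ (θ : ℝ) (S : Finset ℤ), (∀ j ∈ S, -1 - j ∈ S) →
      (∀ j ∈ S, |fermiMatsubara β j| ≤ 8 * e₀ * (4 : ℝ) ^ h) →
      ‖∑ j ∈ S, ∫ ρ in Ioo 0 (3 * π / 4), (ρ : ℂ) *
        ((bgmShell e₀ μ E h (fermiMatsubara β j, ρ • dir θ) : ℝ) : ℂ) /
          bgmDenom μ E (h - 1) (fermiMatsubara β j, ρ • dir θ)‖ ≤ S.card * Θ)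
    (m ω : ℕ) :
    ‖bgmGenProp β e₀ μ E h m ω 0 0‖ ≤ 12 * e₀ * (4 : ℝ) ^ h * Θ * sectorWidth m / π ^ 3 := by
  have hπ := Real.pi_pos
  have h4 : (0 : ℝ) < (4 : ℝ) ^ h := zpow_pos (by norm_num) _
  obtain ⟨S, hSR, hmem, hSsym⟩ := exists_matsubara_box hβpos (8 * e₀ * (4 : ℝ) ^ h)
  -- the Fermi point of the sector centre lies in the disc `|p_i| < π/4`
  have hpFi : ∀ i, |(levelRadius (bgmEffDisp β E h) μ (sectorCenter m ω) • dir (sectorCenter m ω)) i| < π / 4 := by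
    obtain ⟨hε2, h0', -, -⟩ := bgmEffDisp_perturbation hI hS hh₁ hh₀
    have hc₀ : 0 ≤ c₀ := (abs_nonneg U).trans hU
    have h0 : ∀ k, |bgmEffDisp β E h k - sqDispersion k| ≤ 2 * |C 0| * c₀ := fun k =>
      (h0' k).trans (by gcongr)
    have hc'pos : 0 < Real.sqrt ((μ + 4) / 2) := Real.sqrt_pos.2 (by linarith)
    have hc'sq : Real.sqrt ((μ + 4) / 2) ^ 2 = (μ + 4) / 2 := Real.sq_sqrt (by linarith)
    have hcδ : 2 * (0 : ℝ) < 4 / π * Real.sqrt ((μ + 4) / 2) := by rw [mul_zero]; positivity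
    have hlev : μ ∈ Ioo (Real.sqrt ((μ + 4) / 2) ^ 2 + 2 * |C 0| * c₀ - 4)
        (-2 - Real.sqrt 2 - 2 * |C 0| * c₀) := by
      rw [hc'sq]; constructor <;> linarith
    obtain ⟨hroot, -, huK, hK⟩ := levelRadius_bounds hε2 h0 le_rfl hcδ hlev (sectorCenter m ω)
    intro i
    refine (abs_smul_dir_apply_le'' _ _ i).trans_lt ?_
    rw [abs_of_nonneg hroot.1.1]; exact lt_of_le_of_lt huK hK
  rw [bgmGenProp_zero_eq_sum hI hSy hS he hβpos hh₁ hh₀ hU hUh hK₀ hK₁ hK₂' m ω hmem, ← Finset.sum_div, norm_mul,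
    norm_div, Complex.norm_real, Complex.norm_real, Real.norm_eq_abs, Real.norm_eq_abs,
    abs_of_pos (by positivity : (0 : ℝ) < 1 / β), abs_of_pos (by positivity : (0 : ℝ) < (2 * π) ^ 2)]
  have hsum := norm_sum_sectorTerm_le hI hSy hS he hβpos hh₁ hh₀ hU hUh hμ₂ hK₀ hK₂ hδ₀b ht1b hpFi m ω hSR hΘ
    fun θ => hray θ S hSsym hSR
  have hβS := inv_beta_mul_card_le hβpos (by positivity) S hSR
  have hw := (sectorWidth_pos m).le
  refine (mul_le_mul_of_nonneg_left (div_le_div_of_nonneg_right hsum (by positivity)) (by positivity)).trans ?_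
  calc 1 / β * (S.card * Θ * (3 / 2 * sectorWidth m) / (2 * π) ^ 2)
      = (1 / β * S.card) * (Θ * (3 / 2 * sectorWidth m) / (2 * π) ^ 2) := by ring
    _ ≤ (4 * (8 * e₀ * (4 : ℝ) ^ h) / π) * (Θ * (3 / 2 * sectorWidth m) / (2 * π) ^ 2) :=
        mul_le_mul_of_nonneg_right hβS (by positivity)
    _ = 12 * e₀ * (4 : ℝ) ^ h * Θ * sectorWidth m / π ^ 3 := by field_simp; ring

/-- Small positive constants: a continuous constraint vanishing at `0` holds near `0⁺`. [folklore] -/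
private theorem eventually_le_of_continuous {f : ℝ → ℝ} (hf : Continuous f) (h0 : f 0 = 0) {b : ℝ}
    (hb : 0 < b) : ∀ᶠ c in 𝓝[>] (0 : ℝ), f c ≤ b :=
  ((hf.tendsto' 0 0 h0).eventually_le_const hb).filter_mono nhdsWithin_le_nhds

/-- Strict version of `eventually_le_of_continuous`. [folklore] -/
private theorem eventually_lt_of_continuous {f : ℝ → ℝ} (hf : Continuous f) (h0 : f 0 = 0) {b : ℝ}
    (hb : 0 < b) : ∀ᶠ c in 𝓝[>] (0 : ℝ), f c < b :=
  ((hf.tendsto' 0 0 h0).eventually_lt_const hb).filter_mono nhdsWithin_le_nhds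

/-- **The dimensional and the improved bound for the sector propagators at `x = 0`** — the common
content of Lemmas 2.2a/2.2b with the angular index `m` free: there are `c₀, τ > 0` and `K` (depending
on `μ, e₀` and the constants `C` of (2.36)) such that under (2.36) with `|U| ≤ c₀`, `|U||h_β| ≤ c₀`,
for every scale `h_β ≤ h ≤ 0` and every `m, ω`: `|g(0)| ≤ 512/π`, and `|g(0)| ≤ Kγ^{2h}·(π/2^m)` as
soon as `γ^h ≤ τ`. [cite: BenfattoGiulianiMastropietro2006, §2.5 Lemma 2.2a (2.56a), Lemma 2.2b (2.60a) p0011:L40–L96, p0012:L14] -/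
theorem norm_bgmGenProp_zero_le {μ e₀ : ℝ} (hμ₁ : -4 < μ) (hμ₂ : μ < -2 - Real.sqrt 2)
    (he₀ : BGMAdmissibleE0 μ e₀) (C : ℕ → ℝ) :
    ∃ c₀ τ K : ℝ, 0 < c₀ ∧ 0 < τ ∧ 0 ≤ K ∧
    ∀ (β U : ℝ) (hβ : ℤ), 0 < β → hβ ≤ 0 → |U| ≤ c₀ → |U| * |(hβ : ℝ)| ≤ c₀ →
    ∀ E : ℤ → ℝ × (Fin 2 → ℝ) → ℂ, BGMInitial E → BGMSymmetry E → BGMSmoothness β U C hβ E →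
    ∀ h : ℤ, hβ ≤ h → h ≤ 0 → ∀ (m ω : ℕ),
      ‖bgmGenProp β e₀ μ E h m ω 0 0‖ ≤ 512 / π ∧
      ((4 : ℝ) ^ h ≤ τ → ‖bgmGenProp β e₀ μ E h m ω 0 0‖ ≤ K * (4 : ℝ) ^ (2 * h) * sectorWidth m) := by
  have he : 0 < e₀ := he₀.1
  have hπ := Real.pi_pos
  have hμ4 : 0 < μ + 4 := by linarith
  have hgap : 0 < -2 - Real.sqrt 2 - μ := by linarith
  have hc' : 0 < Real.sqrt ((μ + 4) / 2) := Real.sqrt_pos.2 (by linarith)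
  have hc'ne : Real.sqrt ((μ + 4) / 2) ≠ 0 := hc'.ne'
  obtain ⟨L, hL0, hL⟩ := exists_lipschitz_gnCutoff he
  -- the coupled-smallness constant `c₀`: nine polynomial constraints vanishing at `c₀ = 0`
  obtain ⟨c₀, ⟨hc1, hK₀, hK₁, hK₂, hδ₂, hδ₀a, hδ₀b, hδ₁, hK₂'⟩, hc₀pos⟩ :
      ∃ c₀ : ℝ, (c₀ ≤ 1 ∧ |C 0| * c₀ ≤ 3 / 16 * e₀ ∧ 2 * |C 1| * c₀ ^ 2 ≤ 1 / 2 ∧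
        4 * |C 2| * c₀ ^ 2 * (64 * e₀) ≤ 1 ∧ |C 2| * c₀ ^ 2 ≤ 1 / 4 ∧ 2 * |C 0| * c₀ ≤ (μ + 4) / 8 ∧
        2 * |C 0| * c₀ ≤ (-2 - Real.sqrt 2 - μ) / 4 ∧ 2 * |C 1| * c₀ ^ 2 ≤ Real.sqrt ((μ + 4) / 2) / 4 ∧
        2 * (4 * |C 2| * c₀ ^ 2) * (2 * |C 0| * c₀ + 2 * e₀) ≤ 1) ∧ 0 < c₀ :=
    (((eventually_le_of_continuous (f := fun c => c) continuous_id rfl one_pos).and <|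
      (eventually_le_of_continuous (f := fun c => |C 0| * c) (by fun_prop) (by simp) (by positivity)).and <|
      (eventually_le_of_continuous (f := fun c => 2 * |C 1| * c ^ 2) (by fun_prop) (by simp) (by norm_num)).and <|
      (eventually_le_of_continuous (f := fun c => 4 * |C 2| * c ^ 2 * (64 * e₀)) (by fun_prop) (by simp)
        one_pos).and <|
      (eventually_le_of_continuous (f := fun c => |C 2| * c ^ 2) (by fun_prop) (by simp) (by norm_num)).and <|
      (eventually_le_of_continuous (f := fun c => 2 * |C 0| * c) (by fun_prop) (by simp)
        (by linarith : (0 : ℝ) < (μ + 4) / 8)).and <|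
      (eventually_le_of_continuous (f := fun c => 2 * |C 0| * c) (by fun_prop) (by simp)
        (by linarith : (0 : ℝ) < (-2 - Real.sqrt 2 - μ) / 4)).and <|
      (eventually_le_of_continuous (f := fun c => 2 * |C 1| * c ^ 2) (by fun_prop) (by simp)
        (div_pos hc' (by norm_num))).and <|
      (eventually_le_of_continuous (f := fun c => 2 * (4 * |C 2| * c ^ 2) * (2 * |C 0| * c + 2 * e₀))
        (by fun_prop) (by simp) one_pos)).and eventually_mem_nhdsWithin).exists
  -- the threshold `τ`: four constraints vanishing at `τ = 0`
  obtain ⟨CΔ, hCΔ⟩ : ∃ x : ℝ, x = 384 * |C 2| * c₀ ^ 2 * e₀ ^ 2 / Real.sqrt ((μ + 4) / 2) + |C 0| * c₀ +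
      108 * e₀ ^ 2 / (Real.sqrt ((μ + 4) / 2)) ^ 2 + 128 * |C 2| * c₀ ^ 2 * e₀ ^ 2 := ⟨_, rfl⟩
  have hCΔ0 : 0 ≤ CΔ := by rw [hCΔ]; positivity
  obtain ⟨τ, ⟨ht1a, ht1b, ht2, ht5⟩, hτpos⟩ : ∃ τ : ℝ, (3 * e₀ * τ ≤ (μ + 4) / 8 ∧
      3 * e₀ * τ ≤ (-2 - Real.sqrt 2 - μ) / 4 ∧
      6 * e₀ * τ / Real.sqrt ((μ + 4) / 2) < Real.sqrt ((μ + 4) / 2) ∧ CΔ * τ ≤ e₀ / 32) ∧ 0 < τ :=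
    (((eventually_le_of_continuous (f := fun t => 3 * e₀ * t) (by fun_prop) (by simp)
        (by linarith : (0 : ℝ) < (μ + 4) / 8)).and <|
      (eventually_le_of_continuous (f := fun t => 3 * e₀ * t) (by fun_prop) (by simp)
        (by linarith : (0 : ℝ) < (-2 - Real.sqrt 2 - μ) / 4)).and <|
      (eventually_lt_of_continuous (f := fun t => 6 * e₀ * t / Real.sqrt ((μ + 4) / 2)) (by fun_prop) (by simp)
        hc').and <|
      (eventually_le_of_continuous (f := fun t => CΔ * t) (by fun_prop) (by simp) (by positivity))).and
      eventually_mem_nhdsWithin).exists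
  -- the per-angle constant and `K`
  obtain ⟨Θc, hΘc⟩ : ∃ x : ℝ, x = 192 / Real.sqrt ((μ + 4) / 2) +
      (192 * (3 * π / 4) * L / e₀ + 1024 * (3 * π / 4) / e₀ ^ 2) * CΔ := ⟨_, rfl⟩
  have hΘc0 : 0 ≤ Θc := by rw [hΘc]; positivity
  refine ⟨c₀, τ, 12 * e₀ * (Θc * (12 * e₀ / Real.sqrt ((μ + 4) / 2))) / π ^ 3, hc₀pos, hτpos, by positivity, ?_⟩
  intro β U hβ hβpos hhβ hU hUh E hI hSy hS h hh₁ hh₀ m ω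
  have h4 : (0 : ℝ) < (4 : ℝ) ^ h := zpow_pos (by norm_num) _
  refine ⟨norm_bgmGenProp_zero_le_crude hI hSy hS he hβpos hh₁ hh₀ hU hUh hK₀ hK₁ hK₂' m ω, fun hτ => ?_⟩
  -- the thresholds at scale `h`
  have hmon : 3 * e₀ * (4 : ℝ) ^ h ≤ 3 * e₀ * τ := mul_le_mul_of_nonneg_left hτ (by positivity)
  have ht1a' := hmon.trans ht1a
  have ht1b' := hmon.trans ht1b
  have ht2' : 6 * e₀ * (4 : ℝ) ^ h / Real.sqrt ((μ + 4) / 2) < Real.sqrt ((μ + 4) / 2) :=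
    lt_of_le_of_lt (div_le_div_of_nonneg_right (mul_le_mul_of_nonneg_left hτ (by positivity)) hc'.le) ht2
  have ht5' : CΔ * (4 : ℝ) ^ (2 * h) ≤ e₀ * (4 : ℝ) ^ (h - 2) / 2 := by
    rw [two_mul, zpow_add₀ (by norm_num : (4 : ℝ) ≠ 0), four_zpow_sub_two]
    have h1 : CΔ * (4 : ℝ) ^ h ≤ CΔ * τ := mul_le_mul_of_nonneg_left hτ hCΔ0
    calc CΔ * ((4 : ℝ) ^ h * (4 : ℝ) ^ h) = (CΔ * (4 : ℝ) ^ h) * (4 : ℝ) ^ h := by ring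
      _ ≤ (e₀ / 32) * (4 : ℝ) ^ h := mul_le_mul_of_nonneg_right (h1.trans ht5) h4.le
      _ = e₀ * ((4 : ℝ) ^ h / 16) / 2 := by ring
  have hfine := norm_bgmGenProp_zero_le_fine hI hSy hS he hβpos hh₁ hh₀ hU hUh hμ₁ hμ₂ hK₀ hK₁ hK₂ hK₂' hδ₀a
    hδ₀b ht1b' (Θ := Θc * (2 * (6 * e₀ * (4 : ℝ) ^ h / Real.sqrt ((μ + 4) / 2)))) (by positivity)
    (fun θ S hSsym hSR => by
      have := norm_sum_ray_integral_le hI hSy hS he hβpos hh₁ hh₀ hU hUh hμ₁ hμ₂ hK₀ hK₂ hδ₂ hδ₀a hδ₀b hδ₁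
        ht1a' ht1b' ht2' (by rw [← hCΔ]; exact ht5') hL hL0 θ hSsym hSR
      rw [← hCΔ, ← hΘc] at this
      exact this) m ω
  refine hfine.trans (le_of_eq ?_)
  rw [two_mul h, zpow_add₀ (by norm_num : (4 : ℝ) ≠ 0)]
  field_simp
  ring

end Assembly

/-- `γ^{2h}·(π/2^n) = π·2^{5h}` for `n = -h` (anisotropic sectors, `γ = 4`). [folklore] -/
private theorem zpow_sectorWidth_aniso {h : ℤ} (hh : h ≤ 0) :
    (4 : ℝ) ^ (2 * h) * sectorWidth (bgmScaleIdx h) = π * (2 : ℝ) ^ (5 * h) := by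
  have hn : ((bgmScaleIdx h : ℕ) : ℤ) = -h := by simp [bgmScaleIdx, Int.toNat_of_nonneg (neg_nonneg.2 hh)]
  rw [sectorWidth, ← zpow_natCast, hn, show (4 : ℝ) = (2 : ℝ) ^ (2 : ℤ) by norm_num, ← zpow_mul,
    show (5 : ℤ) * h = 2 * (2 * h) + h by ring, zpow_add₀ (by norm_num : (2 : ℝ) ≠ 0) (2 * (2 * h)) h, zpow_neg]
  field_simp

/-- `γ^{2h}·(π/2^{2n}) = π·4^{3h}` for `n = -h` (isotropic sectors). [folklore] -/
private theorem zpow_sectorWidth_iso {h : ℤ} (hh : h ≤ 0) :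
    (4 : ℝ) ^ (2 * h) * sectorWidth (2 * bgmScaleIdx h) = π * (4 : ℝ) ^ (3 * h) := by
  have hn : ((bgmScaleIdx h : ℕ) : ℤ) = -h := by simp [bgmScaleIdx, Int.toNat_of_nonneg (neg_nonneg.2 hh)]
  rw [sectorWidth, pow_mul, show (2 : ℝ) ^ 2 = 4 by norm_num, ← zpow_natCast, hn]
  rw [show (3 : ℤ) * h = 2 * h + h by ring, zpow_add₀ (by norm_num : (4 : ℝ) ≠ 0) (2 * h) h, zpow_neg]
  field_simp

/-- **BGM 2006 Lemma 2.2a — PROVED** (discharge of the named fact `BGM2006_Lemma_2_2a`, FACT-LIST F-003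
of the cell gate-hubbard-kl): the tadpole value of the anisotropic sector propagator of the moving
dispersion at inverse temperature `β` obeys `|g^{(h)}_ω(0)| ≤ C'γ^{5h/2}`, `γ^{5h/2} = 2^{5h}`, uniformly
in `β`, `ω`, the dispersion family and `h_β ≤ h ≤ 0`.  Proof as printed ((2.56b)–(2.56e): polar
coordinates, (2.43), the shell `f̃_h`, the `O(γ^h)` replacements and "zero by oddity"), the oddity being
the Matsubara reflection `j ↦ -1-j` composed with the reflection of the radial variable about the
scale-`h` Fermi radius. [cite: BenfattoGiulianiMastropietro2006, §2.5 Lemma 2.2a (2.56a) and its proof p0011:L40–L96] -/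
theorem BGM2006_Lemma_2_2a_holds : BGM2006_Lemma_2_2a := by
  intro μ e₀ hμ₁ hμ₂ he₀ C
  obtain ⟨c₀, τ, K, hc₀, hτ, hK, hmain⟩ := norm_bgmGenProp_zero_le hμ₁ hμ₂ he₀ C
  obtain ⟨N, hN⟩ : ∃ N : ℕ, ((1 : ℝ) / 4) ^ N < τ := exists_pow_lt_of_lt_one hτ (by norm_num)
  refine ⟨c₀, max (K * π) (512 / π * (2 : ℝ) ^ (5 * N)), hc₀, ?_⟩
  intro β U₀ U hβ hβpos hhβ hU hc E hI hSy hS h hh₁ hh₀ ω _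
  obtain ⟨U', hS', hU1, hU2⟩ := bgmSmoothness_wlog hS hhβ hU hc hc₀.le
  obtain ⟨hcrude, hfine⟩ := hmain β U' hβ hβpos hhβ hU1 hU2 E hI hSy hS' h hh₁ hh₀ (bgmScaleIdx h) ω
  have h2pos : (0 : ℝ) < (2 : ℝ) ^ (5 * h) := zpow_pos (by norm_num) _
  change ‖bgmGenProp β e₀ μ E h (bgmScaleIdx h) ω 0 0‖ ≤ _
  by_cases hcase : h ≤ -(N : ℤ)
  · have h4τ : (4 : ℝ) ^ h ≤ τ := by
      refine le_trans ?_ hN.le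
      rw [one_div, inv_pow, ← zpow_natCast, ← zpow_neg]
      exact zpow_le_zpow_right₀ (by norm_num) (by omega)
    have h1 := hfine h4τ
    rw [mul_assoc, zpow_sectorWidth_aniso hh₀] at h1
    calc _ ≤ K * (π * (2 : ℝ) ^ (5 * h)) := h1
      _ = (K * π) * (2 : ℝ) ^ (5 * h) := by ring
      _ ≤ max (K * π) (512 / π * (2 : ℝ) ^ (5 * N)) * (2 : ℝ) ^ (5 * h) :=
          mul_le_mul_of_nonneg_right (le_max_left _ _) h2pos.le
  · have hN1 : (1 : ℝ) ≤ (2 : ℝ) ^ (5 * N) * (2 : ℝ) ^ (5 * h) := by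
      rw [← zpow_natCast, ← zpow_add₀ (by norm_num : (2 : ℝ) ≠ 0)]
      exact one_le_zpow₀ (by norm_num) (by push_cast; omega)
    calc _ ≤ 512 / π := hcrude
      _ ≤ 512 / π * ((2 : ℝ) ^ (5 * N) * (2 : ℝ) ^ (5 * h)) := le_mul_of_one_le_right (by positivity) hN1
      _ = (512 / π * (2 : ℝ) ^ (5 * N)) * (2 : ℝ) ^ (5 * h) := by ring
      _ ≤ max (K * π) (512 / π * (2 : ℝ) ^ (5 * N)) * (2 : ℝ) ^ (5 * h) :=
          mul_le_mul_of_nonneg_right (le_max_right _ _) h2pos.le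

/-- **BGM 2006 Lemma 2.2b — PROVED** (discharge of the named fact `BGM2006_Lemma_2_2b`, FACT-LIST F-005
of the cell gate-hubbard-kl): the tadpole value of the ISOTROPIC sector propagator (angular width `πγ^h`)
obeys `|ḡ^{(h)}_ω̄(0)| ≤ C'γ^{3h}` — "to be proven via a repetition of the proof of Lemma 2.2a": the same
two-index estimate with the sector width `(3/2)πγ^h` in place of `(3/2)πγ^{h/2}`. [cite: BenfattoGiulianiMastropietro2006, §2.5 Lemma 2.2b (2.60a) p0012:L14–L18] -/
theorem BGM2006_Lemma_2_2b_holds : BGM2006_Lemma_2_2b := by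
  intro μ e₀ hμ₁ hμ₂ he₀ C
  obtain ⟨c₀, τ, K, hc₀, hτ, hK, hmain⟩ := norm_bgmGenProp_zero_le hμ₁ hμ₂ he₀ C
  obtain ⟨N, hN⟩ : ∃ N : ℕ, ((1 : ℝ) / 4) ^ N < τ := exists_pow_lt_of_lt_one hτ (by norm_num)
  refine ⟨c₀, max (K * π) (512 / π * (4 : ℝ) ^ (3 * N)), hc₀, ?_⟩
  intro β U₀ U hβ hβpos hhβ hU hc E hI hSy hS h hh₁ hh₀ ω _
  obtain ⟨U', hS', hU1, hU2⟩ := bgmSmoothness_wlog hS hhβ hU hc hc₀.le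
  obtain ⟨hcrude, hfine⟩ := hmain β U' hβ hβpos hhβ hU1 hU2 E hI hSy hS' h hh₁ hh₀ (2 * bgmScaleIdx h) ω
  have h4pos : (0 : ℝ) < (4 : ℝ) ^ (3 * h) := zpow_pos (by norm_num) _
  change ‖bgmGenProp β e₀ μ E h (2 * bgmScaleIdx h) ω 0 0‖ ≤ _
  by_cases hcase : h ≤ -(N : ℤ)
  · have h4τ : (4 : ℝ) ^ h ≤ τ := by
      refine le_trans ?_ hN.le
      rw [one_div, inv_pow, ← zpow_natCast, ← zpow_neg]
      exact zpow_le_zpow_right₀ (by norm_num) (by omega)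
    have h1 := hfine h4τ
    rw [mul_assoc, zpow_sectorWidth_iso hh₀] at h1
    calc _ ≤ K * (π * (4 : ℝ) ^ (3 * h)) := h1
      _ = (K * π) * (4 : ℝ) ^ (3 * h) := by ring
      _ ≤ max (K * π) (512 / π * (4 : ℝ) ^ (3 * N)) * (4 : ℝ) ^ (3 * h) :=
          mul_le_mul_of_nonneg_right (le_max_left _ _) h4pos.le
  · have hN1 : (1 : ℝ) ≤ (4 : ℝ) ^ (3 * N) * (4 : ℝ) ^ (3 * h) := by
      rw [← zpow_natCast, ← zpow_add₀ (by norm_num : (4 : ℝ) ≠ 0)]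
      exact one_le_zpow₀ (by norm_num) (by push_cast; omega)
    calc _ ≤ 512 / π := hcrude
      _ ≤ 512 / π * ((4 : ℝ) ^ (3 * N) * (4 : ℝ) ^ (3 * h)) := le_mul_of_one_le_right (by positivity) hN1
      _ = (512 / π * (4 : ℝ) ^ (3 * N)) * (4 : ℝ) ^ (3 * h) := by ring
      _ ≤ max (K * π) (512 / π * (4 : ℝ) ^ (3 * N)) * (4 : ℝ) ^ (3 * h) :=
          mul_le_mul_of_nonneg_right (le_max_right _ _) h4pos.le






end Literature.MathematicalPhysics.QuantumLattice.FermiRG
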